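import Literature.Probability.RandomPlanarGeometry.HexSAWPolygonJoinAssembly
import Literature.Probability.RandomPlanarGeometry.HexSAWPolygonJoinDecode
import Literature.Probability.RandomPlanarGeometry.SAWPolygonTraversal
import Literature.Probability.RandomPlanarGeometry.HexSAWPolygonHorizontalCutShapes
import HarnessLib

/-!
# Junction uniqueness for the capless Madras join on `ℍ`, type T3 (`JU3`): the horizontal double brick is determined by the joined polygon

Topic `Literature/Probability/RandomPlanarGeometry` (lane «pcv-sawmu», a-p4 g14; stub E5a of LINE «HEX-MADRAS», fourth of the five junction
types of `HexSAWPolygonJoinAssembly.JunctionUnique`; pattern of `HexSAWPolygonJunctionUniqueT2` (`ju2`); imports only the assembly, the tree's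
`JoinDecode` / `Traversal`, and the cut predicates — independent of the JU1/JU2/JU4 files).

A T3 decomposition `(P, Q, t)` of `J = hdJoin t P Q` (contact site `t` of `P`, bond `t – b`, `b = t − (1,0)`; facing site `w′ = t + (2,1)` of `Q`,
bond `c – w′`, `c = t + (3,1)`; `t₀ + t₁` odd) comes in four shapes according to the bits `t + (−1,1) ∈ P` (then `b` drops out of `J`) and
`t + (3,0) ∈ Q` (then `c` drops out of `J`).  In each shape the decomposition forces EVERY traversal of `J` (`SAWPolygonTraversal.IsPolyTraversal`)
entering the first site of the left block (`b`, or `t + (−1,1)`) from the last site of the right block (`t + (−1,1)`, or `t + (0,1)`) to read the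
`P`-arc, the lower connector `t+(1,0), t+(2,0)[, t+(3,0)]`, the `Q`-arc and the upper connector `t+(1,1), t+(0,1)[, t+(−1,1)]` in this order — the
forward horizontal cut of `HexSAWPolygonHorizontalCut(Shapes)` (`IsHdCut`, `IsHdCutTF`, `IsHdCutFT`, `IsHdCutTT`) — and a traversal crossing
that bond the other way to read the backward cut.  Two T3 decompositions OF THE SAME SHAPE of one polygon then give two cuts on one traversal:
equal by `isHdCut*_unique`, or impossible by `not_isHdCut*'_of_isHdCut*`.  (`JU3` carries the two bits as shared hypotheses, so only
same-shape uniqueness is needed.)  Translations: even ones transport the whole frame; an odd one would translate the vertical bond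
`t – t−(0,1)` of `P ⊆ J` to a non-bond of the brick wall.

## Main statements (namespace `…SAW.HexBW.Assembly`)
* `isHdCut_of_isT3` / `isHdCut'_of_isT3` (shape FF), `isHdCutTF_of_isT3` / `isHdCutTF'_of_isT3`, `isHdCutFT_of_isT3` / `isHdCutFT'_of_isT3`,
  `isHdCutTT_of_isT3` / `isHdCutTT'_of_isT3` — the bridge, four shapes, both orientations;
* `hdJoin_site_unique` — same polygon, two T3 decompositions with the same bits ⇒ same contact site;
* `isT3_shift`, `hdJoin_shift` — covariance under (even) translations; **`ju3 : JU3`**.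
[cite: Hammond2015SAPJoining, Definition 4.3 p. 20 and §4.2 pp. 20–24 (arXiv v5: the junction plaquette of the Madras join is recognisable)]
[cite: Madras1995LatticeAnimalsExponent, §2 (primary, not held)] [cite: MadrasSlade1993, Definition 3.2.1 p. 62; Theorem 3.2.3 proof pp. 64–65].
-/

noncomputable section

open SimpleGraph Finset Literature.Probability.LatticeModels Literature.Probability.Percolation
open Literature.Barriers.CriticalPhenomena.SupercriticalSAW (shiftEdges card_shiftEdges mem_shiftEdges_iff shiftEdges_injective)
open Literature.Probability.Percolation.SiteGadgetSystem (vertsOf mem_vertsOf)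

namespace Literature.Probability.RandomPlanarGeometry.SAW

namespace HexBW

namespace Assembly

variable {P Q : Finset (Sym2 (Site 2))} {t : Site 2} {n : ℕ} {u : ℕ → Site 2}

/-! ### Plumbing -/

/-- `![a, b] 0 = a` (private plumbing). [folklore] -/
@[simp] private theorem uy0 (a b : ℤ) : (![a, b] : Site 2) 0 = a := rfl
/-- `![a, b] 1 = b` (private plumbing). [folklore] -/
@[simp] private theorem uy1 (a b : ℤ) : (![a, b] : Site 2) 1 = b := rfl

/-- the next site of a traversal at a vertex with two known polygon bonds (private plumbing). [cite: MadrasSlade1993, Definition 3.2.1 p. 62 (degree two)] -/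
private theorem next_eq₃ {E : Finset (Sym2 (Site 2))} {L : ℕ} (hu : IsPolyTraversal brickWallGraph E L u) (hE : IsPolygon brickWallGraph E)
    {i : ℕ} {x y : Site 2} (hx : s(u (i + 1), x) ∈ E) (hy : s(u (i + 1), y) ∈ E) (hxy : x ≠ y) (hprev : u i = x) :
    u (i + 2) = y := by
  have hm : s(u (i + 1), u (i + 1 + 1)) ∈ E := hu.mem (i + 1)
  rcases hE.eq_or_eq_of_mem hx hy hxy hm with h | h
  · exact absurd (h.trans hprev.symm) (hu.ne_succ_succ i)
  · exact h

/-- two distinct offsets give distinct sites (private plumbing). [folklore] -/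
private theorem off_ne₃ {a b c d : ℤ} (h : (a, b) ≠ (c, d)) : t + ![a, b] ≠ t + ![c, d] := by
  intro he
  have h0 := congrArg (fun z : Site 2 => z 0) he
  have h1 := congrArg (fun z : Site 2 => z 1) he
  simp at h0 h1
  exact h (Prod.ext h0 h1)

/-- a site with prescribed offsets from `t` (private plumbing). [folklore] -/
private theorem eq_off₃ {x : Site 2} {a b : ℤ} (h0 : x 0 = t 0 + a) (h1 : x 1 = t 1 + b) : x = t + ![a, b] := by
  ext k; fin_cases k <;> simp [h0, h1]

/-- coordinates of a site given by an offset (private plumbing). [folklore] -/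
private theorem coord_of_eq₃ {x p : Site 2} {a b : ℤ} (h : x = p + ![a, b]) : x 0 = p 0 + a ∧ x 1 = p 1 + b := by
  subst h; exact ⟨by simp, by simp⟩

/-- two bonds with different offset endpoints differ (private plumbing). [folklore] -/
private theorem sne₃ {a b c d e f g k : ℤ} (h1 : (c, d) ≠ (g, k) ∨ (a, b) ≠ (e, f)) (h2 : (a, b) ≠ (g, k) ∨ (c, d) ≠ (e, f)) :
    s(t + ![a, b], t + ![c, d]) ≠ s(t + ![e, f], t + ![g, k]) := by
  intro he
  rcases Sym2.eq_iff.1 he with ⟨p1, p2⟩ | ⟨p1, p2⟩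
  · rcases h1 with h | h
    · exact off_ne₃ h p2
    · exact off_ne₃ h p1
  · rcases h2 with h | h
    · exact off_ne₃ h p1
    · exact off_ne₃ h p2

/-- Horizontal bond with prescribed offsets (private plumbing). [cite: EntingJensen2009, §7.4.2, Fig. 7.10 (brickwork form of the honeycomb lattice)] -/
private theorem adjH₃ (t : Site 2) (a b c : ℤ) (h : c = a + 1 ∨ a = c + 1) :
    brickWallGraph.Adj (t + ![a, b]) (t + ![c, b]) := by
  rw [brickWallGraph_adj_coord]; left; simp; omega

/-- Vertical bond with prescribed offsets (private plumbing). [cite: EntingJensen2009, §7.4.2, Fig. 7.10 (brickwork form of the honeycomb lattice)] -/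
private theorem adjV₃ (t : Site 2) (a b d : ℤ)
    (h : (d = b + 1 ∧ (t 0 + t 1 + a + b) % 2 = 0) ∨ (b = d + 1 ∧ (t 0 + t 1 + a + d) % 2 = 0)) :
    brickWallGraph.Adj (t + ![a, b]) (t + ![a, d]) := by
  rw [brickWallGraph_adj_coord]; right
  refine ⟨by simp, ?_⟩
  simp only [Pi.add_apply, uy0, uy1]
  rcases h with ⟨h1, h2⟩ | ⟨h1, h2⟩
  · left; constructor <;> omega
  · right; constructor <;> omega

/-- The brick-wall neighbours of `t + (a,b)` (coordinate form; private plumbing). [cite: EntingJensen2009, §7.4.2, Fig. 7.10] -/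
private theorem nbr₃ (t : Site 2) (a b : ℤ) {y : Site 2} (h : brickWallGraph.Adj (t + ![a, b]) y) :
    y = t + ![a + 1, b] ∨ y = t + ![a - 1, b] ∨
      (y = t + ![a, b + 1] ∧ (t 0 + t 1 + a + b) % 2 = 0) ∨ (y = t + ![a, b - 1] ∧ (t 0 + t 1 + a + b) % 2 = 1) := by
  rw [brickWallGraph_adj_coord] at h
  simp only [Pi.add_apply, uy0, uy1] at h
  rcases h with ⟨h0 | h0, h1⟩ | ⟨h0, ⟨h1, hp⟩ | ⟨h1, hp⟩⟩
  · left; exact eq_off₃ (by omega) (by omega)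
  · right; left; exact eq_off₃ (by omega) (by omega)
  · right; right; left; exact ⟨eq_off₃ (by omega) (by omega), by omega⟩
  · right; right; right; exact ⟨eq_off₃ (by omega) (by omega), by omega⟩

/-- a site on a bond of `E` is a vertex of `E`, left slot (private plumbing). [folklore] -/
private theorem vleft₃ {E : Finset (Sym2 (Site 2))} {v w : Site 2} (h : s(v, w) ∈ E) : v ∈ vertsOf E :=
  mem_vertsOf.2 ⟨_, h, by simp⟩

/-- a site on a bond of `E` is a vertex of `E`, right slot (private plumbing). [folklore] -/
private theorem vright₃ {E : Finset (Sym2 (Site 2))} {v w : Site 2} (h : s(v, w) ∈ E) : w ∈ vertsOf E :=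
  mem_vertsOf.2 ⟨_, h, by simp⟩

/-- **Forced bonds** (degree two): a vertex of a honeycomb polygon with one lattice neighbour off the polygon has its bonds to the other two.
[cite: MadrasSlade1993, Definition 3.2.1 p. 62 (every site of a polygon has exactly two polygon bonds)] -/
private theorem cforced₃ {E : Finset (Sym2 (Site 2))} (hE : IsPolygon brickWallGraph E) {v x y z : Site 2}
    (hv : v ∈ vertsOf E) (hnb : ∀ w, brickWallGraph.Adj v w → w = x ∨ w = y ∨ w = z) (hx : x ∉ vertsOf E) :
    s(v, y) ∈ E ∧ s(v, z) ∈ E := by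
  obtain ⟨b₁, b₂, hne, h₁, h₂, a₁, a₂⟩ := hE.exists_two_edges (mem_vertsOf.1 hv)
  have hb₁ : b₁ ≠ x := fun h => hx (h ▸ vright₃ h₁)
  have hb₂ : b₂ ≠ x := fun h => hx (h ▸ vright₃ h₂)
  rcases hnb b₁ a₁ with rfl | rfl | rfl
  · exact absurd rfl hb₁
  · rcases hnb b₂ a₂ with rfl | rfl | rfl
    · exact absurd rfl hb₂
    · exact absurd rfl hne
    · exact ⟨h₁, h₂⟩
  · rcases hnb b₂ a₂ with rfl | rfl | rfl
    · exact absurd rfl hb₂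
    · exact ⟨h₂, h₁⟩
    · exact absurd rfl hne

/-- a walk's `k`-th bond (private plumbing). [folklore] -/
private theorem getVert_edge₃ {a b : Site 2} (W : brickWallGraph.Walk a b) {k : ℕ} (hk : k < W.length) :
    s(W.getVert k, W.getVert (k + 1)) ∈ W.edges := by
  have hlen : k < W.darts.length := by rw [SimpleGraph.Walk.length_darts]; exact hk
  have hd : W.darts[k] ∈ W.darts := List.getElem_mem hlen
  rw [SimpleGraph.Walk.darts_getElem_eq_getVert k hlen] at hd
  exact List.mem_map.2 ⟨_, hd, rfl⟩

/-! ### The two-step arcs through the dropped corners `b = t − (1,0)` and `c = t + (3,1)` -/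

/-- `t+(−1,1) → b → t` (private plumbing). [cite: Hammond2015SAPJoining, Definition 4.3 p. 20 (arXiv v5)] -/
private def wPf₃ (t : Site 2) (h : (t 0 + t 1) % 2 = 1) : brickWallGraph.Walk (t + ![-1, 1]) (t + ![0, 0]) :=
  Walk.cons (adjV₃ t (-1) 1 0 (Or.inr ⟨by norm_num, by omega⟩)) (Walk.cons (adjH₃ t (-1) 0 0 (by norm_num)) Walk.nil)

/-- `t → b → t+(−1,1)` (private plumbing). [cite: Hammond2015SAPJoining, Definition 4.3 p. 20 (arXiv v5)] -/
private def wPb₃ (t : Site 2) (h : (t 0 + t 1) % 2 = 1) : brickWallGraph.Walk (t + ![0, 0]) (t + ![-1, 1]) :=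
  Walk.cons (adjH₃ t 0 0 (-1) (by norm_num)) (Walk.cons (adjV₃ t (-1) 0 1 (Or.inl ⟨by norm_num, by omega⟩)) Walk.nil)

/-- `t+(3,0) → c → w′` (private plumbing). [cite: Hammond2015SAPJoining, Definition 4.3 p. 20 (arXiv v5)] -/
private def wQf₃ (t : Site 2) (h : (t 0 + t 1) % 2 = 1) : brickWallGraph.Walk (t + ![3, 0]) (t + ![2, 1]) :=
  Walk.cons (adjV₃ t 3 0 1 (Or.inl ⟨by norm_num, by omega⟩)) (Walk.cons (adjH₃ t 3 1 2 (by norm_num)) Walk.nil)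

/-- `w′ → c → t+(3,0)` (private plumbing). [cite: Hammond2015SAPJoining, Definition 4.3 p. 20 (arXiv v5)] -/
private def wQb₃ (t : Site 2) (h : (t 0 + t 1) % 2 = 1) : brickWallGraph.Walk (t + ![2, 1]) (t + ![3, 0]) :=
  Walk.cons (adjH₃ t 2 1 3 (by norm_num)) (Walk.cons (adjV₃ t 3 1 0 (Or.inr ⟨by norm_num, by omega⟩)) Walk.nil)

/-! ### The T3 frame: vertices, forced bonds, membership in the join -/

section Frame

variable (hP : IsPolygon brickWallGraph P) (hQ : IsPolygon brickWallGraph Q) (hK1 : Corridor P Q) (h : IsT3 P Q t)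
include h

/-- `t ∈ P`. [cite: Hammond2015SAPJoining, Definition 4.3 p. 20 (arXiv v5)] -/
private theorem tP₃ : t + ![0, 0] ∈ vertsOf P := vleft₃ h.hl
/-- `b ∈ P`. [cite: Hammond2015SAPJoining, Definition 4.3 p. 20 (arXiv v5)] -/
private theorem bP₃ : t + ![-1, 0] ∈ vertsOf P := vright₃ h.hl
/-- `w′ ∈ Q`. [cite: Hammond2015SAPJoining, Definition 4.3 p. 20 (arXiv v5)] -/
private theorem wQ₃ : t + ![2, 1] ∈ vertsOf Q := vright₃ h.hr
/-- `c ∈ Q`. [cite: Hammond2015SAPJoining, Definition 4.3 p. 20 (arXiv v5)] -/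
private theorem cQ₃ : t + ![3, 1] ∈ vertsOf Q := vleft₃ h.hr

include hP in
/-- the vertical bond of `t` points down and lies on `P` (its right neighbour is free). [cite: MadrasSlade1993, Definition 3.2.1 p. 62 (degree two)] -/
private theorem tdown₃ : s(t + ![0, 0], t + ![0, -1]) ∈ P := by
  have hpar := h.hpar
  refine (cforced₃ hP (x := t + ![1, 0]) (y := t + ![-1, 0]) (z := t + ![0, -1]) (tP₃ h) (fun w hw => ?_) h.f10.1).2
  rcases nbr₃ t 0 0 hw with e | e | ⟨e, hp⟩ | ⟨e, -⟩
  · exact Or.inl (by simpa using e)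
  · exact Or.inr (Or.inl (by simpa using e))
  · omega
  · exact Or.inr (Or.inr (by simpa using e))

include hP in
/-- long `P` case: the bond `b – t+(−1,1)` is forced. [cite: MadrasSlade1993, Definition 3.2.1 p. 62 (degree two)] -/
private theorem forcedP₃ (hv : t + ![-1, 1] ∈ vertsOf P) : s(t + ![-1, 1], t + ![-1, 0]) ∈ P := by
  have hpar := h.hpar
  refine (cforced₃ hP (x := t + ![0, 1]) (y := t + ![-2, 1]) (z := t + ![-1, 0]) hv (fun w hw => ?_) h.f01.1).2
  rcases nbr₃ t (-1) 1 hw with e | e | ⟨e, hp⟩ | ⟨e, -⟩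
  · exact Or.inl (by simpa using e)
  · exact Or.inr (Or.inl (by simpa using e))
  · omega
  · exact Or.inr (Or.inr (by simpa using e))

include hQ in
/-- long `Q` case: the bond `t+(3,0) – c` is forced. [cite: MadrasSlade1993, Definition 3.2.1 p. 62 (degree two)] -/
private theorem forcedQ₃ (hv : t + ![3, 0] ∈ vertsOf Q) : s(t + ![3, 0], t + ![3, 1]) ∈ Q := by
  have hpar := h.hpar
  refine (cforced₃ hQ (x := t + ![2, 0]) (y := t + ![4, 0]) (z := t + ![3, 1]) hv (fun w hw => ?_) h.f20.2).2
  rcases nbr₃ t 3 0 hw with e | e | ⟨e, -⟩ | ⟨e, hp⟩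
  · exact Or.inr (Or.inl (by simpa using e))
  · exact Or.inl (by simpa using e)
  · exact Or.inr (Or.inr (by simpa using e))
  · omega

include hK1 in
/-- a bond of `P` other than the two cluster-boundary bonds at `b` lies on the join. [cite: Hammond2015SAPJoining, Definition 4.3 p. 20 (arXiv v5: «(τ ∪ σ) Δ ∂C»)] -/
private theorem memJ_of_memP₃ {e : Sym2 (Site 2)} (he : e ∈ P) (h1 : e ≠ s(t + ![0, 0], t + ![-1, 0]))
    (h2 : t + ![-1, 1] ∈ vertsOf P → e ≠ s(t + ![-1, 0], t + ![-1, 1])) : e ∈ hdJoin t P Q := by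
  classical
  have hdisj := disjoint_of_corridor (P := P) (Q := Q) hK1
  rw [hdJoin, Finset.mem_symmDiff]
  refine Or.inl ⟨Finset.mem_union_left _ he, fun hB => ?_⟩
  simp only [hdBoundary, Finset.mem_insert, Finset.mem_singleton] at hB
  rcases hB with rfl | rfl | rfl | rfl | rfl | rfl | rfl | rfl | rfl | rfl
  · exact h1 rfl
  · exact h2 (vright₃ he) rfl
  · exact h.f01.1 (vright₃ he)
  · exact h.f01.1 (vleft₃ he)
  · exact h.f11.1 (vleft₃ he)
  · exact hdisj _ (vright₃ he) (wQ₃ h)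
  · exact h.f30 (vleft₃ he)
  · exact h.f10.1 (vright₃ he)
  · exact h.f10.1 (vleft₃ he)
  · exact h.f20.1 (vleft₃ he)

include hK1 in
/-- a bond of `Q` other than the two cluster-boundary bonds at `c` lies on the join. [cite: Hammond2015SAPJoining, Definition 4.3 p. 20 (arXiv v5)] -/
private theorem memJ_of_memQ₃ {e : Sym2 (Site 2)} (he : e ∈ Q) (h1 : e ≠ s(t + ![3, 1], t + ![2, 1]))
    (h2 : t + ![3, 0] ∈ vertsOf Q → e ≠ s(t + ![3, 0], t + ![3, 1])) : e ∈ hdJoin t P Q := by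
  classical
  have hdisj := disjoint_of_corridor (P := P) (Q := Q) hK1
  rw [hdJoin, Finset.mem_symmDiff]
  refine Or.inl ⟨Finset.mem_union_right _ he, fun hB => ?_⟩
  simp only [hdBoundary, Finset.mem_insert, Finset.mem_singleton] at hB
  rcases hB with rfl | rfl | rfl | rfl | rfl | rfl | rfl | rfl | rfl | rfl
  · exact hdisj _ (tP₃ h) (vleft₃ he)
  · exact h.fm1 (vright₃ he)
  · exact h.f01.2 (vright₃ he)
  · exact h.f01.2 (vleft₃ he)
  · exact h.f11.2 (vleft₃ he)
  · exact h1 rfl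
  · exact h2 (vleft₃ he) rfl
  · exact h.f10.2 (vright₃ he)
  · exact h.f10.2 (vleft₃ he)
  · exact h.f20.2 (vleft₃ he)

omit h in
/-- a cluster-boundary bond on neither polygon lies on the join (private plumbing). [cite: Hammond2015SAPJoining, Definition 4.3 p. 20 (arXiv v5)] -/
private theorem memJ_of_bdry₃ {x y : Site 2} (hB : s(x, y) ∈ hdBoundary t) (hxP : x ∉ vertsOf P ∨ y ∉ vertsOf P)
    (hxQ : x ∉ vertsOf Q ∨ y ∉ vertsOf Q) : s(x, y) ∈ hdJoin t P Q := by
  classical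
  rw [hdJoin, Finset.mem_symmDiff]
  refine Or.inr ⟨hB, fun hm => ?_⟩
  rcases Finset.mem_union.1 hm with hm | hm
  · rcases hxP with hx | hx
    · exact hx (vleft₃ hm)
    · exact hx (vright₃ hm)
  · rcases hxQ with hx | hx
    · exact hx (vleft₃ hm)
    · exact hx (vright₃ hm)

/-- connector `t – t+(1,0)`. [cite: Hammond2015SAPJoining, Definition 4.3 p. 20 (arXiv v5)] -/
private theorem cJ1₃ : s(t + ![0, 0], t + ![1, 0]) ∈ hdJoin t P Q :=
  memJ_of_bdry₃ (by simp [hdBoundary]) (Or.inr h.f10.1) (Or.inr h.f10.2)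
/-- connector `t+(1,0) – t+(2,0)`. [cite: Hammond2015SAPJoining, Definition 4.3 p. 20 (arXiv v5)] -/
private theorem cJ2₃ : s(t + ![1, 0], t + ![2, 0]) ∈ hdJoin t P Q :=
  memJ_of_bdry₃ (by simp [hdBoundary]) (Or.inl h.f10.1) (Or.inl h.f10.2)
/-- connector `t+(2,0) – t+(3,0)`. [cite: Hammond2015SAPJoining, Definition 4.3 p. 20 (arXiv v5)] -/
private theorem cJ3₃ : s(t + ![2, 0], t + ![3, 0]) ∈ hdJoin t P Q :=
  memJ_of_bdry₃ (by simp [hdBoundary]) (Or.inl h.f20.1) (Or.inl h.f20.2)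
/-- connector `t+(−1,1) – t+(0,1)`. [cite: Hammond2015SAPJoining, Definition 4.3 p. 20 (arXiv v5)] -/
private theorem cJ4₃ : s(t + ![-1, 1], t + ![0, 1]) ∈ hdJoin t P Q :=
  memJ_of_bdry₃ (by simp [hdBoundary]) (Or.inr h.f01.1) (Or.inr h.f01.2)
/-- connector `t+(0,1) – t+(1,1)`. [cite: Hammond2015SAPJoining, Definition 4.3 p. 20 (arXiv v5)] -/
private theorem cJ5₃ : s(t + ![0, 1], t + ![1, 1]) ∈ hdJoin t P Q :=
  memJ_of_bdry₃ (by simp [hdBoundary]) (Or.inl h.f01.1) (Or.inl h.f01.2)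
/-- connector `t+(1,1) – w′`. [cite: Hammond2015SAPJoining, Definition 4.3 p. 20 (arXiv v5)] -/
private theorem cJ6₃ : s(t + ![1, 1], t + ![2, 1]) ∈ hdJoin t P Q :=
  memJ_of_bdry₃ (by simp [hdBoundary]) (Or.inl h.f11.1) (Or.inl h.f11.2)
/-- connector `b – t+(−1,1)` (short `P` case). [cite: Hammond2015SAPJoining, Definition 4.3 p. 20 (arXiv v5)] -/
private theorem cJb₃ (hjP : t + ![-1, 1] ∉ vertsOf P) : s(t + ![-1, 0], t + ![-1, 1]) ∈ hdJoin t P Q :=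
  memJ_of_bdry₃ (by simp [hdBoundary]) (Or.inr hjP) (Or.inr h.fm1)
/-- connector `t+(3,0) – c` (short `Q` case). [cite: Hammond2015SAPJoining, Definition 4.3 p. 20 (arXiv v5)] -/
private theorem cJc₃ (hjQ : t + ![3, 0] ∉ vertsOf Q) : s(t + ![3, 0], t + ![3, 1]) ∈ hdJoin t P Q :=
  memJ_of_bdry₃ (by simp [hdBoundary]) (Or.inl h.f30) (Or.inl hjQ)

include hP hK1 in
/-- the down bond of `t` lies on the join. [cite: Hammond2015SAPJoining, Definition 4.3 p. 20 (arXiv v5)] -/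
private theorem tdownJ₃ : s(t + ![0, 0], t + ![0, -1]) ∈ hdJoin t P Q :=
  memJ_of_memP₃ hK1 h (tdown₃ hP h) (sne₃ (Or.inl (by decide)) (Or.inl (by decide))) (fun _ => sne₃ (Or.inl (by decide)) (Or.inl (by decide)))

end Frame

/-! ### The bridge: a T3 decomposition imposes the horizontal cut on every traversal -/

/-- `IsHdCut` from the junction values (private plumbing). [cite: Hammond2015SAPJoining, Definition 4.3 p. 20 (arXiv v5)] -/
private theorem isHdCut_of_eqs {M j : ℕ} {v : ℕ → Site 2} (p : Site 2)
    (h0 : v j = p + ![-1, 0]) (h1 : v (j + M - 4) = p + ![0, 0]) (h2 : v (j + M - 3) = p + ![1, 0]) (h3 : v (j + M - 2) = p + ![2, 0])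
    (h4 : v (j + M - 1) = p + ![3, 0]) (h5 : v (j + M) = p + ![3, 1]) (h6 : v (j + 2 * M - 4) = p + ![2, 1]) (h7 : v (j + 2 * M - 3) = p + ![1, 1])
    (h8 : v (j + 2 * M - 2) = p + ![0, 1]) (h9 : v (j + 2 * M - 1) = p + ![-1, 1])
    (sep : ∀ a b : ℕ, j ≤ a → a < j + M → j + M ≤ b → b < j + 2 * M → v a 1 = v b 1 → v a 0 < v b 0) : IsHdCut M v j := by
  obtain ⟨e0, e1⟩ := coord_of_eq₃ h0
  obtain ⟨f10, f11⟩ := coord_of_eq₃ h1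
  obtain ⟨f20, f21⟩ := coord_of_eq₃ h2
  obtain ⟨f30, f31⟩ := coord_of_eq₃ h3
  obtain ⟨f40, f41⟩ := coord_of_eq₃ h4
  obtain ⟨f50, f51⟩ := coord_of_eq₃ h5
  obtain ⟨f60, f61⟩ := coord_of_eq₃ h6
  obtain ⟨f70, f71⟩ := coord_of_eq₃ h7
  obtain ⟨f80, f81⟩ := coord_of_eq₃ h8
  obtain ⟨f90, f91⟩ := coord_of_eq₃ h9
  exact ⟨⟨by omega, by omega⟩, ⟨by omega, by omega⟩, ⟨by omega, by omega⟩, ⟨by omega, by omega⟩, ⟨by omega, by omega⟩, ⟨by omega, by omega⟩, ⟨by omega, by omega⟩, ⟨by omega, by omega⟩, ⟨by omega, by omega⟩, sep⟩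

/-- `IsHdCut'` from the junction values (private plumbing). [cite: Hammond2015SAPJoining, Definition 4.3 p. 20 (arXiv v5)] -/
private theorem isHdCut'_of_eqs {M j : ℕ} {v : ℕ → Site 2} (p : Site 2)
    (h0 : v j = p + ![-1, 1]) (h1 : v (j + 1) = p + ![0, 1]) (h2 : v (j + 2) = p + ![1, 1]) (h3 : v (j + 3) = p + ![2, 1])
    (h4 : v (j + M - 1) = p + ![3, 1]) (h5 : v (j + M) = p + ![3, 0]) (h6 : v (j + M + 1) = p + ![2, 0]) (h7 : v (j + M + 2) = p + ![1, 0])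
    (h8 : v (j + M + 3) = p + ![0, 0]) (h9 : v (j + 2 * M - 1) = p + ![-1, 0])
    (sep : ∀ a b : ℕ, j ≤ a → a < j + M → j + M ≤ b → b < j + 2 * M → v a 1 = v b 1 → v b 0 < v a 0) : IsHdCut' M v j := by
  obtain ⟨e0, e1⟩ := coord_of_eq₃ h0
  obtain ⟨f10, f11⟩ := coord_of_eq₃ h1
  obtain ⟨f20, f21⟩ := coord_of_eq₃ h2
  obtain ⟨f30, f31⟩ := coord_of_eq₃ h3
  obtain ⟨f40, f41⟩ := coord_of_eq₃ h4
  obtain ⟨f50, f51⟩ := coord_of_eq₃ h5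
  obtain ⟨f60, f61⟩ := coord_of_eq₃ h6
  obtain ⟨f70, f71⟩ := coord_of_eq₃ h7
  obtain ⟨f80, f81⟩ := coord_of_eq₃ h8
  obtain ⟨f90, f91⟩ := coord_of_eq₃ h9
  exact ⟨⟨by omega, by omega⟩, ⟨by omega, by omega⟩, ⟨by omega, by omega⟩, ⟨by omega, by omega⟩, ⟨by omega, by omega⟩, ⟨by omega, by omega⟩, ⟨by omega, by omega⟩, ⟨by omega, by omega⟩, ⟨by omega, by omega⟩, sep⟩

/-- `IsHdCutTF` from the junction values (private plumbing). [cite: Hammond2015SAPJoining, Definition 4.3 p. 20 (arXiv v5)] -/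
private theorem isHdCutTF_of_eqs {M j : ℕ} {v : ℕ → Site 2} (p : Site 2)
    (h0 : v j = p + ![-1, 1]) (h1 : v (j + M - 4) = p + ![0, 0]) (h2 : v (j + M - 3) = p + ![1, 0]) (h3 : v (j + M - 2) = p + ![2, 0])
    (h4 : v (j + M - 1) = p + ![3, 0]) (h5 : v (j + M) = p + ![3, 1]) (h6 : v (j + 2 * M - 3) = p + ![2, 1]) (h7 : v (j + 2 * M - 2) = p + ![1, 1])
    (h8 : v (j + 2 * M - 1) = p + ![0, 1])
    (sep : ∀ a b : ℕ, j ≤ a → a < j + M → j + M ≤ b → b < j + 2 * M → v a 1 = v b 1 → v a 0 < v b 0) : IsHdCutTF M v j := by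
  obtain ⟨e0, e1⟩ := coord_of_eq₃ h0
  obtain ⟨f10, f11⟩ := coord_of_eq₃ h1
  obtain ⟨f20, f21⟩ := coord_of_eq₃ h2
  obtain ⟨f30, f31⟩ := coord_of_eq₃ h3
  obtain ⟨f40, f41⟩ := coord_of_eq₃ h4
  obtain ⟨f50, f51⟩ := coord_of_eq₃ h5
  obtain ⟨f60, f61⟩ := coord_of_eq₃ h6
  obtain ⟨f70, f71⟩ := coord_of_eq₃ h7
  obtain ⟨f80, f81⟩ := coord_of_eq₃ h8
  exact ⟨⟨by omega, by omega⟩, ⟨by omega, by omega⟩, ⟨by omega, by omega⟩, ⟨by omega, by omega⟩, ⟨by omega, by omega⟩, ⟨by omega, by omega⟩, ⟨by omega, by omega⟩, ⟨by omega, by omega⟩, sep⟩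

/-- `IsHdCutTF'` from the junction values (private plumbing). [cite: Hammond2015SAPJoining, Definition 4.3 p. 20 (arXiv v5)] -/
private theorem isHdCutTF'_of_eqs {M j : ℕ} {v : ℕ → Site 2} (p : Site 2)
    (h0 : v j = p + ![0, 1]) (h1 : v (j + 1) = p + ![1, 1]) (h2 : v (j + 2) = p + ![2, 1]) (h3 : v (j + M - 1) = p + ![3, 1])
    (h4 : v (j + M) = p + ![3, 0]) (h5 : v (j + M + 1) = p + ![2, 0]) (h6 : v (j + M + 2) = p + ![1, 0]) (h7 : v (j + M + 3) = p + ![0, 0])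
    (h8 : v (j + 2 * M - 1) = p + ![-1, 1])
    (sep : ∀ a b : ℕ, j ≤ a → a < j + M → j + M ≤ b → b < j + 2 * M → v a 1 = v b 1 → v b 0 < v a 0) : IsHdCutTF' M v j := by
  obtain ⟨e0, e1⟩ := coord_of_eq₃ h0
  obtain ⟨f10, f11⟩ := coord_of_eq₃ h1
  obtain ⟨f20, f21⟩ := coord_of_eq₃ h2
  obtain ⟨f30, f31⟩ := coord_of_eq₃ h3
  obtain ⟨f40, f41⟩ := coord_of_eq₃ h4
  obtain ⟨f50, f51⟩ := coord_of_eq₃ h5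
  obtain ⟨f60, f61⟩ := coord_of_eq₃ h6
  obtain ⟨f70, f71⟩ := coord_of_eq₃ h7
  obtain ⟨f80, f81⟩ := coord_of_eq₃ h8
  exact ⟨⟨by omega, by omega⟩, ⟨by omega, by omega⟩, ⟨by omega, by omega⟩, ⟨by omega, by omega⟩, ⟨by omega, by omega⟩, ⟨by omega, by omega⟩, ⟨by omega, by omega⟩, ⟨by omega, by omega⟩, sep⟩

/-- `IsHdCutFT` from the junction values (private plumbing). [cite: Hammond2015SAPJoining, Definition 4.3 p. 20 (arXiv v5)] -/
private theorem isHdCutFT_of_eqs {M j : ℕ} {v : ℕ → Site 2} (p : Site 2)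
    (h0 : v j = p + ![-1, 0]) (h1 : v (j + M - 3) = p + ![0, 0]) (h2 : v (j + M - 2) = p + ![1, 0]) (h3 : v (j + M - 1) = p + ![2, 0])
    (h4 : v (j + M) = p + ![3, 0]) (h5 : v (j + 2 * M - 4) = p + ![2, 1]) (h6 : v (j + 2 * M - 3) = p + ![1, 1])
    (h7 : v (j + 2 * M - 2) = p + ![0, 1]) (h8 : v (j + 2 * M - 1) = p + ![-1, 1])
    (sep : ∀ a b : ℕ, j ≤ a → a < j + M → j + M ≤ b → b < j + 2 * M → v a 1 = v b 1 → v a 0 < v b 0) : IsHdCutFT M v j := by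
  obtain ⟨e0, e1⟩ := coord_of_eq₃ h0
  obtain ⟨f10, f11⟩ := coord_of_eq₃ h1
  obtain ⟨f20, f21⟩ := coord_of_eq₃ h2
  obtain ⟨f30, f31⟩ := coord_of_eq₃ h3
  obtain ⟨f40, f41⟩ := coord_of_eq₃ h4
  obtain ⟨f50, f51⟩ := coord_of_eq₃ h5
  obtain ⟨f60, f61⟩ := coord_of_eq₃ h6
  obtain ⟨f70, f71⟩ := coord_of_eq₃ h7
  obtain ⟨f80, f81⟩ := coord_of_eq₃ h8
  exact ⟨⟨by omega, by omega⟩, ⟨by omega, by omega⟩, ⟨by omega, by omega⟩, ⟨by omega, by omega⟩, ⟨by omega, by omega⟩, ⟨by omega, by omega⟩, ⟨by omega, by omega⟩, ⟨by omega, by omega⟩, sep⟩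

/-- `IsHdCutFT'` from the junction values (private plumbing). [cite: Hammond2015SAPJoining, Definition 4.3 p. 20 (arXiv v5)] -/
private theorem isHdCutFT'_of_eqs {M j : ℕ} {v : ℕ → Site 2} (p : Site 2)
    (h0 : v j = p + ![-1, 1]) (h1 : v (j + 1) = p + ![0, 1]) (h2 : v (j + 2) = p + ![1, 1]) (h3 : v (j + 3) = p + ![2, 1])
    (h4 : v (j + M - 1) = p + ![3, 0]) (h5 : v (j + M) = p + ![2, 0]) (h6 : v (j + M + 1) = p + ![1, 0]) (h7 : v (j + M + 2) = p + ![0, 0])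
    (h8 : v (j + 2 * M - 1) = p + ![-1, 0])
    (sep : ∀ a b : ℕ, j ≤ a → a < j + M → j + M ≤ b → b < j + 2 * M → v a 1 = v b 1 → v b 0 < v a 0) : IsHdCutFT' M v j := by
  obtain ⟨e0, e1⟩ := coord_of_eq₃ h0
  obtain ⟨f10, f11⟩ := coord_of_eq₃ h1
  obtain ⟨f20, f21⟩ := coord_of_eq₃ h2
  obtain ⟨f30, f31⟩ := coord_of_eq₃ h3
  obtain ⟨f40, f41⟩ := coord_of_eq₃ h4
  obtain ⟨f50, f51⟩ := coord_of_eq₃ h5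
  obtain ⟨f60, f61⟩ := coord_of_eq₃ h6
  obtain ⟨f70, f71⟩ := coord_of_eq₃ h7
  obtain ⟨f80, f81⟩ := coord_of_eq₃ h8
  exact ⟨⟨by omega, by omega⟩, ⟨by omega, by omega⟩, ⟨by omega, by omega⟩, ⟨by omega, by omega⟩, ⟨by omega, by omega⟩, ⟨by omega, by omega⟩, ⟨by omega, by omega⟩, ⟨by omega, by omega⟩, sep⟩

/-- `IsHdCutTT` from the junction values (private plumbing). [cite: Hammond2015SAPJoining, Definition 4.3 p. 20 (arXiv v5)] -/
private theorem isHdCutTT_of_eqs {M j : ℕ} {v : ℕ → Site 2} (p : Site 2)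
    (h0 : v j = p + ![-1, 1]) (h1 : v (j + M - 3) = p + ![0, 0]) (h2 : v (j + M - 2) = p + ![1, 0]) (h3 : v (j + M - 1) = p + ![2, 0])
    (h4 : v (j + M) = p + ![3, 0]) (h5 : v (j + 2 * M - 3) = p + ![2, 1]) (h6 : v (j + 2 * M - 2) = p + ![1, 1])
    (h7 : v (j + 2 * M - 1) = p + ![0, 1])
    (sep : ∀ a b : ℕ, j ≤ a → a < j + M → j + M ≤ b → b < j + 2 * M → v a 1 = v b 1 → v a 0 < v b 0) : IsHdCutTT M v j := by
  obtain ⟨e0, e1⟩ := coord_of_eq₃ h0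
  obtain ⟨f10, f11⟩ := coord_of_eq₃ h1
  obtain ⟨f20, f21⟩ := coord_of_eq₃ h2
  obtain ⟨f30, f31⟩ := coord_of_eq₃ h3
  obtain ⟨f40, f41⟩ := coord_of_eq₃ h4
  obtain ⟨f50, f51⟩ := coord_of_eq₃ h5
  obtain ⟨f60, f61⟩ := coord_of_eq₃ h6
  obtain ⟨f70, f71⟩ := coord_of_eq₃ h7
  exact ⟨⟨by omega, by omega⟩, ⟨by omega, by omega⟩, ⟨by omega, by omega⟩, ⟨by omega, by omega⟩, ⟨by omega, by omega⟩, ⟨by omega, by omega⟩, ⟨by omega, by omega⟩, sep⟩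

/-- `IsHdCutTT'` from the junction values (private plumbing). [cite: Hammond2015SAPJoining, Definition 4.3 p. 20 (arXiv v5)] -/
private theorem isHdCutTT'_of_eqs {M j : ℕ} {v : ℕ → Site 2} (p : Site 2)
    (h0 : v j = p + ![0, 1]) (h1 : v (j + 1) = p + ![1, 1]) (h2 : v (j + 2) = p + ![2, 1]) (h3 : v (j + M - 1) = p + ![3, 0])
    (h4 : v (j + M) = p + ![2, 0]) (h5 : v (j + M + 1) = p + ![1, 0]) (h6 : v (j + M + 2) = p + ![0, 0]) (h7 : v (j + 2 * M - 1) = p + ![-1, 1])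
    (sep : ∀ a b : ℕ, j ≤ a → a < j + M → j + M ≤ b → b < j + 2 * M → v a 1 = v b 1 → v b 0 < v a 0) : IsHdCutTT' M v j := by
  obtain ⟨e0, e1⟩ := coord_of_eq₃ h0
  obtain ⟨f10, f11⟩ := coord_of_eq₃ h1
  obtain ⟨f20, f21⟩ := coord_of_eq₃ h2
  obtain ⟨f30, f31⟩ := coord_of_eq₃ h3
  obtain ⟨f40, f41⟩ := coord_of_eq₃ h4
  obtain ⟨f50, f51⟩ := coord_of_eq₃ h5
  obtain ⟨f60, f61⟩ := coord_of_eq₃ h6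
  obtain ⟨f70, f71⟩ := coord_of_eq₃ h7
  exact ⟨⟨by omega, by omega⟩, ⟨by omega, by omega⟩, ⟨by omega, by omega⟩, ⟨by omega, by omega⟩, ⟨by omega, by omega⟩, ⟨by omega, by omega⟩, ⟨by omega, by omega⟩, sep⟩

section Bridge

variable (hP : IsPolygon brickWallGraph P) (hQ : IsPolygon brickWallGraph Q) (hPn : #P = n) (hQn : #Q = n) (hn : 3 ≤ n)
  (hK1 : Corridor P Q) (h : IsT3 P Q t)
include hP hQ hPn hQn hn hK1 h

/-- **A T3 decomposition, shape FF (`t+(−1,1) ∉ P`, `t+(3,0) ∉ Q`), imposes the forward horizontal cut `IsHdCut (n + 3) u (i+1)` on every traversal of the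
joined polygon with `u i = t + (-1,1)`, `u (i+1) = t + (-1,0)`.** [cite: Hammond2015SAPJoining, §4.2 pp. 20–24 (arXiv v5: recognising the junction plaquette); Madras1995LatticeAnimalsExponent, §2] -/
theorem isHdCut_of_isT3 (hjP : t + ![-1, 1] ∉ vertsOf P) (hjQ : t + ![3, 0] ∉ vertsOf Q) (hu : IsPolyTraversal brickWallGraph (hdJoin t P Q) (2 * n + 6) u) {i : ℕ}
    (h0 : u i = t + ![-1, 1]) (h1 : u (i + 1) = t + ![-1, 0]) : IsHdCut (n + 3) u (i + 1) := by
  classical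
  have hdisj := disjoint_of_corridor (P := P) (Q := Q) hK1
  obtain ⟨hJ, -⟩ := h.isPolygon_join hP hQ hdisj
  set J := hdJoin t P Q with hJdef
  have hpar := h.hpar
  have tP : t + ![0, 0] ∈ vertsOf P := tP₃ h
  have wQ : t + ![2, 1] ∈ vertsOf Q := wQ₃ h
  have cJ1 : s(t + ![0, 0], t + ![1, 0]) ∈ J := cJ1₃ h
  have cJ2 : s(t + ![1, 0], t + ![2, 0]) ∈ J := cJ2₃ h
  have cJ3 : s(t + ![2, 0], t + ![3, 0]) ∈ J := cJ3₃ h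
  have cJ4 : s(t + ![-1, 1], t + ![0, 1]) ∈ J := cJ4₃ h
  have cJ5 : s(t + ![0, 1], t + ![1, 1]) ∈ J := cJ5₃ h
  have cJ6 : s(t + ![1, 1], t + ![2, 1]) ∈ J := cJ6₃ h
  have cJb : s(t + ![-1, 0], t + ![-1, 1]) ∈ J := cJb₃ h hjP
  have cJc : s(t + ![3, 0], t + ![3, 1]) ∈ J := cJc₃ h hjQ
  -- open `P` at `b – t`: the `P`-arc `W : b ⇝ t`
  have hbt : s(t + ![-1, 0], t + ![0, 0]) ∈ P := by rw [Sym2.eq_swap]; exact h.hl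
  obtain ⟨W, hW, hWe, -, hWl, hWs⟩ := hP.exists_isPath_erase hbt
  have hWJ : ∀ e ∈ W.edges, e ∈ J := fun e he => by
    have hm : e ∈ P.erase s(t + ![-1, 0], t + ![0, 0]) := by rw [← hWe]; exact List.mem_toFinset.2 he
    exact memJ_of_memP₃ hK1 h (Finset.mem_erase.1 hm).2 (by rw [Sym2.eq_swap]; exact (Finset.mem_erase.1 hm).1)
      (fun hv => absurd hv hjP)
  have hWlen : W.length = n - 1 := by omega
  have hWv : ∀ k, W.getVert k ∈ vertsOf P := fun k => mem_vertsOf.2 ((hWs _).1 (W.getVert_mem_support k))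
  -- open `Q` at `c – w′`: the `Q`-arc `W' : c ⇝ w′`
  obtain ⟨W', hW', hW'e, -, hW'l, hW's⟩ := hQ.exists_isPath_erase h.hr
  have hW'J : ∀ e ∈ W'.edges, e ∈ J := fun e he => by
    have hm : e ∈ Q.erase s(t + ![3, 1], t + ![2, 1]) := by rw [← hW'e]; exact List.mem_toFinset.2 he
    exact memJ_of_memQ₃ hK1 h (Finset.mem_erase.1 hm).2 (Finset.mem_erase.1 hm).1 (fun hv => absurd hv hjQ)
  have hW'len : W'.length = n - 1 := by omega
  have hW'v : ∀ k, W'.getVert k ∈ vertsOf Q := fun k => mem_vertsOf.2 ((hW's _).1 (W'.getVert_mem_support k))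
  have hWedge : ∀ k, k < W.length → s(W.getVert k, W.getVert (k + 1)) ∈ J := fun k hk => hWJ _ (getVert_edge₃ W hk)
  have hW'edge : ∀ k, k < W'.length → s(W'.getVert k, W'.getVert (k + 1)) ∈ J := fun k hk => hW'J _ (getVert_edge₃ W' hk)
  -- STEP 1: the `P`-arc, `u (i+1+k) = W_k`
  have hu2 : u (i + 2) = W.getVert 1 := by
    have := next_eq₃ (i := i) hu hJ (x := t + ![-1, 1]) (y := W.getVert 1) (by rw [h1]; exact cJb) ?_ ?_ h0
    · exact this
    · rw [h1]; have := hWedge 0 (by omega); rwa [Walk.getVert_zero] at this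
    · exact (fun he => hjP (he ▸ hWv 1))
  have hP_arc : ∀ k, k ≤ n - 1 → u (i + 1 + k) = W.getVert k := fun k hk =>
    hu.follows_path hJ W hW hWJ (i := i + 1) h1 (fun _ => by rw [show i + 1 + 1 = i + 2 by omega]; exact hu2) k (by omega)
  have hut : u (i + n) = t + ![0, 0] := by
    have := hP_arc (n - 1) le_rfl
    rw [show i + 1 + (n - 1) = i + n by omega, ← hWlen, Walk.getVert_length] at this; exact this
  have hut1 : u (i + n - 1) = W.getVert (n - 2) := by
    have := hP_arc (n - 2) (by omega); rwa [show i + 1 + (n - 2) = i + n - 1 by omega] at this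
  have hWlast : s(t + ![0, 0], W.getVert (n - 2)) ∈ J := by
    have := hWedge (n - 2) (by omega)
    rw [show n - 2 + 1 = n - 1 by omega, ← hWlen, Walk.getVert_length, Sym2.eq_swap] at this
    exact this
  -- STEP 2: the lower connector
  have hR1 : u (i + n + 1) = t + ![1, 0] := by
    have := next_eq₃ (i := i + n - 1) hu hJ (x := W.getVert (n - 2)) (y := t + ![1, 0]) (by rw [show i + n - 1 + 1 = i + n by omega, hut]; exact hWlast)
      (by rw [show i + n - 1 + 1 = i + n by omega, hut]; exact cJ1) (fun he => h.f10.1 (he ▸ hWv (n - 2))) hut1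
    rwa [show i + n - 1 + 2 = i + n + 1 by omega] at this
  have hR2 : u (i + n + 2) = t + ![2, 0] := by
    have := next_eq₃ (i := i + n) hu hJ (x := t + ![0, 0]) (y := t + ![2, 0]) (by rw [hR1, Sym2.eq_swap]; exact cJ1)
      (by rw [hR1]; exact cJ2) (off_ne₃ (by decide)) hut
    exact this
  have hR3 : u (i + n + 3) = t + ![3, 0] := by
    have := next_eq₃ (i := i + n + 1) hu hJ (x := t + ![1, 0]) (y := t + ![3, 0]) (by rw [show i + n + 1 + 1 = i + n + 2 by omega, hR2, Sym2.eq_swap]; exact cJ2)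
      (by rw [show i + n + 1 + 1 = i + n + 2 by omega, hR2]; exact cJ3) (off_ne₃ (by decide)) hR1
    rwa [show i + n + 1 + 2 = i + n + 3 by omega] at this
  have hR4 : u (i + n + 4) = t + ![3, 1] := by
    have := next_eq₃ (i := i + n + 2) hu hJ (x := t + ![2, 0]) (y := t + ![3, 1]) (by rw [show i + n + 2 + 1 = i + n + 3 by omega, hR3, Sym2.eq_swap]; exact cJ3)
      (by rw [show i + n + 2 + 1 = i + n + 3 by omega, hR3]; exact cJc) (off_ne₃ (by decide)) hR2
    rwa [show i + n + 2 + 2 = i + n + 4 by omega] at this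
  -- STEP 3: the `Q`-arc
  have hQ1 : u (i + n + 4 + 1) = W'.getVert 1 := by
    have := next_eq₃ (i := i + n + 3) hu hJ (x := t + ![3, 0]) (y := W'.getVert 1) (by rw [show i + n + 3 + 1 = i + n + 4 by omega, hR4, Sym2.eq_swap]; exact cJc) ?_ ?_ hR3
    · rwa [show i + n + 3 + 2 = i + n + 4 + 1 by omega] at this
    · rw [show i + n + 3 + 1 = i + n + 4 by omega, hR4]; have := hW'edge 0 (by omega); rwa [Walk.getVert_zero] at this
    · exact (fun he => hjQ (he ▸ hW'v 1))
  have hQ_arc : ∀ k, k ≤ n - 1 → u (i + n + 4 + k) = W'.getVert k := fun k hk =>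
    hu.follows_path hJ W' hW' hW'J (i := i + n + 4) hR4 (fun _ => hQ1) k (by omega)
  have huw : u (i + 2 * n + 3) = t + ![2, 1] := by
    have := hQ_arc (n - 1) le_rfl
    rw [show i + n + 4 + (n - 1) = i + 2 * n + 3 by omega, ← hW'len, Walk.getVert_length] at this; exact this
  have huw1 : u (i + 2 * n + 2) = W'.getVert (n - 2) := by
    have := hQ_arc (n - 2) (by omega); rwa [show i + n + 4 + (n - 2) = i + 2 * n + 2 by omega] at this
  have hW'last : s(t + ![2, 1], W'.getVert (n - 2)) ∈ J := by
    have := hW'edge (n - 2) (by omega)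
    rw [show n - 2 + 1 = n - 1 by omega, ← hW'len, Walk.getVert_length, Sym2.eq_swap] at this
    exact this
  -- STEP 4: the upper connector
  have hL1 : u (i + 2 * n + 4) = t + ![1, 1] := by
    have := next_eq₃ (i := i + 2 * n + 2) hu hJ (x := W'.getVert (n - 2)) (y := t + ![1, 1]) (by rw [show i + 2 * n + 2 + 1 = i + 2 * n + 3 by omega, huw]; exact hW'last)
      (by rw [show i + 2 * n + 2 + 1 = i + 2 * n + 3 by omega, huw, Sym2.eq_swap]; exact cJ6) (fun he => h.f11.2 (he ▸ hW'v (n - 2))) huw1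
    rwa [show i + 2 * n + 2 + 2 = i + 2 * n + 4 by omega] at this
  have hL2 : u (i + 2 * n + 5) = t + ![0, 1] := by
    have := next_eq₃ (i := i + 2 * n + 3) hu hJ (x := t + ![2, 1]) (y := t + ![0, 1]) (by rw [show i + 2 * n + 3 + 1 = i + 2 * n + 4 by omega, hL1]; exact cJ6)
      (by rw [show i + 2 * n + 3 + 1 = i + 2 * n + 4 by omega, hL1, Sym2.eq_swap]; exact cJ5) (off_ne₃ (by decide)) huw
    rwa [show i + 2 * n + 3 + 2 = i + 2 * n + 5 by omega] at this
  have hL3 : u (i + 2 * n + 6) = t + ![-1, 1] := by rw [show i + 2 * n + 6 = i + (2 * n + 6) by omega, hu.periodic, h0]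
  -- the cut
  refine isHdCut_of_eqs t h1
    (by rw [show i + 1 + (n + 3) - 4 = i + n by omega, hut])
    (by rw [show i + 1 + (n + 3) - 3 = i + n + 1 by omega, hR1])
    (by rw [show i + 1 + (n + 3) - 2 = i + n + 2 by omega, hR2])
    (by rw [show i + 1 + (n + 3) - 1 = i + n + 3 by omega, hR3])
    (by rw [show i + 1 + (n + 3) = i + n + 4 by omega, hR4])
    (by rw [show i + 1 + 2 * (n + 3) - 4 = i + 2 * n + 3 by omega, huw])
    (by rw [show i + 1 + 2 * (n + 3) - 3 = i + 2 * n + 4 by omega, hL1])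
    (by rw [show i + 1 + 2 * (n + 3) - 2 = i + 2 * n + 5 by omega, hL2])
    (by rw [show i + 1 + 2 * (n + 3) - 1 = i + 2 * n + 6 by omega, hL3])
    ?_
  -- row separation: the left block (`P`-arc and lower connector) lies left of the right block (`Q`-arc and upper connector)
  intro a b ha1 ha2 hb1 hb2 hrow
  have haL : u a ∈ vertsOf P ∨ (u a = t + ![1, 0] ∨ u a = t + ![2, 0] ∨ u a = t + ![3, 0]) := by
    rcases Nat.lt_or_ge a (i + n + 1) with hlt | hge
    · left
      have := hP_arc (a - (i + 1)) (by omega)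
      rw [show i + 1 + (a - (i + 1)) = a by omega] at this
      rw [this]; exact hWv _
    · right
      rcases Nat.lt_or_ge a (i + n + 2) with h1' | h1'
      · left; rw [show a = i + n + 1 by omega]; exact hR1
      rcases Nat.lt_or_ge a (i + n + 3) with h2' | h2'
      · right; left; rw [show a = i + n + 2 by omega]; exact hR2
      · right; right; rw [show a = i + n + 3 by omega]; exact hR3
  have hbR : u b ∈ vertsOf Q ∨ (u b = t + ![1, 1] ∨ u b = t + ![0, 1] ∨ u b = t + ![-1, 1]) := by
    rcases Nat.lt_or_ge b (i + 2 * n + 3 + 1) with hlt | hge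
    · left
      have := hQ_arc (b - (i + n + 4)) (by omega)
      rw [show i + n + 4 + (b - (i + n + 4)) = b by omega] at this
      rw [this]; exact hW'v _
    · right
      rcases Nat.lt_or_ge b (i + 2 * n + 3 + 2) with h1' | h1'
      · left; rw [show b = i + 2 * n + 4 by omega]; exact hL1
      rcases Nat.lt_or_ge b (i + 2 * n + 3 + 3) with h2' | h2'
      · right; left; rw [show b = i + 2 * n + 5 by omega]; exact hL2
      · right; right; rw [show b = i + 2 * n + 6 by omega]; exact hL3
  rcases haL with haP | hj <;> rcases hbR with hbQ | hj'
  · exact lt_of_lt_of_le (by omega) (hK1 _ haP _ hbQ (Or.inl hrow))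
  · -- a `P`-site against an upper-connector site (row `t₁ + 1`): corridor against `w′ ∈ Q`; `t+(0,1)`, `t+(−1,1)` are off `P`
    rcases hj' with hbE | hbE | hbE <;> rw [hbE] at hrow ⊢
    · have := hK1 _ haP _ wQ (by simp at hrow ⊢; omega); simp at this ⊢; omega
    · have := hK1 _ haP _ wQ (by simp at hrow ⊢; omega)
      simp at this hrow ⊢
      rcases lt_or_eq_of_le (show u a 0 ≤ t 0 by omega) with hlt | heq
      · omega
      · exact absurd haP (by rw [eq_off₃ (t := t) (x := u a) (a := 0) (b := 1) (by omega) (by omega)]; exact h.f01.1)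
    · have := hK1 _ haP _ wQ (by simp at hrow ⊢; omega)
      simp at this hrow ⊢
      rcases lt_or_eq_of_le (show u a 0 ≤ t 0 by omega) with hlt | heq
      · rcases lt_or_eq_of_le (show u a 0 ≤ t 0 - 1 by omega) with hlt' | heq'
        · omega
        · exact absurd haP (by rw [eq_off₃ (t := t) (x := u a) (a := -1) (b := 1) (by omega) (by omega)]; exact hjP)
      · exact absurd haP (by rw [eq_off₃ (t := t) (x := u a) (a := 0) (b := 1) (by omega) (by omega)]; exact h.f01.1)
  · -- a lower-connector site against a `Q`-site (row `t₁`): corridor against `t ∈ P`; `t+(2,0)`, `t+(3,0)` are off `Q`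
    rcases hj with haE | haE | haE <;> rw [haE] at hrow ⊢
    · have := hK1 _ tP _ hbQ (by simp at hrow ⊢; omega); simp at this ⊢; omega
    · have := hK1 _ tP _ hbQ (by simp at hrow ⊢; omega)
      simp at this hrow ⊢
      rcases lt_or_eq_of_le (show t 0 + 2 ≤ u b 0 by omega) with hlt | heq
      · omega
      · exact absurd hbQ (by rw [eq_off₃ (t := t) (x := u b) (a := 2) (b := 0) (by omega) (by omega)]; exact h.f20.2)
    · have := hK1 _ tP _ hbQ (by simp at hrow ⊢; omega)
      simp at this hrow ⊢
      rcases lt_or_eq_of_le (show t 0 + 2 ≤ u b 0 by omega) with hlt | heq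
      · rcases lt_or_eq_of_le (show t 0 + 3 ≤ u b 0 by omega) with hlt' | heq'
        · omega
        · exact absurd hbQ (by rw [eq_off₃ (t := t) (x := u b) (a := 3) (b := 0) (by omega) (by omega)]; exact hjQ)
      · exact absurd hbQ (by rw [eq_off₃ (t := t) (x := u b) (a := 2) (b := 0) (by omega) (by omega)]; exact h.f20.2)
  · rcases hj with haE | haE | haE <;> rcases hj' with hbE | hbE | hbE <;> rw [haE, hbE] at hrow ⊢ <;>
      (simp only [Pi.add_apply, uy0, uy1] at hrow ⊢; omega)

/-- **A T3 decomposition, shape FF (`t+(−1,1) ∉ P`, `t+(3,0) ∉ Q`), imposes the BACKWARD horizontal cut `IsHdCut' (n + 3) u (i+1)` on every traversal of the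
joined polygon with `u i = t + (-1,0)`, `u (i+1) = t + (-1,1)`.** [cite: Hammond2015SAPJoining, §4.2 pp. 20–24 (arXiv v5: recognising the junction plaquette); Madras1995LatticeAnimalsExponent, §2] -/
theorem isHdCut'_of_isT3 (hjP : t + ![-1, 1] ∉ vertsOf P) (hjQ : t + ![3, 0] ∉ vertsOf Q) (hu : IsPolyTraversal brickWallGraph (hdJoin t P Q) (2 * n + 6) u) {i : ℕ}
    (h0 : u i = t + ![-1, 0]) (h1 : u (i + 1) = t + ![-1, 1]) : IsHdCut' (n + 3) u (i + 1) := by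
  classical
  have hdisj := disjoint_of_corridor (P := P) (Q := Q) hK1
  obtain ⟨hJ, -⟩ := h.isPolygon_join hP hQ hdisj
  set J := hdJoin t P Q with hJdef
  have hpar := h.hpar
  have tP : t + ![0, 0] ∈ vertsOf P := tP₃ h
  have wQ : t + ![2, 1] ∈ vertsOf Q := wQ₃ h
  have cJ1 : s(t + ![0, 0], t + ![1, 0]) ∈ J := cJ1₃ h
  have cJ2 : s(t + ![1, 0], t + ![2, 0]) ∈ J := cJ2₃ h
  have cJ3 : s(t + ![2, 0], t + ![3, 0]) ∈ J := cJ3₃ h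
  have cJ4 : s(t + ![-1, 1], t + ![0, 1]) ∈ J := cJ4₃ h
  have cJ5 : s(t + ![0, 1], t + ![1, 1]) ∈ J := cJ5₃ h
  have cJ6 : s(t + ![1, 1], t + ![2, 1]) ∈ J := cJ6₃ h
  have cJb : s(t + ![-1, 0], t + ![-1, 1]) ∈ J := cJb₃ h hjP
  have cJc : s(t + ![3, 0], t + ![3, 1]) ∈ J := cJc₃ h hjQ
  -- open `P` at `t – b`: the `P`-arc `W : t ⇝ b`
  obtain ⟨W, hW, hWe, -, hWl, hWs⟩ := hP.exists_isPath_erase h.hl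
  have hWJ : ∀ e ∈ W.edges, e ∈ J := fun e he => by
    have hm : e ∈ P.erase s(t + ![0, 0], t + ![-1, 0]) := by rw [← hWe]; exact List.mem_toFinset.2 he
    exact memJ_of_memP₃ hK1 h (Finset.mem_erase.1 hm).2 (Finset.mem_erase.1 hm).1 (fun hv => absurd hv hjP)
  have hWlen : W.length = n - 1 := by omega
  have hWv : ∀ k, W.getVert k ∈ vertsOf P := fun k => mem_vertsOf.2 ((hWs _).1 (W.getVert_mem_support k))
  -- open `Q` at `w′ – c`: the `Q`-arc `W' : w′ ⇝ c`
  have hwc : s(t + ![2, 1], t + ![3, 1]) ∈ Q := by rw [Sym2.eq_swap]; exact h.hr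
  obtain ⟨W', hW', hW'e, -, hW'l, hW's⟩ := hQ.exists_isPath_erase hwc
  have hW'J : ∀ e ∈ W'.edges, e ∈ J := fun e he => by
    have hm : e ∈ Q.erase s(t + ![2, 1], t + ![3, 1]) := by rw [← hW'e]; exact List.mem_toFinset.2 he
    exact memJ_of_memQ₃ hK1 h (Finset.mem_erase.1 hm).2 (by rw [Sym2.eq_swap]; exact (Finset.mem_erase.1 hm).1)
      (fun hv => absurd hv hjQ)
  have hW'len : W'.length = n - 1 := by omega
  have hW'v : ∀ k, W'.getVert k ∈ vertsOf Q := fun k => mem_vertsOf.2 ((hW's _).1 (W'.getVert_mem_support k))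
  have hWedge : ∀ k, k < W.length → s(W.getVert k, W.getVert (k + 1)) ∈ J := fun k hk => hWJ _ (getVert_edge₃ W hk)
  have hW'edge : ∀ k, k < W'.length → s(W'.getVert k, W'.getVert (k + 1)) ∈ J := fun k hk => hW'J _ (getVert_edge₃ W' hk)
  -- STEP 1: the upper connector `t+(−1,1) → t+(0,1) → t+(1,1) → w′`
  have hL1 : u (i + 2) = t + ![0, 1] := by
    have := next_eq₃ (i := i) hu hJ (x := t + ![-1, 0]) (y := t + ![0, 1]) (by rw [h1, Sym2.eq_swap]; exact cJb)
      (by rw [h1]; exact cJ4) (off_ne₃ (by decide)) h0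
    exact this
  have hL2 : u (i + 3) = t + ![1, 1] := by
    have := next_eq₃ (i := i + 1) hu hJ (x := t + ![-1, 1]) (y := t + ![1, 1]) (by rw [show i + 1 + 1 = i + 2 by omega, hL1, Sym2.eq_swap]; exact cJ4)
      (by rw [show i + 1 + 1 = i + 2 by omega, hL1]; exact cJ5) (off_ne₃ (by decide)) h1
    rwa [show i + 1 + 2 = i + 3 by omega] at this
  have hL3 : u (i + 4) = t + ![2, 1] := by
    have := next_eq₃ (i := i + 2) hu hJ (x := t + ![0, 1]) (y := t + ![2, 1]) (by rw [show i + 2 + 1 = i + 3 by omega, hL2, Sym2.eq_swap]; exact cJ5)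
      (by rw [show i + 2 + 1 = i + 3 by omega, hL2]; exact cJ6) (off_ne₃ (by decide)) hL1
    rwa [show i + 2 + 2 = i + 4 by omega] at this
  -- STEP 2: the `Q`-arc backwards, `u (i+4+k) = W'_k`
  have hQ1 : u (i + 5) = W'.getVert 1 := by
    have := next_eq₃ (i := i + 3) hu hJ (x := t + ![1, 1]) (y := W'.getVert 1) (by rw [show i + 3 + 1 = i + 4 by omega, hL3, Sym2.eq_swap]; exact cJ6) ?_ ?_ hL2
    · rwa [show i + 3 + 2 = i + 5 by omega] at this
    · rw [show i + 3 + 1 = i + 4 by omega, hL3]; have := hW'edge 0 (by omega); rwa [Walk.getVert_zero] at this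
    · exact (fun he => h.f11.2 (he ▸ hW'v 1))
  have hQ_arc : ∀ k, k ≤ n - 1 → u (i + 4 + k) = W'.getVert k := fun k hk =>
    hu.follows_path hJ W' hW' hW'J (i := i + 4) hL3 (fun _ => by rw [show i + 4 + 1 = i + 5 by omega]; exact hQ1) k (by omega)
  have huR0 : u (i + n + 3) = t + ![3, 1] := by
    have := hQ_arc (n - 1) le_rfl
    rw [show i + 4 + (n - 1) = i + n + 3 by omega, ← hW'len, Walk.getVert_length] at this; exact this
  have huR01 : u (i + n + 2) = W'.getVert (n - 2) := by
    have := hQ_arc (n - 2) (by omega); rwa [show i + 4 + (n - 2) = i + n + 2 by omega] at this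
  have hW'last : s(t + ![3, 1], W'.getVert (n - 2)) ∈ J := by
    have := hW'edge (n - 2) (by omega)
    rw [show n - 2 + 1 = n - 1 by omega, ← hW'len, Walk.getVert_length, Sym2.eq_swap] at this
    exact this
  -- STEP 3: the lower connector backwards
  have hR1 : u (i + n + 4) = t + ![3, 0] := by
    have := next_eq₃ (i := i + n + 2) hu hJ (x := W'.getVert (n - 2)) (y := t + ![3, 0]) (by rw [show i + n + 2 + 1 = i + n + 3 by omega, huR0]; exact hW'last)
      (by rw [show i + n + 2 + 1 = i + n + 3 by omega, huR0, Sym2.eq_swap]; exact cJc) (fun he => hjQ (he ▸ hW'v (n - 2))) huR01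
    rwa [show i + n + 2 + 2 = i + n + 4 by omega] at this
  have hR2 : u (i + n + 5) = t + ![2, 0] := by
    have := next_eq₃ (i := i + n + 3) hu hJ (x := t + ![3, 1]) (y := t + ![2, 0]) (by rw [show i + n + 3 + 1 = i + n + 4 by omega, hR1]; exact cJc)
      (by rw [show i + n + 3 + 1 = i + n + 4 by omega, hR1, Sym2.eq_swap]; exact cJ3) (off_ne₃ (by decide)) huR0
    rwa [show i + n + 3 + 2 = i + n + 5 by omega] at this
  have hR3 : u (i + n + 6) = t + ![1, 0] := by
    have := next_eq₃ (i := i + n + 4) hu hJ (x := t + ![3, 0]) (y := t + ![1, 0]) (by rw [show i + n + 4 + 1 = i + n + 5 by omega, hR2]; exact cJ3)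
      (by rw [show i + n + 4 + 1 = i + n + 5 by omega, hR2, Sym2.eq_swap]; exact cJ2) (off_ne₃ (by decide)) hR1
    rwa [show i + n + 4 + 2 = i + n + 6 by omega] at this
  have hR4 : u (i + n + 7) = t + ![0, 0] := by
    have := next_eq₃ (i := i + n + 5) hu hJ (x := t + ![2, 0]) (y := t + ![0, 0]) (by rw [show i + n + 5 + 1 = i + n + 6 by omega, hR3]; exact cJ2)
      (by rw [show i + n + 5 + 1 = i + n + 6 by omega, hR3, Sym2.eq_swap]; exact cJ1) (off_ne₃ (by decide)) hR2
    rwa [show i + n + 5 + 2 = i + n + 7 by omega] at this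
  -- STEP 4: the `P`-arc backwards
  have hP1 : u (i + n + 7 + 1) = W.getVert 1 := by
    have := next_eq₃ (i := i + n + 6) hu hJ (x := t + ![1, 0]) (y := W.getVert 1) (by rw [show i + n + 6 + 1 = i + n + 7 by omega, hR4]; exact cJ1) ?_ ?_ hR3
    · rwa [show i + n + 6 + 2 = i + n + 7 + 1 by omega] at this
    · rw [show i + n + 6 + 1 = i + n + 7 by omega, hR4]; have := hWedge 0 (by omega); rwa [Walk.getVert_zero] at this
    · exact (fun he => h.f10.1 (he ▸ hWv 1))
  have hP_arc : ∀ k, k ≤ n - 1 → u (i + n + 7 + k) = W.getVert k := fun k hk =>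
    hu.follows_path hJ W hW hWJ (i := i + n + 7) hR4 (fun _ => hP1) k (by omega)
  have huend : u (i + (2 * n + 6)) = t + ![-1, 0] := by
    have := hP_arc (n - 1) le_rfl
    rw [show i + n + 7 + (n - 1) = i + (2 * n + 6) by omega, ← hWlen, Walk.getVert_length] at this; exact this
  -- the backward cut
  refine isHdCut'_of_eqs t h1
    (by rw [show i + 1 + 1 = i + 2 by omega, hL1])
    (by rw [show i + 1 + 2 = i + 3 by omega, hL2])
    (by rw [show i + 1 + 3 = i + 4 by omega, hL3])
    (by rw [show i + 1 + (n + 3) - 1 = i + n + 3 by omega, huR0])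
    (by rw [show i + 1 + (n + 3) = i + n + 4 by omega, hR1])
    (by rw [show i + 1 + (n + 3) + 1 = i + n + 5 by omega, hR2])
    (by rw [show i + 1 + (n + 3) + 2 = i + n + 6 by omega, hR3])
    (by rw [show i + 1 + (n + 3) + 3 = i + n + 7 by omega, hR4])
    (by rw [show i + 1 + 2 * (n + 3) - 1 = i + (2 * n + 6) by omega, huend])
    ?_
  -- row separation: the first block (upper connector, `Q`-arc) lies right of the second (lower connector, `P`-arc)
  intro a b ha1 ha2 hb1 hb2 hrow
  have haR : u a ∈ vertsOf Q ∨ (u a = t + ![-1, 1] ∨ u a = t + ![0, 1] ∨ u a = t + ![1, 1]) := by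
    rcases Nat.lt_or_ge a (i + 4) with hlt | hge
    · right
      rcases Nat.lt_or_ge a (i + 2) with h1' | h1'
      · left; rw [show a = i + 1 by omega]; exact h1
      rcases Nat.lt_or_ge a (i + 3) with h2' | h2'
      · right; left; rw [show a = i + 2 by omega]; exact hL1
      · right; right; rw [show a = i + 3 by omega]; exact hL2
    · left
      have := hQ_arc (a - (i + 4)) (by omega)
      rw [show i + 4 + (a - (i + 4)) = a by omega] at this
      rw [this]; exact hW'v _
  have hbL : u b ∈ vertsOf P ∨ (u b = t + ![3, 0] ∨ u b = t + ![2, 0] ∨ u b = t + ![1, 0]) := by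
    rcases Nat.lt_or_ge b (i + n + 7) with hlt | hge
    · right
      rcases Nat.lt_or_ge b (i + n + 5) with h1' | h1'
      · left; rw [show b = i + n + 4 by omega]; exact hR1
      rcases Nat.lt_or_ge b (i + n + 6) with h2' | h2'
      · right; left; rw [show b = i + n + 5 by omega]; exact hR2
      · right; right; rw [show b = i + n + 6 by omega]; exact hR3
    · left
      have := hP_arc (b - (i + n + 7)) (by omega)
      rw [show i + n + 7 + (b - (i + n + 7)) = b by omega] at this
      rw [this]; exact hWv _
  rcases haR with haQ | hj <;> rcases hbL with hbP | hj'
  · exact lt_of_lt_of_le (by omega) (hK1 _ hbP _ haQ (Or.inl hrow.symm))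
  · -- a `Q`-site against a lower-connector site (row `t₁`): corridor against `t ∈ P`
    rcases hj' with hbE | hbE | hbE <;> rw [hbE] at hrow ⊢
    · have := hK1 _ tP _ haQ (by simp at hrow ⊢; omega)
      simp at this hrow ⊢
      rcases lt_or_eq_of_le (show t 0 + 2 ≤ u a 0 by omega) with hlt | heq
      · rcases lt_or_eq_of_le (show t 0 + 3 ≤ u a 0 by omega) with hlt' | heq'
        · omega
        · exact absurd haQ (by rw [eq_off₃ (t := t) (x := u a) (a := 3) (b := 0) (by omega) (by omega)]; exact hjQ)
      · exact absurd haQ (by rw [eq_off₃ (t := t) (x := u a) (a := 2) (b := 0) (by omega) (by omega)]; exact h.f20.2)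
    · have := hK1 _ tP _ haQ (by simp at hrow ⊢; omega)
      simp at this hrow ⊢
      rcases lt_or_eq_of_le (show t 0 + 2 ≤ u a 0 by omega) with hlt | heq
      · omega
      · exact absurd haQ (by rw [eq_off₃ (t := t) (x := u a) (a := 2) (b := 0) (by omega) (by omega)]; exact h.f20.2)
    · have := hK1 _ tP _ haQ (by simp at hrow ⊢; omega); simp at this ⊢; omega
  · -- an upper-connector site against a `P`-site (row `t₁ + 1`): corridor against `w′ ∈ Q`
    rcases hj with haE | haE | haE <;> rw [haE] at hrow ⊢
    · have := hK1 _ hbP _ wQ (by simp at hrow ⊢; omega)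
      simp at this hrow ⊢
      rcases lt_or_eq_of_le (show u b 0 ≤ t 0 by omega) with hlt | heq
      · rcases lt_or_eq_of_le (show u b 0 ≤ t 0 - 1 by omega) with hlt' | heq'
        · omega
        · exact absurd hbP (by rw [eq_off₃ (t := t) (x := u b) (a := -1) (b := 1) (by omega) (by omega)]; exact hjP)
      · exact absurd hbP (by rw [eq_off₃ (t := t) (x := u b) (a := 0) (b := 1) (by omega) (by omega)]; exact h.f01.1)
    · have := hK1 _ hbP _ wQ (by simp at hrow ⊢; omega)
      simp at this hrow ⊢
      rcases lt_or_eq_of_le (show u b 0 ≤ t 0 by omega) with hlt | heq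
      · omega
      · exact absurd hbP (by rw [eq_off₃ (t := t) (x := u b) (a := 0) (b := 1) (by omega) (by omega)]; exact h.f01.1)
    · have := hK1 _ hbP _ wQ (by simp at hrow ⊢; omega); simp at this ⊢; omega
  · rcases hj with haE | haE | haE <;> rcases hj' with hbE | hbE | hbE <;> rw [haE, hbE] at hrow ⊢ <;>
      (simp only [Pi.add_apply, uy0, uy1] at hrow ⊢; omega)

/-- **A T3 decomposition, shape TF (`t+(−1,1) ∈ P`, `t+(3,0) ∉ Q`), imposes the forward horizontal cut `IsHdCutTF (n + 2) u (i+1)` on every traversal of the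
joined polygon with `u i = t + (0,1)`, `u (i+1) = t + (-1,1)`.** [cite: Hammond2015SAPJoining, §4.2 pp. 20–24 (arXiv v5: recognising the junction plaquette); Madras1995LatticeAnimalsExponent, §2] -/
theorem isHdCutTF_of_isT3 (hjP : t + ![-1, 1] ∈ vertsOf P) (hjQ : t + ![3, 0] ∉ vertsOf Q) (hu : IsPolyTraversal brickWallGraph (hdJoin t P Q) (2 * n + 4) u) {i : ℕ}
    (h0 : u i = t + ![0, 1]) (h1 : u (i + 1) = t + ![-1, 1]) : IsHdCutTF (n + 2) u (i + 1) := by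
  classical
  have hdisj := disjoint_of_corridor (P := P) (Q := Q) hK1
  obtain ⟨hJ, -⟩ := h.isPolygon_join hP hQ hdisj
  set J := hdJoin t P Q with hJdef
  have hpar := h.hpar
  have tP : t + ![0, 0] ∈ vertsOf P := tP₃ h
  have wQ : t + ![2, 1] ∈ vertsOf Q := wQ₃ h
  have cJ1 : s(t + ![0, 0], t + ![1, 0]) ∈ J := cJ1₃ h
  have cJ2 : s(t + ![1, 0], t + ![2, 0]) ∈ J := cJ2₃ h
  have cJ3 : s(t + ![2, 0], t + ![3, 0]) ∈ J := cJ3₃ h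
  have cJ4 : s(t + ![-1, 1], t + ![0, 1]) ∈ J := cJ4₃ h
  have cJ5 : s(t + ![0, 1], t + ![1, 1]) ∈ J := cJ5₃ h
  have cJ6 : s(t + ![1, 1], t + ![2, 1]) ∈ J := cJ6₃ h
  have cJc : s(t + ![3, 0], t + ![3, 1]) ∈ J := cJc₃ h hjQ
  -- open `P` along `t+(−1,1) – b – t`: the `P`-arc `W`
  have hpE : ∀ e ∈ (wPf₃ t hpar).edges, e ∈ P := fun e he => by
    simp only [wPf₃, Walk.edges_cons, Walk.edges_nil, List.mem_cons, List.not_mem_nil, or_false] at he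
    rcases he with rfl | rfl
    · exact forcedP₃ hP h hjP
    · rw [Sym2.eq_swap]; exact h.hl
  obtain ⟨W, hW, hWe, hWl, hWs⟩ := hP.exists_isPath_sdiff (wPf₃ t hpar) (by rw [Walk.isPath_def]; simp [wPf₃]) hpE
    (by simp [wPf₃]) (by simp [wPf₃]; omega)
  have hpl : (wPf₃ t hpar).length = 2 := by simp [wPf₃]
  have hWJ : ∀ e ∈ W.edges, e ∈ J := fun e he => by
    have hm : e ∈ P \ (wPf₃ t hpar).edges.toFinset := by rw [← hWe]; exact List.mem_toFinset.2 he
    rw [Finset.mem_sdiff] at hm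
    have hne : ¬ (e = s(t + ![-1, 1], t + ![-1, 0]) ∨ e = s(t + ![-1, 0], t + ![0, 0])) := by
      intro hh; apply hm.2
      simp only [wPf₃, Walk.edges_cons, Walk.edges_nil, List.toFinset_cons, List.toFinset_nil, Finset.mem_insert,
        Finset.notMem_empty, or_false]
      exact hh
    exact memJ_of_memP₃ hK1 h hm.1 (fun he' => hne (Or.inr (by rw [Sym2.eq_swap]; exact he')))
      (fun _ he' => hne (Or.inl (by rw [Sym2.eq_swap]; exact he')))
  have hWlen : W.length = n - 2 := by rw [hpl] at hWl; omega
  have hWv : ∀ k, W.getVert k ∈ vertsOf P := fun k => mem_vertsOf.2 ((hWs _).1 (W.getVert_mem_support k)).1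
  -- open `Q` at `c – w′`: the `Q`-arc `W' : c ⇝ w′`
  obtain ⟨W', hW', hW'e, -, hW'l, hW's⟩ := hQ.exists_isPath_erase h.hr
  have hW'J : ∀ e ∈ W'.edges, e ∈ J := fun e he => by
    have hm : e ∈ Q.erase s(t + ![3, 1], t + ![2, 1]) := by rw [← hW'e]; exact List.mem_toFinset.2 he
    exact memJ_of_memQ₃ hK1 h (Finset.mem_erase.1 hm).2 (Finset.mem_erase.1 hm).1 (fun hv => absurd hv hjQ)
  have hW'len : W'.length = n - 1 := by omega
  have hW'v : ∀ k, W'.getVert k ∈ vertsOf Q := fun k => mem_vertsOf.2 ((hW's _).1 (W'.getVert_mem_support k))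
  have hWedge : ∀ k, k < W.length → s(W.getVert k, W.getVert (k + 1)) ∈ J := fun k hk => hWJ _ (getVert_edge₃ W hk)
  have hW'edge : ∀ k, k < W'.length → s(W'.getVert k, W'.getVert (k + 1)) ∈ J := fun k hk => hW'J _ (getVert_edge₃ W' hk)
  -- STEP 1: the `P`-arc, `u (i+1+k) = W_k`
  have hu2 : u (i + 2) = W.getVert 1 := by
    have := next_eq₃ (i := i) hu hJ (x := t + ![0, 1]) (y := W.getVert 1) (by rw [h1]; exact cJ4) ?_ ?_ h0
    · exact this
    · rw [h1]; have := hWedge 0 (by omega); rwa [Walk.getVert_zero] at this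
    · exact (fun he => h.f01.1 (he ▸ hWv 1))
  have hP_arc : ∀ k, k ≤ n - 2 → u (i + 1 + k) = W.getVert k := fun k hk =>
    hu.follows_path hJ W hW hWJ (i := i + 1) h1 (fun _ => by rw [show i + 1 + 1 = i + 2 by omega]; exact hu2) k (by omega)
  have hut : u (i + n - 1) = t + ![0, 0] := by
    have := hP_arc (n - 2) le_rfl
    rw [show i + 1 + (n - 2) = i + n - 1 by omega, ← hWlen, Walk.getVert_length] at this; exact this
  have hut1 : u (i + n - 2) = W.getVert (n - 3) := by
    have := hP_arc (n - 3) (by omega); rwa [show i + 1 + (n - 3) = i + n - 2 by omega] at this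
  have hWlast : s(t + ![0, 0], W.getVert (n - 3)) ∈ J := by
    have := hWedge (n - 3) (by omega)
    rw [show n - 3 + 1 = n - 2 by omega, ← hWlen, Walk.getVert_length, Sym2.eq_swap] at this
    exact this
  -- STEP 2: the lower connector
  have hR1 : u (i + n) = t + ![1, 0] := by
    have := next_eq₃ (i := i + n - 2) hu hJ (x := W.getVert (n - 3)) (y := t + ![1, 0]) (by rw [show i + n - 2 + 1 = i + n - 1 by omega, hut]; exact hWlast)
      (by rw [show i + n - 2 + 1 = i + n - 1 by omega, hut]; exact cJ1) (fun he => h.f10.1 (he ▸ hWv (n - 3))) hut1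
    rwa [show i + n - 2 + 2 = i + n by omega] at this
  have hR2 : u (i + n + 1) = t + ![2, 0] := by
    have := next_eq₃ (i := i + n - 1) hu hJ (x := t + ![0, 0]) (y := t + ![2, 0]) (by rw [show i + n - 1 + 1 = i + n by omega, hR1, Sym2.eq_swap]; exact cJ1)
      (by rw [show i + n - 1 + 1 = i + n by omega, hR1]; exact cJ2) (off_ne₃ (by decide)) hut
    rwa [show i + n - 1 + 2 = i + n + 1 by omega] at this
  have hR3 : u (i + n + 2) = t + ![3, 0] := by
    have := next_eq₃ (i := i + n) hu hJ (x := t + ![1, 0]) (y := t + ![3, 0]) (by rw [hR2, Sym2.eq_swap]; exact cJ2)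
      (by rw [hR2]; exact cJ3) (off_ne₃ (by decide)) hR1
    exact this
  have hR4 : u (i + n + 3) = t + ![3, 1] := by
    have := next_eq₃ (i := i + n + 1) hu hJ (x := t + ![2, 0]) (y := t + ![3, 1]) (by rw [show i + n + 1 + 1 = i + n + 2 by omega, hR3, Sym2.eq_swap]; exact cJ3)
      (by rw [show i + n + 1 + 1 = i + n + 2 by omega, hR3]; exact cJc) (off_ne₃ (by decide)) hR2
    rwa [show i + n + 1 + 2 = i + n + 3 by omega] at this
  -- STEP 3: the `Q`-arc
  have hQ1 : u (i + n + 3 + 1) = W'.getVert 1 := by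
    have := next_eq₃ (i := i + n + 2) hu hJ (x := t + ![3, 0]) (y := W'.getVert 1) (by rw [show i + n + 2 + 1 = i + n + 3 by omega, hR4, Sym2.eq_swap]; exact cJc) ?_ ?_ hR3
    · rwa [show i + n + 2 + 2 = i + n + 3 + 1 by omega] at this
    · rw [show i + n + 2 + 1 = i + n + 3 by omega, hR4]; have := hW'edge 0 (by omega); rwa [Walk.getVert_zero] at this
    · exact (fun he => hjQ (he ▸ hW'v 1))
  have hQ_arc : ∀ k, k ≤ n - 1 → u (i + n + 3 + k) = W'.getVert k := fun k hk =>
    hu.follows_path hJ W' hW' hW'J (i := i + n + 3) hR4 (fun _ => hQ1) k (by omega)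
  have huw : u (i + 2 * n + 2) = t + ![2, 1] := by
    have := hQ_arc (n - 1) le_rfl
    rw [show i + n + 3 + (n - 1) = i + 2 * n + 2 by omega, ← hW'len, Walk.getVert_length] at this; exact this
  have huw1 : u (i + 2 * n + 1) = W'.getVert (n - 2) := by
    have := hQ_arc (n - 2) (by omega); rwa [show i + n + 3 + (n - 2) = i + 2 * n + 1 by omega] at this
  have hW'last : s(t + ![2, 1], W'.getVert (n - 2)) ∈ J := by
    have := hW'edge (n - 2) (by omega)
    rw [show n - 2 + 1 = n - 1 by omega, ← hW'len, Walk.getVert_length, Sym2.eq_swap] at this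
    exact this
  -- STEP 4: the upper connector
  have hL1 : u (i + 2 * n + 3) = t + ![1, 1] := by
    have := next_eq₃ (i := i + 2 * n + 1) hu hJ (x := W'.getVert (n - 2)) (y := t + ![1, 1]) (by rw [show i + 2 * n + 1 + 1 = i + 2 * n + 2 by omega, huw]; exact hW'last)
      (by rw [show i + 2 * n + 1 + 1 = i + 2 * n + 2 by omega, huw, Sym2.eq_swap]; exact cJ6) (fun he => h.f11.2 (he ▸ hW'v (n - 2))) huw1
    rwa [show i + 2 * n + 1 + 2 = i + 2 * n + 3 by omega] at this
  have hL2 : u (i + 2 * n + 4) = t + ![0, 1] := by rw [show i + 2 * n + 4 = i + (2 * n + 4) by omega, hu.periodic, h0]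
  -- the cut
  refine isHdCutTF_of_eqs t h1
    (by rw [show i + 1 + (n + 2) - 4 = i + n - 1 by omega, hut])
    (by rw [show i + 1 + (n + 2) - 3 = i + n by omega, hR1])
    (by rw [show i + 1 + (n + 2) - 2 = i + n + 1 by omega, hR2])
    (by rw [show i + 1 + (n + 2) - 1 = i + n + 2 by omega, hR3])
    (by rw [show i + 1 + (n + 2) = i + n + 3 by omega, hR4])
    (by rw [show i + 1 + 2 * (n + 2) - 3 = i + 2 * n + 2 by omega, huw])
    (by rw [show i + 1 + 2 * (n + 2) - 2 = i + 2 * n + 3 by omega, hL1])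
    (by rw [show i + 1 + 2 * (n + 2) - 1 = i + 2 * n + 4 by omega, hL2])
    ?_
  -- row separation: the left block (`P`-arc and lower connector) lies left of the right block (`Q`-arc and upper connector)
  intro a b ha1 ha2 hb1 hb2 hrow
  have haL : u a ∈ vertsOf P ∨ (u a = t + ![1, 0] ∨ u a = t + ![2, 0] ∨ u a = t + ![3, 0]) := by
    rcases Nat.lt_or_ge a (i + n - 1 + 1) with hlt | hge
    · left
      have := hP_arc (a - (i + 1)) (by omega)
      rw [show i + 1 + (a - (i + 1)) = a by omega] at this
      rw [this]; exact hWv _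
    · right
      rcases Nat.lt_or_ge a (i + n - 1 + 2) with h1' | h1'
      · left; rw [show a = i + n by omega]; exact hR1
      rcases Nat.lt_or_ge a (i + n - 1 + 3) with h2' | h2'
      · right; left; rw [show a = i + n + 1 by omega]; exact hR2
      · right; right; rw [show a = i + n + 2 by omega]; exact hR3
  have hbR : u b ∈ vertsOf Q ∨ (u b = t + ![1, 1] ∨ u b = t + ![0, 1]) := by
    rcases Nat.lt_or_ge b (i + 2 * n + 2 + 1) with hlt | hge
    · left
      have := hQ_arc (b - (i + n + 3)) (by omega)
      rw [show i + n + 3 + (b - (i + n + 3)) = b by omega] at this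
      rw [this]; exact hW'v _
    · right
      rcases Nat.lt_or_ge b (i + 2 * n + 2 + 2) with h1' | h1'
      · left; rw [show b = i + 2 * n + 3 by omega]; exact hL1
      · right; rw [show b = i + 2 * n + 4 by omega]; exact hL2
  rcases haL with haP | hj <;> rcases hbR with hbQ | hj'
  · exact lt_of_lt_of_le (by omega) (hK1 _ haP _ hbQ (Or.inl hrow))
  · -- a `P`-site against an upper-connector site (row `t₁ + 1`): corridor against `w′ ∈ Q`; `t+(0,1)`, `t+(−1,1)` are off `P`
    rcases hj' with hbE | hbE <;> rw [hbE] at hrow ⊢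
    · have := hK1 _ haP _ wQ (by simp at hrow ⊢; omega); simp at this ⊢; omega
    · have := hK1 _ haP _ wQ (by simp at hrow ⊢; omega)
      simp at this hrow ⊢
      rcases lt_or_eq_of_le (show u a 0 ≤ t 0 by omega) with hlt | heq
      · omega
      · exact absurd haP (by rw [eq_off₃ (t := t) (x := u a) (a := 0) (b := 1) (by omega) (by omega)]; exact h.f01.1)
  · -- a lower-connector site against a `Q`-site (row `t₁`): corridor against `t ∈ P`; `t+(2,0)`, `t+(3,0)` are off `Q`
    rcases hj with haE | haE | haE <;> rw [haE] at hrow ⊢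
    · have := hK1 _ tP _ hbQ (by simp at hrow ⊢; omega); simp at this ⊢; omega
    · have := hK1 _ tP _ hbQ (by simp at hrow ⊢; omega)
      simp at this hrow ⊢
      rcases lt_or_eq_of_le (show t 0 + 2 ≤ u b 0 by omega) with hlt | heq
      · omega
      · exact absurd hbQ (by rw [eq_off₃ (t := t) (x := u b) (a := 2) (b := 0) (by omega) (by omega)]; exact h.f20.2)
    · have := hK1 _ tP _ hbQ (by simp at hrow ⊢; omega)
      simp at this hrow ⊢
      rcases lt_or_eq_of_le (show t 0 + 2 ≤ u b 0 by omega) with hlt | heq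
      · rcases lt_or_eq_of_le (show t 0 + 3 ≤ u b 0 by omega) with hlt' | heq'
        · omega
        · exact absurd hbQ (by rw [eq_off₃ (t := t) (x := u b) (a := 3) (b := 0) (by omega) (by omega)]; exact hjQ)
      · exact absurd hbQ (by rw [eq_off₃ (t := t) (x := u b) (a := 2) (b := 0) (by omega) (by omega)]; exact h.f20.2)
  · rcases hj with haE | haE | haE <;> rcases hj' with hbE | hbE <;> rw [haE, hbE] at hrow ⊢ <;>
      (simp only [Pi.add_apply, uy0, uy1] at hrow ⊢; omega)

/-- **A T3 decomposition, shape TF (`t+(−1,1) ∈ P`, `t+(3,0) ∉ Q`), imposes the BACKWARD horizontal cut `IsHdCutTF' (n + 2) u (i+1)` on every traversal of the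
joined polygon with `u i = t + (-1,1)`, `u (i+1) = t + (0,1)`.** [cite: Hammond2015SAPJoining, §4.2 pp. 20–24 (arXiv v5: recognising the junction plaquette); Madras1995LatticeAnimalsExponent, §2] -/
theorem isHdCutTF'_of_isT3 (hjP : t + ![-1, 1] ∈ vertsOf P) (hjQ : t + ![3, 0] ∉ vertsOf Q) (hu : IsPolyTraversal brickWallGraph (hdJoin t P Q) (2 * n + 4) u) {i : ℕ}
    (h0 : u i = t + ![-1, 1]) (h1 : u (i + 1) = t + ![0, 1]) : IsHdCutTF' (n + 2) u (i + 1) := by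
  classical
  have hdisj := disjoint_of_corridor (P := P) (Q := Q) hK1
  obtain ⟨hJ, -⟩ := h.isPolygon_join hP hQ hdisj
  set J := hdJoin t P Q with hJdef
  have hpar := h.hpar
  have tP : t + ![0, 0] ∈ vertsOf P := tP₃ h
  have wQ : t + ![2, 1] ∈ vertsOf Q := wQ₃ h
  have cJ1 : s(t + ![0, 0], t + ![1, 0]) ∈ J := cJ1₃ h
  have cJ2 : s(t + ![1, 0], t + ![2, 0]) ∈ J := cJ2₃ h
  have cJ3 : s(t + ![2, 0], t + ![3, 0]) ∈ J := cJ3₃ h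
  have cJ4 : s(t + ![-1, 1], t + ![0, 1]) ∈ J := cJ4₃ h
  have cJ5 : s(t + ![0, 1], t + ![1, 1]) ∈ J := cJ5₃ h
  have cJ6 : s(t + ![1, 1], t + ![2, 1]) ∈ J := cJ6₃ h
  have cJc : s(t + ![3, 0], t + ![3, 1]) ∈ J := cJc₃ h hjQ
  -- open `P` along `t+(−1,1) – b – t`: the `P`-arc `W`
  have hpE : ∀ e ∈ (wPb₃ t hpar).edges, e ∈ P := fun e he => by
    simp only [wPb₃, Walk.edges_cons, Walk.edges_nil, List.mem_cons, List.not_mem_nil, or_false] at he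
    rcases he with rfl | rfl
    · exact h.hl
    · rw [Sym2.eq_swap]; exact forcedP₃ hP h hjP
  obtain ⟨W, hW, hWe, hWl, hWs⟩ := hP.exists_isPath_sdiff (wPb₃ t hpar) (by rw [Walk.isPath_def]; simp [wPb₃]) hpE
    (by simp [wPb₃]) (by simp [wPb₃]; omega)
  have hpl : (wPb₃ t hpar).length = 2 := by simp [wPb₃]
  have hWJ : ∀ e ∈ W.edges, e ∈ J := fun e he => by
    have hm : e ∈ P \ (wPb₃ t hpar).edges.toFinset := by rw [← hWe]; exact List.mem_toFinset.2 he
    rw [Finset.mem_sdiff] at hm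
    have hne : ¬ (e = s(t + ![0, 0], t + ![-1, 0]) ∨ e = s(t + ![-1, 0], t + ![-1, 1])) := by
      intro hh; apply hm.2
      simp only [wPb₃, Walk.edges_cons, Walk.edges_nil, List.toFinset_cons, List.toFinset_nil, Finset.mem_insert,
        Finset.notMem_empty, or_false]
      exact hh
    exact memJ_of_memP₃ hK1 h hm.1 (fun he' => hne (Or.inl he')) (fun _ he' => hne (Or.inr he'))
  have hWlen : W.length = n - 2 := by rw [hpl] at hWl; omega
  have hWv : ∀ k, W.getVert k ∈ vertsOf P := fun k => mem_vertsOf.2 ((hWs _).1 (W.getVert_mem_support k)).1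
  -- open `Q` at `w′ – c`: the `Q`-arc `W' : w′ ⇝ c`
  have hwc : s(t + ![2, 1], t + ![3, 1]) ∈ Q := by rw [Sym2.eq_swap]; exact h.hr
  obtain ⟨W', hW', hW'e, -, hW'l, hW's⟩ := hQ.exists_isPath_erase hwc
  have hW'J : ∀ e ∈ W'.edges, e ∈ J := fun e he => by
    have hm : e ∈ Q.erase s(t + ![2, 1], t + ![3, 1]) := by rw [← hW'e]; exact List.mem_toFinset.2 he
    exact memJ_of_memQ₃ hK1 h (Finset.mem_erase.1 hm).2 (by rw [Sym2.eq_swap]; exact (Finset.mem_erase.1 hm).1)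
      (fun hv => absurd hv hjQ)
  have hW'len : W'.length = n - 1 := by omega
  have hW'v : ∀ k, W'.getVert k ∈ vertsOf Q := fun k => mem_vertsOf.2 ((hW's _).1 (W'.getVert_mem_support k))
  have hWedge : ∀ k, k < W.length → s(W.getVert k, W.getVert (k + 1)) ∈ J := fun k hk => hWJ _ (getVert_edge₃ W hk)
  have hW'edge : ∀ k, k < W'.length → s(W'.getVert k, W'.getVert (k + 1)) ∈ J := fun k hk => hW'J _ (getVert_edge₃ W' hk)
  -- STEP 1: the upper connector `t+(0,1) → t+(1,1) → w′`
  have hL1 : u (i + 2) = t + ![1, 1] := by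
    have := next_eq₃ (i := i) hu hJ (x := t + ![-1, 1]) (y := t + ![1, 1]) (by rw [h1, Sym2.eq_swap]; exact cJ4)
      (by rw [h1]; exact cJ5) (off_ne₃ (by decide)) h0
    exact this
  have hL2 : u (i + 3) = t + ![2, 1] := by
    have := next_eq₃ (i := i + 1) hu hJ (x := t + ![0, 1]) (y := t + ![2, 1]) (by rw [show i + 1 + 1 = i + 2 by omega, hL1, Sym2.eq_swap]; exact cJ5)
      (by rw [show i + 1 + 1 = i + 2 by omega, hL1]; exact cJ6) (off_ne₃ (by decide)) h1
    rwa [show i + 1 + 2 = i + 3 by omega] at this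
  -- STEP 2: the `Q`-arc backwards, `u (i+3+k) = W'_k`
  have hQ1 : u (i + 4) = W'.getVert 1 := by
    have := next_eq₃ (i := i + 2) hu hJ (x := t + ![1, 1]) (y := W'.getVert 1) (by rw [show i + 2 + 1 = i + 3 by omega, hL2, Sym2.eq_swap]; exact cJ6) ?_ ?_ hL1
    · rwa [show i + 2 + 2 = i + 4 by omega] at this
    · rw [show i + 2 + 1 = i + 3 by omega, hL2]; have := hW'edge 0 (by omega); rwa [Walk.getVert_zero] at this
    · exact (fun he => h.f11.2 (he ▸ hW'v 1))
  have hQ_arc : ∀ k, k ≤ n - 1 → u (i + 3 + k) = W'.getVert k := fun k hk =>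
    hu.follows_path hJ W' hW' hW'J (i := i + 3) hL2 (fun _ => by rw [show i + 3 + 1 = i + 4 by omega]; exact hQ1) k (by omega)
  have huR0 : u (i + n + 2) = t + ![3, 1] := by
    have := hQ_arc (n - 1) le_rfl
    rw [show i + 3 + (n - 1) = i + n + 2 by omega, ← hW'len, Walk.getVert_length] at this; exact this
  have huR01 : u (i + n + 1) = W'.getVert (n - 2) := by
    have := hQ_arc (n - 2) (by omega); rwa [show i + 3 + (n - 2) = i + n + 1 by omega] at this
  have hW'last : s(t + ![3, 1], W'.getVert (n - 2)) ∈ J := by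
    have := hW'edge (n - 2) (by omega)
    rw [show n - 2 + 1 = n - 1 by omega, ← hW'len, Walk.getVert_length, Sym2.eq_swap] at this
    exact this
  -- STEP 3: the lower connector backwards
  have hR1 : u (i + n + 3) = t + ![3, 0] := by
    have := next_eq₃ (i := i + n + 1) hu hJ (x := W'.getVert (n - 2)) (y := t + ![3, 0]) (by rw [show i + n + 1 + 1 = i + n + 2 by omega, huR0]; exact hW'last)
      (by rw [show i + n + 1 + 1 = i + n + 2 by omega, huR0, Sym2.eq_swap]; exact cJc) (fun he => hjQ (he ▸ hW'v (n - 2))) huR01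
    rwa [show i + n + 1 + 2 = i + n + 3 by omega] at this
  have hR2 : u (i + n + 4) = t + ![2, 0] := by
    have := next_eq₃ (i := i + n + 2) hu hJ (x := t + ![3, 1]) (y := t + ![2, 0]) (by rw [show i + n + 2 + 1 = i + n + 3 by omega, hR1]; exact cJc)
      (by rw [show i + n + 2 + 1 = i + n + 3 by omega, hR1, Sym2.eq_swap]; exact cJ3) (off_ne₃ (by decide)) huR0
    rwa [show i + n + 2 + 2 = i + n + 4 by omega] at this
  have hR3 : u (i + n + 5) = t + ![1, 0] := by
    have := next_eq₃ (i := i + n + 3) hu hJ (x := t + ![3, 0]) (y := t + ![1, 0]) (by rw [show i + n + 3 + 1 = i + n + 4 by omega, hR2]; exact cJ3)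
      (by rw [show i + n + 3 + 1 = i + n + 4 by omega, hR2, Sym2.eq_swap]; exact cJ2) (off_ne₃ (by decide)) hR1
    rwa [show i + n + 3 + 2 = i + n + 5 by omega] at this
  have hR4 : u (i + n + 6) = t + ![0, 0] := by
    have := next_eq₃ (i := i + n + 4) hu hJ (x := t + ![2, 0]) (y := t + ![0, 0]) (by rw [show i + n + 4 + 1 = i + n + 5 by omega, hR3]; exact cJ2)
      (by rw [show i + n + 4 + 1 = i + n + 5 by omega, hR3, Sym2.eq_swap]; exact cJ1) (off_ne₃ (by decide)) hR2
    rwa [show i + n + 4 + 2 = i + n + 6 by omega] at this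
  -- STEP 4: the `P`-arc backwards
  have hP1 : u (i + n + 6 + 1) = W.getVert 1 := by
    have := next_eq₃ (i := i + n + 5) hu hJ (x := t + ![1, 0]) (y := W.getVert 1) (by rw [show i + n + 5 + 1 = i + n + 6 by omega, hR4]; exact cJ1) ?_ ?_ hR3
    · rwa [show i + n + 5 + 2 = i + n + 6 + 1 by omega] at this
    · rw [show i + n + 5 + 1 = i + n + 6 by omega, hR4]; have := hWedge 0 (by omega); rwa [Walk.getVert_zero] at this
    · exact (fun he => h.f10.1 (he ▸ hWv 1))
  have hP_arc : ∀ k, k ≤ n - 2 → u (i + n + 6 + k) = W.getVert k := fun k hk =>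
    hu.follows_path hJ W hW hWJ (i := i + n + 6) hR4 (fun _ => hP1) k (by omega)
  have huend : u (i + (2 * n + 4)) = t + ![-1, 1] := by
    have := hP_arc (n - 2) le_rfl
    rw [show i + n + 6 + (n - 2) = i + (2 * n + 4) by omega, ← hWlen, Walk.getVert_length] at this; exact this
  -- the backward cut
  refine isHdCutTF'_of_eqs t h1
    (by rw [show i + 1 + 1 = i + 2 by omega, hL1])
    (by rw [show i + 1 + 2 = i + 3 by omega, hL2])
    (by rw [show i + 1 + (n + 2) - 1 = i + n + 2 by omega, huR0])
    (by rw [show i + 1 + (n + 2) = i + n + 3 by omega, hR1])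
    (by rw [show i + 1 + (n + 2) + 1 = i + n + 4 by omega, hR2])
    (by rw [show i + 1 + (n + 2) + 2 = i + n + 5 by omega, hR3])
    (by rw [show i + 1 + (n + 2) + 3 = i + n + 6 by omega, hR4])
    (by rw [show i + 1 + 2 * (n + 2) - 1 = i + (2 * n + 4) by omega, huend])
    ?_
  -- row separation: the first block (upper connector, `Q`-arc) lies right of the second (lower connector, `P`-arc)
  intro a b ha1 ha2 hb1 hb2 hrow
  have haR : u a ∈ vertsOf Q ∨ (u a = t + ![0, 1] ∨ u a = t + ![1, 1]) := by
    rcases Nat.lt_or_ge a (i + 3) with hlt | hge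
    · right
      rcases Nat.lt_or_ge a (i + 2) with h1' | h1'
      · left; rw [show a = i + 1 by omega]; exact h1
      · right; rw [show a = i + 2 by omega]; exact hL1
    · left
      have := hQ_arc (a - (i + 3)) (by omega)
      rw [show i + 3 + (a - (i + 3)) = a by omega] at this
      rw [this]; exact hW'v _
  have hbL : u b ∈ vertsOf P ∨ (u b = t + ![3, 0] ∨ u b = t + ![2, 0] ∨ u b = t + ![1, 0]) := by
    rcases Nat.lt_or_ge b (i + n + 6) with hlt | hge
    · right
      rcases Nat.lt_or_ge b (i + n + 4) with h1' | h1'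
      · left; rw [show b = i + n + 3 by omega]; exact hR1
      rcases Nat.lt_or_ge b (i + n + 5) with h2' | h2'
      · right; left; rw [show b = i + n + 4 by omega]; exact hR2
      · right; right; rw [show b = i + n + 5 by omega]; exact hR3
    · left
      have := hP_arc (b - (i + n + 6)) (by omega)
      rw [show i + n + 6 + (b - (i + n + 6)) = b by omega] at this
      rw [this]; exact hWv _
  rcases haR with haQ | hj <;> rcases hbL with hbP | hj'
  · exact lt_of_lt_of_le (by omega) (hK1 _ hbP _ haQ (Or.inl hrow.symm))
  · -- a `Q`-site against a lower-connector site (row `t₁`): corridor against `t ∈ P`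
    rcases hj' with hbE | hbE | hbE <;> rw [hbE] at hrow ⊢
    · have := hK1 _ tP _ haQ (by simp at hrow ⊢; omega)
      simp at this hrow ⊢
      rcases lt_or_eq_of_le (show t 0 + 2 ≤ u a 0 by omega) with hlt | heq
      · rcases lt_or_eq_of_le (show t 0 + 3 ≤ u a 0 by omega) with hlt' | heq'
        · omega
        · exact absurd haQ (by rw [eq_off₃ (t := t) (x := u a) (a := 3) (b := 0) (by omega) (by omega)]; exact hjQ)
      · exact absurd haQ (by rw [eq_off₃ (t := t) (x := u a) (a := 2) (b := 0) (by omega) (by omega)]; exact h.f20.2)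
    · have := hK1 _ tP _ haQ (by simp at hrow ⊢; omega)
      simp at this hrow ⊢
      rcases lt_or_eq_of_le (show t 0 + 2 ≤ u a 0 by omega) with hlt | heq
      · omega
      · exact absurd haQ (by rw [eq_off₃ (t := t) (x := u a) (a := 2) (b := 0) (by omega) (by omega)]; exact h.f20.2)
    · have := hK1 _ tP _ haQ (by simp at hrow ⊢; omega); simp at this ⊢; omega
  · -- an upper-connector site against a `P`-site (row `t₁ + 1`): corridor against `w′ ∈ Q`
    rcases hj with haE | haE <;> rw [haE] at hrow ⊢
    · have := hK1 _ hbP _ wQ (by simp at hrow ⊢; omega)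
      simp at this hrow ⊢
      rcases lt_or_eq_of_le (show u b 0 ≤ t 0 by omega) with hlt | heq
      · omega
      · exact absurd hbP (by rw [eq_off₃ (t := t) (x := u b) (a := 0) (b := 1) (by omega) (by omega)]; exact h.f01.1)
    · have := hK1 _ hbP _ wQ (by simp at hrow ⊢; omega); simp at this ⊢; omega
  · rcases hj with haE | haE <;> rcases hj' with hbE | hbE | hbE <;> rw [haE, hbE] at hrow ⊢ <;>
      (simp only [Pi.add_apply, uy0, uy1] at hrow ⊢; omega)

/-- **A T3 decomposition, shape FT (`t+(−1,1) ∉ P`, `t+(3,0) ∈ Q`), imposes the forward horizontal cut `IsHdCutFT (n + 2) u (i+1)` on every traversal of the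
joined polygon with `u i = t + (-1,1)`, `u (i+1) = t + (-1,0)`.** [cite: Hammond2015SAPJoining, §4.2 pp. 20–24 (arXiv v5: recognising the junction plaquette); Madras1995LatticeAnimalsExponent, §2] -/
theorem isHdCutFT_of_isT3 (hjP : t + ![-1, 1] ∉ vertsOf P) (hjQ : t + ![3, 0] ∈ vertsOf Q) (hu : IsPolyTraversal brickWallGraph (hdJoin t P Q) (2 * n + 4) u) {i : ℕ}
    (h0 : u i = t + ![-1, 1]) (h1 : u (i + 1) = t + ![-1, 0]) : IsHdCutFT (n + 2) u (i + 1) := by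
  classical
  have hdisj := disjoint_of_corridor (P := P) (Q := Q) hK1
  obtain ⟨hJ, -⟩ := h.isPolygon_join hP hQ hdisj
  set J := hdJoin t P Q with hJdef
  have hpar := h.hpar
  have tP : t + ![0, 0] ∈ vertsOf P := tP₃ h
  have wQ : t + ![2, 1] ∈ vertsOf Q := wQ₃ h
  have cJ1 : s(t + ![0, 0], t + ![1, 0]) ∈ J := cJ1₃ h
  have cJ2 : s(t + ![1, 0], t + ![2, 0]) ∈ J := cJ2₃ h
  have cJ3 : s(t + ![2, 0], t + ![3, 0]) ∈ J := cJ3₃ h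
  have cJ4 : s(t + ![-1, 1], t + ![0, 1]) ∈ J := cJ4₃ h
  have cJ5 : s(t + ![0, 1], t + ![1, 1]) ∈ J := cJ5₃ h
  have cJ6 : s(t + ![1, 1], t + ![2, 1]) ∈ J := cJ6₃ h
  have cJb : s(t + ![-1, 0], t + ![-1, 1]) ∈ J := cJb₃ h hjP
  -- open `P` at `b – t`: the `P`-arc `W : b ⇝ t`
  have hbt : s(t + ![-1, 0], t + ![0, 0]) ∈ P := by rw [Sym2.eq_swap]; exact h.hl
  obtain ⟨W, hW, hWe, -, hWl, hWs⟩ := hP.exists_isPath_erase hbt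
  have hWJ : ∀ e ∈ W.edges, e ∈ J := fun e he => by
    have hm : e ∈ P.erase s(t + ![-1, 0], t + ![0, 0]) := by rw [← hWe]; exact List.mem_toFinset.2 he
    exact memJ_of_memP₃ hK1 h (Finset.mem_erase.1 hm).2 (by rw [Sym2.eq_swap]; exact (Finset.mem_erase.1 hm).1)
      (fun hv => absurd hv hjP)
  have hWlen : W.length = n - 1 := by omega
  have hWv : ∀ k, W.getVert k ∈ vertsOf P := fun k => mem_vertsOf.2 ((hWs _).1 (W.getVert_mem_support k))
  -- open `Q` along `t+(3,0) – c – w′`: the `Q`-arc `W'`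
  have hqE : ∀ e ∈ (wQf₃ t hpar).edges, e ∈ Q := fun e he => by
    simp only [wQf₃, Walk.edges_cons, Walk.edges_nil, List.mem_cons, List.not_mem_nil, or_false] at he
    rcases he with rfl | rfl
    · exact forcedQ₃ hQ h hjQ
    · exact h.hr
  obtain ⟨W', hW', hW'e, hW'l, hW's⟩ := hQ.exists_isPath_sdiff (wQf₃ t hpar) (by rw [Walk.isPath_def]; simp [wQf₃]) hqE
    (by simp [wQf₃]) (by simp [wQf₃]; omega)
  have hql : (wQf₃ t hpar).length = 2 := by simp [wQf₃]
  have hW'J : ∀ e ∈ W'.edges, e ∈ J := fun e he => by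
    have hm : e ∈ Q \ (wQf₃ t hpar).edges.toFinset := by rw [← hW'e]; exact List.mem_toFinset.2 he
    rw [Finset.mem_sdiff] at hm
    have hne : ¬ (e = s(t + ![3, 0], t + ![3, 1]) ∨ e = s(t + ![3, 1], t + ![2, 1])) := by
      intro hh; apply hm.2
      simp only [wQf₃, Walk.edges_cons, Walk.edges_nil, List.toFinset_cons, List.toFinset_nil, Finset.mem_insert,
        Finset.notMem_empty, or_false]
      exact hh
    exact memJ_of_memQ₃ hK1 h hm.1 (fun he' => hne (Or.inr he')) (fun _ he' => hne (Or.inl he'))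
  have hW'len : W'.length = n - 2 := by rw [hql] at hW'l; omega
  have hW'v : ∀ k, W'.getVert k ∈ vertsOf Q := fun k => mem_vertsOf.2 ((hW's _).1 (W'.getVert_mem_support k)).1
  have hWedge : ∀ k, k < W.length → s(W.getVert k, W.getVert (k + 1)) ∈ J := fun k hk => hWJ _ (getVert_edge₃ W hk)
  have hW'edge : ∀ k, k < W'.length → s(W'.getVert k, W'.getVert (k + 1)) ∈ J := fun k hk => hW'J _ (getVert_edge₃ W' hk)
  -- STEP 1: the `P`-arc, `u (i+1+k) = W_k`
  have hu2 : u (i + 2) = W.getVert 1 := by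
    have := next_eq₃ (i := i) hu hJ (x := t + ![-1, 1]) (y := W.getVert 1) (by rw [h1]; exact cJb) ?_ ?_ h0
    · exact this
    · rw [h1]; have := hWedge 0 (by omega); rwa [Walk.getVert_zero] at this
    · exact (fun he => hjP (he ▸ hWv 1))
  have hP_arc : ∀ k, k ≤ n - 1 → u (i + 1 + k) = W.getVert k := fun k hk =>
    hu.follows_path hJ W hW hWJ (i := i + 1) h1 (fun _ => by rw [show i + 1 + 1 = i + 2 by omega]; exact hu2) k (by omega)
  have hut : u (i + n) = t + ![0, 0] := by
    have := hP_arc (n - 1) le_rfl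
    rw [show i + 1 + (n - 1) = i + n by omega, ← hWlen, Walk.getVert_length] at this; exact this
  have hut1 : u (i + n - 1) = W.getVert (n - 2) := by
    have := hP_arc (n - 2) (by omega); rwa [show i + 1 + (n - 2) = i + n - 1 by omega] at this
  have hWlast : s(t + ![0, 0], W.getVert (n - 2)) ∈ J := by
    have := hWedge (n - 2) (by omega)
    rw [show n - 2 + 1 = n - 1 by omega, ← hWlen, Walk.getVert_length, Sym2.eq_swap] at this
    exact this
  -- STEP 2: the lower connector
  have hR1 : u (i + n + 1) = t + ![1, 0] := by
    have := next_eq₃ (i := i + n - 1) hu hJ (x := W.getVert (n - 2)) (y := t + ![1, 0]) (by rw [show i + n - 1 + 1 = i + n by omega, hut]; exact hWlast)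
      (by rw [show i + n - 1 + 1 = i + n by omega, hut]; exact cJ1) (fun he => h.f10.1 (he ▸ hWv (n - 2))) hut1
    rwa [show i + n - 1 + 2 = i + n + 1 by omega] at this
  have hR2 : u (i + n + 2) = t + ![2, 0] := by
    have := next_eq₃ (i := i + n) hu hJ (x := t + ![0, 0]) (y := t + ![2, 0]) (by rw [hR1, Sym2.eq_swap]; exact cJ1)
      (by rw [hR1]; exact cJ2) (off_ne₃ (by decide)) hut
    exact this
  have hR3 : u (i + n + 3) = t + ![3, 0] := by
    have := next_eq₃ (i := i + n + 1) hu hJ (x := t + ![1, 0]) (y := t + ![3, 0]) (by rw [show i + n + 1 + 1 = i + n + 2 by omega, hR2, Sym2.eq_swap]; exact cJ2)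
      (by rw [show i + n + 1 + 1 = i + n + 2 by omega, hR2]; exact cJ3) (off_ne₃ (by decide)) hR1
    rwa [show i + n + 1 + 2 = i + n + 3 by omega] at this
  -- STEP 3: the `Q`-arc
  have hQ1 : u (i + n + 3 + 1) = W'.getVert 1 := by
    have := next_eq₃ (i := i + n + 2) hu hJ (x := t + ![2, 0]) (y := W'.getVert 1) (by rw [show i + n + 2 + 1 = i + n + 3 by omega, hR3, Sym2.eq_swap]; exact cJ3) ?_ ?_ hR2
    · rwa [show i + n + 2 + 2 = i + n + 3 + 1 by omega] at this
    · rw [show i + n + 2 + 1 = i + n + 3 by omega, hR3]; have := hW'edge 0 (by omega); rwa [Walk.getVert_zero] at this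
    · exact (fun he => h.f20.2 (he ▸ hW'v 1))
  have hQ_arc : ∀ k, k ≤ n - 2 → u (i + n + 3 + k) = W'.getVert k := fun k hk =>
    hu.follows_path hJ W' hW' hW'J (i := i + n + 3) hR3 (fun _ => hQ1) k (by omega)
  have huw : u (i + 2 * n + 1) = t + ![2, 1] := by
    have := hQ_arc (n - 2) le_rfl
    rw [show i + n + 3 + (n - 2) = i + 2 * n + 1 by omega, ← hW'len, Walk.getVert_length] at this; exact this
  have huw1 : u (i + 2 * n) = W'.getVert (n - 3) := by
    have := hQ_arc (n - 3) (by omega); rwa [show i + n + 3 + (n - 3) = i + 2 * n by omega] at this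
  have hW'last : s(t + ![2, 1], W'.getVert (n - 3)) ∈ J := by
    have := hW'edge (n - 3) (by omega)
    rw [show n - 3 + 1 = n - 2 by omega, ← hW'len, Walk.getVert_length, Sym2.eq_swap] at this
    exact this
  -- STEP 4: the upper connector
  have hL1 : u (i + 2 * n + 2) = t + ![1, 1] := by
    have := next_eq₃ (i := i + 2 * n) hu hJ (x := W'.getVert (n - 3)) (y := t + ![1, 1]) (by rw [huw]; exact hW'last)
      (by rw [huw, Sym2.eq_swap]; exact cJ6) (fun he => h.f11.2 (he ▸ hW'v (n - 3))) huw1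
    exact this
  have hL2 : u (i + 2 * n + 3) = t + ![0, 1] := by
    have := next_eq₃ (i := i + 2 * n + 1) hu hJ (x := t + ![2, 1]) (y := t + ![0, 1]) (by rw [show i + 2 * n + 1 + 1 = i + 2 * n + 2 by omega, hL1]; exact cJ6)
      (by rw [show i + 2 * n + 1 + 1 = i + 2 * n + 2 by omega, hL1, Sym2.eq_swap]; exact cJ5) (off_ne₃ (by decide)) huw
    rwa [show i + 2 * n + 1 + 2 = i + 2 * n + 3 by omega] at this
  have hL3 : u (i + 2 * n + 4) = t + ![-1, 1] := by rw [show i + 2 * n + 4 = i + (2 * n + 4) by omega, hu.periodic, h0]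
  -- the cut
  refine isHdCutFT_of_eqs t h1
    (by rw [show i + 1 + (n + 2) - 3 = i + n by omega, hut])
    (by rw [show i + 1 + (n + 2) - 2 = i + n + 1 by omega, hR1])
    (by rw [show i + 1 + (n + 2) - 1 = i + n + 2 by omega, hR2])
    (by rw [show i + 1 + (n + 2) = i + n + 3 by omega, hR3])
    (by rw [show i + 1 + 2 * (n + 2) - 4 = i + 2 * n + 1 by omega, huw])
    (by rw [show i + 1 + 2 * (n + 2) - 3 = i + 2 * n + 2 by omega, hL1])
    (by rw [show i + 1 + 2 * (n + 2) - 2 = i + 2 * n + 3 by omega, hL2])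
    (by rw [show i + 1 + 2 * (n + 2) - 1 = i + 2 * n + 4 by omega, hL3])
    ?_
  -- row separation: the left block (`P`-arc and lower connector) lies left of the right block (`Q`-arc and upper connector)
  intro a b ha1 ha2 hb1 hb2 hrow
  have haL : u a ∈ vertsOf P ∨ (u a = t + ![1, 0] ∨ u a = t + ![2, 0]) := by
    rcases Nat.lt_or_ge a (i + n + 1) with hlt | hge
    · left
      have := hP_arc (a - (i + 1)) (by omega)
      rw [show i + 1 + (a - (i + 1)) = a by omega] at this
      rw [this]; exact hWv _
    · right
      rcases Nat.lt_or_ge a (i + n + 2) with h1' | h1'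
      · left; rw [show a = i + n + 1 by omega]; exact hR1
      · right; rw [show a = i + n + 2 by omega]; exact hR2
  have hbR : u b ∈ vertsOf Q ∨ (u b = t + ![1, 1] ∨ u b = t + ![0, 1] ∨ u b = t + ![-1, 1]) := by
    rcases Nat.lt_or_ge b (i + 2 * n + 1 + 1) with hlt | hge
    · left
      have := hQ_arc (b - (i + n + 3)) (by omega)
      rw [show i + n + 3 + (b - (i + n + 3)) = b by omega] at this
      rw [this]; exact hW'v _
    · right
      rcases Nat.lt_or_ge b (i + 2 * n + 1 + 2) with h1' | h1'
      · left; rw [show b = i + 2 * n + 2 by omega]; exact hL1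
      rcases Nat.lt_or_ge b (i + 2 * n + 1 + 3) with h2' | h2'
      · right; left; rw [show b = i + 2 * n + 3 by omega]; exact hL2
      · right; right; rw [show b = i + 2 * n + 4 by omega]; exact hL3
  rcases haL with haP | hj <;> rcases hbR with hbQ | hj'
  · exact lt_of_lt_of_le (by omega) (hK1 _ haP _ hbQ (Or.inl hrow))
  · -- a `P`-site against an upper-connector site (row `t₁ + 1`): corridor against `w′ ∈ Q`; `t+(0,1)`, `t+(−1,1)` are off `P`
    rcases hj' with hbE | hbE | hbE <;> rw [hbE] at hrow ⊢
    · have := hK1 _ haP _ wQ (by simp at hrow ⊢; omega); simp at this ⊢; omega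
    · have := hK1 _ haP _ wQ (by simp at hrow ⊢; omega)
      simp at this hrow ⊢
      rcases lt_or_eq_of_le (show u a 0 ≤ t 0 by omega) with hlt | heq
      · omega
      · exact absurd haP (by rw [eq_off₃ (t := t) (x := u a) (a := 0) (b := 1) (by omega) (by omega)]; exact h.f01.1)
    · have := hK1 _ haP _ wQ (by simp at hrow ⊢; omega)
      simp at this hrow ⊢
      rcases lt_or_eq_of_le (show u a 0 ≤ t 0 by omega) with hlt | heq
      · rcases lt_or_eq_of_le (show u a 0 ≤ t 0 - 1 by omega) with hlt' | heq'
        · omega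
        · exact absurd haP (by rw [eq_off₃ (t := t) (x := u a) (a := -1) (b := 1) (by omega) (by omega)]; exact hjP)
      · exact absurd haP (by rw [eq_off₃ (t := t) (x := u a) (a := 0) (b := 1) (by omega) (by omega)]; exact h.f01.1)
  · -- a lower-connector site against a `Q`-site (row `t₁`): corridor against `t ∈ P`; `t+(2,0)`, `t+(3,0)` are off `Q`
    rcases hj with haE | haE <;> rw [haE] at hrow ⊢
    · have := hK1 _ tP _ hbQ (by simp at hrow ⊢; omega); simp at this ⊢; omega
    · have := hK1 _ tP _ hbQ (by simp at hrow ⊢; omega)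
      simp at this hrow ⊢
      rcases lt_or_eq_of_le (show t 0 + 2 ≤ u b 0 by omega) with hlt | heq
      · omega
      · exact absurd hbQ (by rw [eq_off₃ (t := t) (x := u b) (a := 2) (b := 0) (by omega) (by omega)]; exact h.f20.2)
  · rcases hj with haE | haE <;> rcases hj' with hbE | hbE | hbE <;> rw [haE, hbE] at hrow ⊢ <;>
      (simp only [Pi.add_apply, uy0, uy1] at hrow ⊢; omega)

/-- **A T3 decomposition, shape FT (`t+(−1,1) ∉ P`, `t+(3,0) ∈ Q`), imposes the BACKWARD horizontal cut `IsHdCutFT' (n + 2) u (i+1)` on every traversal of the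
joined polygon with `u i = t + (-1,0)`, `u (i+1) = t + (-1,1)`.** [cite: Hammond2015SAPJoining, §4.2 pp. 20–24 (arXiv v5: recognising the junction plaquette); Madras1995LatticeAnimalsExponent, §2] -/
theorem isHdCutFT'_of_isT3 (hjP : t + ![-1, 1] ∉ vertsOf P) (hjQ : t + ![3, 0] ∈ vertsOf Q) (hu : IsPolyTraversal brickWallGraph (hdJoin t P Q) (2 * n + 4) u) {i : ℕ}
    (h0 : u i = t + ![-1, 0]) (h1 : u (i + 1) = t + ![-1, 1]) : IsHdCutFT' (n + 2) u (i + 1) := by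
  classical
  have hdisj := disjoint_of_corridor (P := P) (Q := Q) hK1
  obtain ⟨hJ, -⟩ := h.isPolygon_join hP hQ hdisj
  set J := hdJoin t P Q with hJdef
  have hpar := h.hpar
  have tP : t + ![0, 0] ∈ vertsOf P := tP₃ h
  have wQ : t + ![2, 1] ∈ vertsOf Q := wQ₃ h
  have cJ1 : s(t + ![0, 0], t + ![1, 0]) ∈ J := cJ1₃ h
  have cJ2 : s(t + ![1, 0], t + ![2, 0]) ∈ J := cJ2₃ h
  have cJ3 : s(t + ![2, 0], t + ![3, 0]) ∈ J := cJ3₃ h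
  have cJ4 : s(t + ![-1, 1], t + ![0, 1]) ∈ J := cJ4₃ h
  have cJ5 : s(t + ![0, 1], t + ![1, 1]) ∈ J := cJ5₃ h
  have cJ6 : s(t + ![1, 1], t + ![2, 1]) ∈ J := cJ6₃ h
  have cJb : s(t + ![-1, 0], t + ![-1, 1]) ∈ J := cJb₃ h hjP
  -- open `P` at `t – b`: the `P`-arc `W : t ⇝ b`
  obtain ⟨W, hW, hWe, -, hWl, hWs⟩ := hP.exists_isPath_erase h.hl
  have hWJ : ∀ e ∈ W.edges, e ∈ J := fun e he => by
    have hm : e ∈ P.erase s(t + ![0, 0], t + ![-1, 0]) := by rw [← hWe]; exact List.mem_toFinset.2 he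
    exact memJ_of_memP₃ hK1 h (Finset.mem_erase.1 hm).2 (Finset.mem_erase.1 hm).1 (fun hv => absurd hv hjP)
  have hWlen : W.length = n - 1 := by omega
  have hWv : ∀ k, W.getVert k ∈ vertsOf P := fun k => mem_vertsOf.2 ((hWs _).1 (W.getVert_mem_support k))
  -- open `Q` along `t+(3,0) – c – w′`: the `Q`-arc `W'`
  have hqE : ∀ e ∈ (wQb₃ t hpar).edges, e ∈ Q := fun e he => by
    simp only [wQb₃, Walk.edges_cons, Walk.edges_nil, List.mem_cons, List.not_mem_nil, or_false] at he
    rcases he with rfl | rfl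
    · rw [Sym2.eq_swap]; exact h.hr
    · rw [Sym2.eq_swap]; exact forcedQ₃ hQ h hjQ
  obtain ⟨W', hW', hW'e, hW'l, hW's⟩ := hQ.exists_isPath_sdiff (wQb₃ t hpar) (by rw [Walk.isPath_def]; simp [wQb₃]) hqE
    (by simp [wQb₃]) (by simp [wQb₃]; omega)
  have hql : (wQb₃ t hpar).length = 2 := by simp [wQb₃]
  have hW'J : ∀ e ∈ W'.edges, e ∈ J := fun e he => by
    have hm : e ∈ Q \ (wQb₃ t hpar).edges.toFinset := by rw [← hW'e]; exact List.mem_toFinset.2 he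
    rw [Finset.mem_sdiff] at hm
    have hne : ¬ (e = s(t + ![2, 1], t + ![3, 1]) ∨ e = s(t + ![3, 1], t + ![3, 0])) := by
      intro hh; apply hm.2
      simp only [wQb₃, Walk.edges_cons, Walk.edges_nil, List.toFinset_cons, List.toFinset_nil, Finset.mem_insert,
        Finset.notMem_empty, or_false]
      exact hh
    exact memJ_of_memQ₃ hK1 h hm.1 (fun he' => hne (Or.inl (by rw [Sym2.eq_swap]; exact he')))
      (fun _ he' => hne (Or.inr (by rw [Sym2.eq_swap]; exact he')))
  have hW'len : W'.length = n - 2 := by rw [hql] at hW'l; omega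
  have hW'v : ∀ k, W'.getVert k ∈ vertsOf Q := fun k => mem_vertsOf.2 ((hW's _).1 (W'.getVert_mem_support k)).1
  have hWedge : ∀ k, k < W.length → s(W.getVert k, W.getVert (k + 1)) ∈ J := fun k hk => hWJ _ (getVert_edge₃ W hk)
  have hW'edge : ∀ k, k < W'.length → s(W'.getVert k, W'.getVert (k + 1)) ∈ J := fun k hk => hW'J _ (getVert_edge₃ W' hk)
  -- STEP 1: the upper connector `t+(−1,1) → t+(0,1) → t+(1,1) → w′`
  have hL1 : u (i + 2) = t + ![0, 1] := by
    have := next_eq₃ (i := i) hu hJ (x := t + ![-1, 0]) (y := t + ![0, 1]) (by rw [h1, Sym2.eq_swap]; exact cJb)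
      (by rw [h1]; exact cJ4) (off_ne₃ (by decide)) h0
    exact this
  have hL2 : u (i + 3) = t + ![1, 1] := by
    have := next_eq₃ (i := i + 1) hu hJ (x := t + ![-1, 1]) (y := t + ![1, 1]) (by rw [show i + 1 + 1 = i + 2 by omega, hL1, Sym2.eq_swap]; exact cJ4)
      (by rw [show i + 1 + 1 = i + 2 by omega, hL1]; exact cJ5) (off_ne₃ (by decide)) h1
    rwa [show i + 1 + 2 = i + 3 by omega] at this
  have hL3 : u (i + 4) = t + ![2, 1] := by
    have := next_eq₃ (i := i + 2) hu hJ (x := t + ![0, 1]) (y := t + ![2, 1]) (by rw [show i + 2 + 1 = i + 3 by omega, hL2, Sym2.eq_swap]; exact cJ5)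
      (by rw [show i + 2 + 1 = i + 3 by omega, hL2]; exact cJ6) (off_ne₃ (by decide)) hL1
    rwa [show i + 2 + 2 = i + 4 by omega] at this
  -- STEP 2: the `Q`-arc backwards, `u (i+4+k) = W'_k`
  have hQ1 : u (i + 5) = W'.getVert 1 := by
    have := next_eq₃ (i := i + 3) hu hJ (x := t + ![1, 1]) (y := W'.getVert 1) (by rw [show i + 3 + 1 = i + 4 by omega, hL3, Sym2.eq_swap]; exact cJ6) ?_ ?_ hL2
    · rwa [show i + 3 + 2 = i + 5 by omega] at this
    · rw [show i + 3 + 1 = i + 4 by omega, hL3]; have := hW'edge 0 (by omega); rwa [Walk.getVert_zero] at this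
    · exact (fun he => h.f11.2 (he ▸ hW'v 1))
  have hQ_arc : ∀ k, k ≤ n - 2 → u (i + 4 + k) = W'.getVert k := fun k hk =>
    hu.follows_path hJ W' hW' hW'J (i := i + 4) hL3 (fun _ => by rw [show i + 4 + 1 = i + 5 by omega]; exact hQ1) k (by omega)
  have huR0 : u (i + n + 2) = t + ![3, 0] := by
    have := hQ_arc (n - 2) le_rfl
    rw [show i + 4 + (n - 2) = i + n + 2 by omega, ← hW'len, Walk.getVert_length] at this; exact this
  have huR01 : u (i + n + 1) = W'.getVert (n - 3) := by
    have := hQ_arc (n - 3) (by omega); rwa [show i + 4 + (n - 3) = i + n + 1 by omega] at this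
  have hW'last : s(t + ![3, 0], W'.getVert (n - 3)) ∈ J := by
    have := hW'edge (n - 3) (by omega)
    rw [show n - 3 + 1 = n - 2 by omega, ← hW'len, Walk.getVert_length, Sym2.eq_swap] at this
    exact this
  -- STEP 3: the lower connector backwards
  have hR1 : u (i + n + 3) = t + ![2, 0] := by
    have := next_eq₃ (i := i + n + 1) hu hJ (x := W'.getVert (n - 3)) (y := t + ![2, 0]) (by rw [show i + n + 1 + 1 = i + n + 2 by omega, huR0]; exact hW'last)
      (by rw [show i + n + 1 + 1 = i + n + 2 by omega, huR0, Sym2.eq_swap]; exact cJ3) (fun he => h.f20.2 (he ▸ hW'v (n - 3))) huR01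
    rwa [show i + n + 1 + 2 = i + n + 3 by omega] at this
  have hR2 : u (i + n + 4) = t + ![1, 0] := by
    have := next_eq₃ (i := i + n + 2) hu hJ (x := t + ![3, 0]) (y := t + ![1, 0]) (by rw [show i + n + 2 + 1 = i + n + 3 by omega, hR1]; exact cJ3)
      (by rw [show i + n + 2 + 1 = i + n + 3 by omega, hR1, Sym2.eq_swap]; exact cJ2) (off_ne₃ (by decide)) huR0
    rwa [show i + n + 2 + 2 = i + n + 4 by omega] at this
  have hR3 : u (i + n + 5) = t + ![0, 0] := by
    have := next_eq₃ (i := i + n + 3) hu hJ (x := t + ![2, 0]) (y := t + ![0, 0]) (by rw [show i + n + 3 + 1 = i + n + 4 by omega, hR2]; exact cJ2)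
      (by rw [show i + n + 3 + 1 = i + n + 4 by omega, hR2, Sym2.eq_swap]; exact cJ1) (off_ne₃ (by decide)) hR1
    rwa [show i + n + 3 + 2 = i + n + 5 by omega] at this
  -- STEP 4: the `P`-arc backwards
  have hP1 : u (i + n + 5 + 1) = W.getVert 1 := by
    have := next_eq₃ (i := i + n + 4) hu hJ (x := t + ![1, 0]) (y := W.getVert 1) (by rw [show i + n + 4 + 1 = i + n + 5 by omega, hR3]; exact cJ1) ?_ ?_ hR2
    · rwa [show i + n + 4 + 2 = i + n + 5 + 1 by omega] at this
    · rw [show i + n + 4 + 1 = i + n + 5 by omega, hR3]; have := hWedge 0 (by omega); rwa [Walk.getVert_zero] at this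
    · exact (fun he => h.f10.1 (he ▸ hWv 1))
  have hP_arc : ∀ k, k ≤ n - 1 → u (i + n + 5 + k) = W.getVert k := fun k hk =>
    hu.follows_path hJ W hW hWJ (i := i + n + 5) hR3 (fun _ => hP1) k (by omega)
  have huend : u (i + (2 * n + 4)) = t + ![-1, 0] := by
    have := hP_arc (n - 1) le_rfl
    rw [show i + n + 5 + (n - 1) = i + (2 * n + 4) by omega, ← hWlen, Walk.getVert_length] at this; exact this
  -- the backward cut
  refine isHdCutFT'_of_eqs t h1
    (by rw [show i + 1 + 1 = i + 2 by omega, hL1])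
    (by rw [show i + 1 + 2 = i + 3 by omega, hL2])
    (by rw [show i + 1 + 3 = i + 4 by omega, hL3])
    (by rw [show i + 1 + (n + 2) - 1 = i + n + 2 by omega, huR0])
    (by rw [show i + 1 + (n + 2) = i + n + 3 by omega, hR1])
    (by rw [show i + 1 + (n + 2) + 1 = i + n + 4 by omega, hR2])
    (by rw [show i + 1 + (n + 2) + 2 = i + n + 5 by omega, hR3])
    (by rw [show i + 1 + 2 * (n + 2) - 1 = i + (2 * n + 4) by omega, huend])
    ?_
  -- row separation: the first block (upper connector, `Q`-arc) lies right of the second (lower connector, `P`-arc)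
  intro a b ha1 ha2 hb1 hb2 hrow
  have haR : u a ∈ vertsOf Q ∨ (u a = t + ![-1, 1] ∨ u a = t + ![0, 1] ∨ u a = t + ![1, 1]) := by
    rcases Nat.lt_or_ge a (i + 4) with hlt | hge
    · right
      rcases Nat.lt_or_ge a (i + 2) with h1' | h1'
      · left; rw [show a = i + 1 by omega]; exact h1
      rcases Nat.lt_or_ge a (i + 3) with h2' | h2'
      · right; left; rw [show a = i + 2 by omega]; exact hL1
      · right; right; rw [show a = i + 3 by omega]; exact hL2
    · left
      have := hQ_arc (a - (i + 4)) (by omega)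
      rw [show i + 4 + (a - (i + 4)) = a by omega] at this
      rw [this]; exact hW'v _
  have hbL : u b ∈ vertsOf P ∨ (u b = t + ![2, 0] ∨ u b = t + ![1, 0]) := by
    rcases Nat.lt_or_ge b (i + n + 5) with hlt | hge
    · right
      rcases Nat.lt_or_ge b (i + n + 4) with h1' | h1'
      · left; rw [show b = i + n + 3 by omega]; exact hR1
      · right; rw [show b = i + n + 4 by omega]; exact hR2
    · left
      have := hP_arc (b - (i + n + 5)) (by omega)
      rw [show i + n + 5 + (b - (i + n + 5)) = b by omega] at this
      rw [this]; exact hWv _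
  rcases haR with haQ | hj <;> rcases hbL with hbP | hj'
  · exact lt_of_lt_of_le (by omega) (hK1 _ hbP _ haQ (Or.inl hrow.symm))
  · -- a `Q`-site against a lower-connector site (row `t₁`): corridor against `t ∈ P`
    rcases hj' with hbE | hbE <;> rw [hbE] at hrow ⊢
    · have := hK1 _ tP _ haQ (by simp at hrow ⊢; omega)
      simp at this hrow ⊢
      rcases lt_or_eq_of_le (show t 0 + 2 ≤ u a 0 by omega) with hlt | heq
      · omega
      · exact absurd haQ (by rw [eq_off₃ (t := t) (x := u a) (a := 2) (b := 0) (by omega) (by omega)]; exact h.f20.2)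
    · have := hK1 _ tP _ haQ (by simp at hrow ⊢; omega); simp at this ⊢; omega
  · -- an upper-connector site against a `P`-site (row `t₁ + 1`): corridor against `w′ ∈ Q`
    rcases hj with haE | haE | haE <;> rw [haE] at hrow ⊢
    · have := hK1 _ hbP _ wQ (by simp at hrow ⊢; omega)
      simp at this hrow ⊢
      rcases lt_or_eq_of_le (show u b 0 ≤ t 0 by omega) with hlt | heq
      · rcases lt_or_eq_of_le (show u b 0 ≤ t 0 - 1 by omega) with hlt' | heq'
        · omega
        · exact absurd hbP (by rw [eq_off₃ (t := t) (x := u b) (a := -1) (b := 1) (by omega) (by omega)]; exact hjP)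
      · exact absurd hbP (by rw [eq_off₃ (t := t) (x := u b) (a := 0) (b := 1) (by omega) (by omega)]; exact h.f01.1)
    · have := hK1 _ hbP _ wQ (by simp at hrow ⊢; omega)
      simp at this hrow ⊢
      rcases lt_or_eq_of_le (show u b 0 ≤ t 0 by omega) with hlt | heq
      · omega
      · exact absurd hbP (by rw [eq_off₃ (t := t) (x := u b) (a := 0) (b := 1) (by omega) (by omega)]; exact h.f01.1)
    · have := hK1 _ hbP _ wQ (by simp at hrow ⊢; omega); simp at this ⊢; omega
  · rcases hj with haE | haE | haE <;> rcases hj' with hbE | hbE <;> rw [haE, hbE] at hrow ⊢ <;>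
      (simp only [Pi.add_apply, uy0, uy1] at hrow ⊢; omega)

/-- **A T3 decomposition, shape TT (`t+(−1,1) ∈ P`, `t+(3,0) ∈ Q`), imposes the forward horizontal cut `IsHdCutTT (n + 1) u (i+1)` on every traversal of the
joined polygon with `u i = t + (0,1)`, `u (i+1) = t + (-1,1)`.** [cite: Hammond2015SAPJoining, §4.2 pp. 20–24 (arXiv v5: recognising the junction plaquette); Madras1995LatticeAnimalsExponent, §2] -/
theorem isHdCutTT_of_isT3 (hjP : t + ![-1, 1] ∈ vertsOf P) (hjQ : t + ![3, 0] ∈ vertsOf Q) (hu : IsPolyTraversal brickWallGraph (hdJoin t P Q) (2 * n + 2) u) {i : ℕ}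
    (h0 : u i = t + ![0, 1]) (h1 : u (i + 1) = t + ![-1, 1]) : IsHdCutTT (n + 1) u (i + 1) := by
  classical
  have hdisj := disjoint_of_corridor (P := P) (Q := Q) hK1
  obtain ⟨hJ, -⟩ := h.isPolygon_join hP hQ hdisj
  set J := hdJoin t P Q with hJdef
  have hpar := h.hpar
  have tP : t + ![0, 0] ∈ vertsOf P := tP₃ h
  have wQ : t + ![2, 1] ∈ vertsOf Q := wQ₃ h
  have cJ1 : s(t + ![0, 0], t + ![1, 0]) ∈ J := cJ1₃ h
  have cJ2 : s(t + ![1, 0], t + ![2, 0]) ∈ J := cJ2₃ h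
  have cJ3 : s(t + ![2, 0], t + ![3, 0]) ∈ J := cJ3₃ h
  have cJ4 : s(t + ![-1, 1], t + ![0, 1]) ∈ J := cJ4₃ h
  have cJ5 : s(t + ![0, 1], t + ![1, 1]) ∈ J := cJ5₃ h
  have cJ6 : s(t + ![1, 1], t + ![2, 1]) ∈ J := cJ6₃ h
  -- open `P` along `t+(−1,1) – b – t`: the `P`-arc `W`
  have hpE : ∀ e ∈ (wPf₃ t hpar).edges, e ∈ P := fun e he => by
    simp only [wPf₃, Walk.edges_cons, Walk.edges_nil, List.mem_cons, List.not_mem_nil, or_false] at he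
    rcases he with rfl | rfl
    · exact forcedP₃ hP h hjP
    · rw [Sym2.eq_swap]; exact h.hl
  obtain ⟨W, hW, hWe, hWl, hWs⟩ := hP.exists_isPath_sdiff (wPf₃ t hpar) (by rw [Walk.isPath_def]; simp [wPf₃]) hpE
    (by simp [wPf₃]) (by simp [wPf₃]; omega)
  have hpl : (wPf₃ t hpar).length = 2 := by simp [wPf₃]
  have hWJ : ∀ e ∈ W.edges, e ∈ J := fun e he => by
    have hm : e ∈ P \ (wPf₃ t hpar).edges.toFinset := by rw [← hWe]; exact List.mem_toFinset.2 he
    rw [Finset.mem_sdiff] at hm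
    have hne : ¬ (e = s(t + ![-1, 1], t + ![-1, 0]) ∨ e = s(t + ![-1, 0], t + ![0, 0])) := by
      intro hh; apply hm.2
      simp only [wPf₃, Walk.edges_cons, Walk.edges_nil, List.toFinset_cons, List.toFinset_nil, Finset.mem_insert,
        Finset.notMem_empty, or_false]
      exact hh
    exact memJ_of_memP₃ hK1 h hm.1 (fun he' => hne (Or.inr (by rw [Sym2.eq_swap]; exact he')))
      (fun _ he' => hne (Or.inl (by rw [Sym2.eq_swap]; exact he')))
  have hWlen : W.length = n - 2 := by rw [hpl] at hWl; omega
  have hWv : ∀ k, W.getVert k ∈ vertsOf P := fun k => mem_vertsOf.2 ((hWs _).1 (W.getVert_mem_support k)).1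
  -- open `Q` along `t+(3,0) – c – w′`: the `Q`-arc `W'`
  have hqE : ∀ e ∈ (wQf₃ t hpar).edges, e ∈ Q := fun e he => by
    simp only [wQf₃, Walk.edges_cons, Walk.edges_nil, List.mem_cons, List.not_mem_nil, or_false] at he
    rcases he with rfl | rfl
    · exact forcedQ₃ hQ h hjQ
    · exact h.hr
  obtain ⟨W', hW', hW'e, hW'l, hW's⟩ := hQ.exists_isPath_sdiff (wQf₃ t hpar) (by rw [Walk.isPath_def]; simp [wQf₃]) hqE
    (by simp [wQf₃]) (by simp [wQf₃]; omega)
  have hql : (wQf₃ t hpar).length = 2 := by simp [wQf₃]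
  have hW'J : ∀ e ∈ W'.edges, e ∈ J := fun e he => by
    have hm : e ∈ Q \ (wQf₃ t hpar).edges.toFinset := by rw [← hW'e]; exact List.mem_toFinset.2 he
    rw [Finset.mem_sdiff] at hm
    have hne : ¬ (e = s(t + ![3, 0], t + ![3, 1]) ∨ e = s(t + ![3, 1], t + ![2, 1])) := by
      intro hh; apply hm.2
      simp only [wQf₃, Walk.edges_cons, Walk.edges_nil, List.toFinset_cons, List.toFinset_nil, Finset.mem_insert,
        Finset.notMem_empty, or_false]
      exact hh
    exact memJ_of_memQ₃ hK1 h hm.1 (fun he' => hne (Or.inr he')) (fun _ he' => hne (Or.inl he'))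
  have hW'len : W'.length = n - 2 := by rw [hql] at hW'l; omega
  have hW'v : ∀ k, W'.getVert k ∈ vertsOf Q := fun k => mem_vertsOf.2 ((hW's _).1 (W'.getVert_mem_support k)).1
  have hWedge : ∀ k, k < W.length → s(W.getVert k, W.getVert (k + 1)) ∈ J := fun k hk => hWJ _ (getVert_edge₃ W hk)
  have hW'edge : ∀ k, k < W'.length → s(W'.getVert k, W'.getVert (k + 1)) ∈ J := fun k hk => hW'J _ (getVert_edge₃ W' hk)
  -- STEP 1: the `P`-arc, `u (i+1+k) = W_k`
  have hu2 : u (i + 2) = W.getVert 1 := by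
    have := next_eq₃ (i := i) hu hJ (x := t + ![0, 1]) (y := W.getVert 1) (by rw [h1]; exact cJ4) ?_ ?_ h0
    · exact this
    · rw [h1]; have := hWedge 0 (by omega); rwa [Walk.getVert_zero] at this
    · exact (fun he => h.f01.1 (he ▸ hWv 1))
  have hP_arc : ∀ k, k ≤ n - 2 → u (i + 1 + k) = W.getVert k := fun k hk =>
    hu.follows_path hJ W hW hWJ (i := i + 1) h1 (fun _ => by rw [show i + 1 + 1 = i + 2 by omega]; exact hu2) k (by omega)
  have hut : u (i + n - 1) = t + ![0, 0] := by
    have := hP_arc (n - 2) le_rfl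
    rw [show i + 1 + (n - 2) = i + n - 1 by omega, ← hWlen, Walk.getVert_length] at this; exact this
  have hut1 : u (i + n - 2) = W.getVert (n - 3) := by
    have := hP_arc (n - 3) (by omega); rwa [show i + 1 + (n - 3) = i + n - 2 by omega] at this
  have hWlast : s(t + ![0, 0], W.getVert (n - 3)) ∈ J := by
    have := hWedge (n - 3) (by omega)
    rw [show n - 3 + 1 = n - 2 by omega, ← hWlen, Walk.getVert_length, Sym2.eq_swap] at this
    exact this
  -- STEP 2: the lower connector
  have hR1 : u (i + n) = t + ![1, 0] := by
    have := next_eq₃ (i := i + n - 2) hu hJ (x := W.getVert (n - 3)) (y := t + ![1, 0]) (by rw [show i + n - 2 + 1 = i + n - 1 by omega, hut]; exact hWlast)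
      (by rw [show i + n - 2 + 1 = i + n - 1 by omega, hut]; exact cJ1) (fun he => h.f10.1 (he ▸ hWv (n - 3))) hut1
    rwa [show i + n - 2 + 2 = i + n by omega] at this
  have hR2 : u (i + n + 1) = t + ![2, 0] := by
    have := next_eq₃ (i := i + n - 1) hu hJ (x := t + ![0, 0]) (y := t + ![2, 0]) (by rw [show i + n - 1 + 1 = i + n by omega, hR1, Sym2.eq_swap]; exact cJ1)
      (by rw [show i + n - 1 + 1 = i + n by omega, hR1]; exact cJ2) (off_ne₃ (by decide)) hut
    rwa [show i + n - 1 + 2 = i + n + 1 by omega] at this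
  have hR3 : u (i + n + 2) = t + ![3, 0] := by
    have := next_eq₃ (i := i + n) hu hJ (x := t + ![1, 0]) (y := t + ![3, 0]) (by rw [hR2, Sym2.eq_swap]; exact cJ2)
      (by rw [hR2]; exact cJ3) (off_ne₃ (by decide)) hR1
    exact this
  -- STEP 3: the `Q`-arc
  have hQ1 : u (i + n + 2 + 1) = W'.getVert 1 := by
    have := next_eq₃ (i := i + n + 1) hu hJ (x := t + ![2, 0]) (y := W'.getVert 1) (by rw [show i + n + 1 + 1 = i + n + 2 by omega, hR3, Sym2.eq_swap]; exact cJ3) ?_ ?_ hR2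
    · rwa [show i + n + 1 + 2 = i + n + 2 + 1 by omega] at this
    · rw [show i + n + 1 + 1 = i + n + 2 by omega, hR3]; have := hW'edge 0 (by omega); rwa [Walk.getVert_zero] at this
    · exact (fun he => h.f20.2 (he ▸ hW'v 1))
  have hQ_arc : ∀ k, k ≤ n - 2 → u (i + n + 2 + k) = W'.getVert k := fun k hk =>
    hu.follows_path hJ W' hW' hW'J (i := i + n + 2) hR3 (fun _ => hQ1) k (by omega)
  have huw : u (i + 2 * n) = t + ![2, 1] := by
    have := hQ_arc (n - 2) le_rfl
    rw [show i + n + 2 + (n - 2) = i + 2 * n by omega, ← hW'len, Walk.getVert_length] at this; exact this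
  have huw1 : u (i + 2 * n - 1) = W'.getVert (n - 3) := by
    have := hQ_arc (n - 3) (by omega); rwa [show i + n + 2 + (n - 3) = i + 2 * n - 1 by omega] at this
  have hW'last : s(t + ![2, 1], W'.getVert (n - 3)) ∈ J := by
    have := hW'edge (n - 3) (by omega)
    rw [show n - 3 + 1 = n - 2 by omega, ← hW'len, Walk.getVert_length, Sym2.eq_swap] at this
    exact this
  -- STEP 4: the upper connector
  have hL1 : u (i + 2 * n + 1) = t + ![1, 1] := by
    have := next_eq₃ (i := i + 2 * n - 1) hu hJ (x := W'.getVert (n - 3)) (y := t + ![1, 1]) (by rw [show i + 2 * n - 1 + 1 = i + 2 * n by omega, huw]; exact hW'last)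
      (by rw [show i + 2 * n - 1 + 1 = i + 2 * n by omega, huw, Sym2.eq_swap]; exact cJ6) (fun he => h.f11.2 (he ▸ hW'v (n - 3))) huw1
    rwa [show i + 2 * n - 1 + 2 = i + 2 * n + 1 by omega] at this
  have hL2 : u (i + 2 * n + 2) = t + ![0, 1] := by rw [show i + 2 * n + 2 = i + (2 * n + 2) by omega, hu.periodic, h0]
  -- the cut
  refine isHdCutTT_of_eqs t h1
    (by rw [show i + 1 + (n + 1) - 3 = i + n - 1 by omega, hut])
    (by rw [show i + 1 + (n + 1) - 2 = i + n by omega, hR1])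
    (by rw [show i + 1 + (n + 1) - 1 = i + n + 1 by omega, hR2])
    (by rw [show i + 1 + (n + 1) = i + n + 2 by omega, hR3])
    (by rw [show i + 1 + 2 * (n + 1) - 3 = i + 2 * n by omega, huw])
    (by rw [show i + 1 + 2 * (n + 1) - 2 = i + 2 * n + 1 by omega, hL1])
    (by rw [show i + 1 + 2 * (n + 1) - 1 = i + 2 * n + 2 by omega, hL2])
    ?_
  -- row separation: the left block (`P`-arc and lower connector) lies left of the right block (`Q`-arc and upper connector)
  intro a b ha1 ha2 hb1 hb2 hrow
  have haL : u a ∈ vertsOf P ∨ (u a = t + ![1, 0] ∨ u a = t + ![2, 0]) := by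
    rcases Nat.lt_or_ge a (i + n - 1 + 1) with hlt | hge
    · left
      have := hP_arc (a - (i + 1)) (by omega)
      rw [show i + 1 + (a - (i + 1)) = a by omega] at this
      rw [this]; exact hWv _
    · right
      rcases Nat.lt_or_ge a (i + n - 1 + 2) with h1' | h1'
      · left; rw [show a = i + n by omega]; exact hR1
      · right; rw [show a = i + n + 1 by omega]; exact hR2
  have hbR : u b ∈ vertsOf Q ∨ (u b = t + ![1, 1] ∨ u b = t + ![0, 1]) := by
    rcases Nat.lt_or_ge b (i + 2 * n + 1) with hlt | hge
    · left
      have := hQ_arc (b - (i + n + 2)) (by omega)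
      rw [show i + n + 2 + (b - (i + n + 2)) = b by omega] at this
      rw [this]; exact hW'v _
    · right
      rcases Nat.lt_or_ge b (i + 2 * n + 2) with h1' | h1'
      · left; rw [show b = i + 2 * n + 1 by omega]; exact hL1
      · right; rw [show b = i + 2 * n + 2 by omega]; exact hL2
  rcases haL with haP | hj <;> rcases hbR with hbQ | hj'
  · exact lt_of_lt_of_le (by omega) (hK1 _ haP _ hbQ (Or.inl hrow))
  · -- a `P`-site against an upper-connector site (row `t₁ + 1`): corridor against `w′ ∈ Q`; `t+(0,1)`, `t+(−1,1)` are off `P`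
    rcases hj' with hbE | hbE <;> rw [hbE] at hrow ⊢
    · have := hK1 _ haP _ wQ (by simp at hrow ⊢; omega); simp at this ⊢; omega
    · have := hK1 _ haP _ wQ (by simp at hrow ⊢; omega)
      simp at this hrow ⊢
      rcases lt_or_eq_of_le (show u a 0 ≤ t 0 by omega) with hlt | heq
      · omega
      · exact absurd haP (by rw [eq_off₃ (t := t) (x := u a) (a := 0) (b := 1) (by omega) (by omega)]; exact h.f01.1)
  · -- a lower-connector site against a `Q`-site (row `t₁`): corridor against `t ∈ P`; `t+(2,0)`, `t+(3,0)` are off `Q`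
    rcases hj with haE | haE <;> rw [haE] at hrow ⊢
    · have := hK1 _ tP _ hbQ (by simp at hrow ⊢; omega); simp at this ⊢; omega
    · have := hK1 _ tP _ hbQ (by simp at hrow ⊢; omega)
      simp at this hrow ⊢
      rcases lt_or_eq_of_le (show t 0 + 2 ≤ u b 0 by omega) with hlt | heq
      · omega
      · exact absurd hbQ (by rw [eq_off₃ (t := t) (x := u b) (a := 2) (b := 0) (by omega) (by omega)]; exact h.f20.2)
  · rcases hj with haE | haE <;> rcases hj' with hbE | hbE <;> rw [haE, hbE] at hrow ⊢ <;>
      (simp only [Pi.add_apply, uy0, uy1] at hrow ⊢; omega)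

/-- **A T3 decomposition, shape TT (`t+(−1,1) ∈ P`, `t+(3,0) ∈ Q`), imposes the BACKWARD horizontal cut `IsHdCutTT' (n + 1) u (i+1)` on every traversal of the
joined polygon with `u i = t + (-1,1)`, `u (i+1) = t + (0,1)`.** [cite: Hammond2015SAPJoining, §4.2 pp. 20–24 (arXiv v5: recognising the junction plaquette); Madras1995LatticeAnimalsExponent, §2] -/
theorem isHdCutTT'_of_isT3 (hjP : t + ![-1, 1] ∈ vertsOf P) (hjQ : t + ![3, 0] ∈ vertsOf Q) (hu : IsPolyTraversal brickWallGraph (hdJoin t P Q) (2 * n + 2) u) {i : ℕ}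
    (h0 : u i = t + ![-1, 1]) (h1 : u (i + 1) = t + ![0, 1]) : IsHdCutTT' (n + 1) u (i + 1) := by
  classical
  have hdisj := disjoint_of_corridor (P := P) (Q := Q) hK1
  obtain ⟨hJ, -⟩ := h.isPolygon_join hP hQ hdisj
  set J := hdJoin t P Q with hJdef
  have hpar := h.hpar
  have tP : t + ![0, 0] ∈ vertsOf P := tP₃ h
  have wQ : t + ![2, 1] ∈ vertsOf Q := wQ₃ h
  have cJ1 : s(t + ![0, 0], t + ![1, 0]) ∈ J := cJ1₃ h
  have cJ2 : s(t + ![1, 0], t + ![2, 0]) ∈ J := cJ2₃ h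
  have cJ3 : s(t + ![2, 0], t + ![3, 0]) ∈ J := cJ3₃ h
  have cJ4 : s(t + ![-1, 1], t + ![0, 1]) ∈ J := cJ4₃ h
  have cJ5 : s(t + ![0, 1], t + ![1, 1]) ∈ J := cJ5₃ h
  have cJ6 : s(t + ![1, 1], t + ![2, 1]) ∈ J := cJ6₃ h
  -- open `P` along `t+(−1,1) – b – t`: the `P`-arc `W`
  have hpE : ∀ e ∈ (wPb₃ t hpar).edges, e ∈ P := fun e he => by
    simp only [wPb₃, Walk.edges_cons, Walk.edges_nil, List.mem_cons, List.not_mem_nil, or_false] at he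
    rcases he with rfl | rfl
    · exact h.hl
    · rw [Sym2.eq_swap]; exact forcedP₃ hP h hjP
  obtain ⟨W, hW, hWe, hWl, hWs⟩ := hP.exists_isPath_sdiff (wPb₃ t hpar) (by rw [Walk.isPath_def]; simp [wPb₃]) hpE
    (by simp [wPb₃]) (by simp [wPb₃]; omega)
  have hpl : (wPb₃ t hpar).length = 2 := by simp [wPb₃]
  have hWJ : ∀ e ∈ W.edges, e ∈ J := fun e he => by
    have hm : e ∈ P \ (wPb₃ t hpar).edges.toFinset := by rw [← hWe]; exact List.mem_toFinset.2 he
    rw [Finset.mem_sdiff] at hm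
    have hne : ¬ (e = s(t + ![0, 0], t + ![-1, 0]) ∨ e = s(t + ![-1, 0], t + ![-1, 1])) := by
      intro hh; apply hm.2
      simp only [wPb₃, Walk.edges_cons, Walk.edges_nil, List.toFinset_cons, List.toFinset_nil, Finset.mem_insert,
        Finset.notMem_empty, or_false]
      exact hh
    exact memJ_of_memP₃ hK1 h hm.1 (fun he' => hne (Or.inl he')) (fun _ he' => hne (Or.inr he'))
  have hWlen : W.length = n - 2 := by rw [hpl] at hWl; omega
  have hWv : ∀ k, W.getVert k ∈ vertsOf P := fun k => mem_vertsOf.2 ((hWs _).1 (W.getVert_mem_support k)).1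
  -- open `Q` along `t+(3,0) – c – w′`: the `Q`-arc `W'`
  have hqE : ∀ e ∈ (wQb₃ t hpar).edges, e ∈ Q := fun e he => by
    simp only [wQb₃, Walk.edges_cons, Walk.edges_nil, List.mem_cons, List.not_mem_nil, or_false] at he
    rcases he with rfl | rfl
    · rw [Sym2.eq_swap]; exact h.hr
    · rw [Sym2.eq_swap]; exact forcedQ₃ hQ h hjQ
  obtain ⟨W', hW', hW'e, hW'l, hW's⟩ := hQ.exists_isPath_sdiff (wQb₃ t hpar) (by rw [Walk.isPath_def]; simp [wQb₃]) hqE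
    (by simp [wQb₃]) (by simp [wQb₃]; omega)
  have hql : (wQb₃ t hpar).length = 2 := by simp [wQb₃]
  have hW'J : ∀ e ∈ W'.edges, e ∈ J := fun e he => by
    have hm : e ∈ Q \ (wQb₃ t hpar).edges.toFinset := by rw [← hW'e]; exact List.mem_toFinset.2 he
    rw [Finset.mem_sdiff] at hm
    have hne : ¬ (e = s(t + ![2, 1], t + ![3, 1]) ∨ e = s(t + ![3, 1], t + ![3, 0])) := by
      intro hh; apply hm.2
      simp only [wQb₃, Walk.edges_cons, Walk.edges_nil, List.toFinset_cons, List.toFinset_nil, Finset.mem_insert,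
        Finset.notMem_empty, or_false]
      exact hh
    exact memJ_of_memQ₃ hK1 h hm.1 (fun he' => hne (Or.inl (by rw [Sym2.eq_swap]; exact he')))
      (fun _ he' => hne (Or.inr (by rw [Sym2.eq_swap]; exact he')))
  have hW'len : W'.length = n - 2 := by rw [hql] at hW'l; omega
  have hW'v : ∀ k, W'.getVert k ∈ vertsOf Q := fun k => mem_vertsOf.2 ((hW's _).1 (W'.getVert_mem_support k)).1
  have hWedge : ∀ k, k < W.length → s(W.getVert k, W.getVert (k + 1)) ∈ J := fun k hk => hWJ _ (getVert_edge₃ W hk)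
  have hW'edge : ∀ k, k < W'.length → s(W'.getVert k, W'.getVert (k + 1)) ∈ J := fun k hk => hW'J _ (getVert_edge₃ W' hk)
  -- STEP 1: the upper connector `t+(0,1) → t+(1,1) → w′`
  have hL1 : u (i + 2) = t + ![1, 1] := by
    have := next_eq₃ (i := i) hu hJ (x := t + ![-1, 1]) (y := t + ![1, 1]) (by rw [h1, Sym2.eq_swap]; exact cJ4)
      (by rw [h1]; exact cJ5) (off_ne₃ (by decide)) h0
    exact this
  have hL2 : u (i + 3) = t + ![2, 1] := by
    have := next_eq₃ (i := i + 1) hu hJ (x := t + ![0, 1]) (y := t + ![2, 1]) (by rw [show i + 1 + 1 = i + 2 by omega, hL1, Sym2.eq_swap]; exact cJ5)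
      (by rw [show i + 1 + 1 = i + 2 by omega, hL1]; exact cJ6) (off_ne₃ (by decide)) h1
    rwa [show i + 1 + 2 = i + 3 by omega] at this
  -- STEP 2: the `Q`-arc backwards, `u (i+3+k) = W'_k`
  have hQ1 : u (i + 4) = W'.getVert 1 := by
    have := next_eq₃ (i := i + 2) hu hJ (x := t + ![1, 1]) (y := W'.getVert 1) (by rw [show i + 2 + 1 = i + 3 by omega, hL2, Sym2.eq_swap]; exact cJ6) ?_ ?_ hL1
    · rwa [show i + 2 + 2 = i + 4 by omega] at this
    · rw [show i + 2 + 1 = i + 3 by omega, hL2]; have := hW'edge 0 (by omega); rwa [Walk.getVert_zero] at this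
    · exact (fun he => h.f11.2 (he ▸ hW'v 1))
  have hQ_arc : ∀ k, k ≤ n - 2 → u (i + 3 + k) = W'.getVert k := fun k hk =>
    hu.follows_path hJ W' hW' hW'J (i := i + 3) hL2 (fun _ => by rw [show i + 3 + 1 = i + 4 by omega]; exact hQ1) k (by omega)
  have huR0 : u (i + n + 1) = t + ![3, 0] := by
    have := hQ_arc (n - 2) le_rfl
    rw [show i + 3 + (n - 2) = i + n + 1 by omega, ← hW'len, Walk.getVert_length] at this; exact this
  have huR01 : u (i + n) = W'.getVert (n - 3) := by
    have := hQ_arc (n - 3) (by omega); rwa [show i + 3 + (n - 3) = i + n by omega] at this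
  have hW'last : s(t + ![3, 0], W'.getVert (n - 3)) ∈ J := by
    have := hW'edge (n - 3) (by omega)
    rw [show n - 3 + 1 = n - 2 by omega, ← hW'len, Walk.getVert_length, Sym2.eq_swap] at this
    exact this
  -- STEP 3: the lower connector backwards
  have hR1 : u (i + n + 2) = t + ![2, 0] := by
    have := next_eq₃ (i := i + n) hu hJ (x := W'.getVert (n - 3)) (y := t + ![2, 0]) (by rw [huR0]; exact hW'last)
      (by rw [huR0, Sym2.eq_swap]; exact cJ3) (fun he => h.f20.2 (he ▸ hW'v (n - 3))) huR01
    exact this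
  have hR2 : u (i + n + 3) = t + ![1, 0] := by
    have := next_eq₃ (i := i + n + 1) hu hJ (x := t + ![3, 0]) (y := t + ![1, 0]) (by rw [show i + n + 1 + 1 = i + n + 2 by omega, hR1]; exact cJ3)
      (by rw [show i + n + 1 + 1 = i + n + 2 by omega, hR1, Sym2.eq_swap]; exact cJ2) (off_ne₃ (by decide)) huR0
    rwa [show i + n + 1 + 2 = i + n + 3 by omega] at this
  have hR3 : u (i + n + 4) = t + ![0, 0] := by
    have := next_eq₃ (i := i + n + 2) hu hJ (x := t + ![2, 0]) (y := t + ![0, 0]) (by rw [show i + n + 2 + 1 = i + n + 3 by omega, hR2]; exact cJ2)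
      (by rw [show i + n + 2 + 1 = i + n + 3 by omega, hR2, Sym2.eq_swap]; exact cJ1) (off_ne₃ (by decide)) hR1
    rwa [show i + n + 2 + 2 = i + n + 4 by omega] at this
  -- STEP 4: the `P`-arc backwards
  have hP1 : u (i + n + 4 + 1) = W.getVert 1 := by
    have := next_eq₃ (i := i + n + 3) hu hJ (x := t + ![1, 0]) (y := W.getVert 1) (by rw [show i + n + 3 + 1 = i + n + 4 by omega, hR3]; exact cJ1) ?_ ?_ hR2
    · rwa [show i + n + 3 + 2 = i + n + 4 + 1 by omega] at this
    · rw [show i + n + 3 + 1 = i + n + 4 by omega, hR3]; have := hWedge 0 (by omega); rwa [Walk.getVert_zero] at this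
    · exact (fun he => h.f10.1 (he ▸ hWv 1))
  have hP_arc : ∀ k, k ≤ n - 2 → u (i + n + 4 + k) = W.getVert k := fun k hk =>
    hu.follows_path hJ W hW hWJ (i := i + n + 4) hR3 (fun _ => hP1) k (by omega)
  have huend : u (i + (2 * n + 2)) = t + ![-1, 1] := by
    have := hP_arc (n - 2) le_rfl
    rw [show i + n + 4 + (n - 2) = i + (2 * n + 2) by omega, ← hWlen, Walk.getVert_length] at this; exact this
  -- the backward cut
  refine isHdCutTT'_of_eqs t h1
    (by rw [show i + 1 + 1 = i + 2 by omega, hL1])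
    (by rw [show i + 1 + 2 = i + 3 by omega, hL2])
    (by rw [show i + 1 + (n + 1) - 1 = i + n + 1 by omega, huR0])
    (by rw [show i + 1 + (n + 1) = i + n + 2 by omega, hR1])
    (by rw [show i + 1 + (n + 1) + 1 = i + n + 3 by omega, hR2])
    (by rw [show i + 1 + (n + 1) + 2 = i + n + 4 by omega, hR3])
    (by rw [show i + 1 + 2 * (n + 1) - 1 = i + (2 * n + 2) by omega, huend])
    ?_
  -- row separation: the first block (upper connector, `Q`-arc) lies right of the second (lower connector, `P`-arc)
  intro a b ha1 ha2 hb1 hb2 hrow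
  have haR : u a ∈ vertsOf Q ∨ (u a = t + ![0, 1] ∨ u a = t + ![1, 1]) := by
    rcases Nat.lt_or_ge a (i + 3) with hlt | hge
    · right
      rcases Nat.lt_or_ge a (i + 2) with h1' | h1'
      · left; rw [show a = i + 1 by omega]; exact h1
      · right; rw [show a = i + 2 by omega]; exact hL1
    · left
      have := hQ_arc (a - (i + 3)) (by omega)
      rw [show i + 3 + (a - (i + 3)) = a by omega] at this
      rw [this]; exact hW'v _
  have hbL : u b ∈ vertsOf P ∨ (u b = t + ![2, 0] ∨ u b = t + ![1, 0]) := by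
    rcases Nat.lt_or_ge b (i + n + 4) with hlt | hge
    · right
      rcases Nat.lt_or_ge b (i + n + 3) with h1' | h1'
      · left; rw [show b = i + n + 2 by omega]; exact hR1
      · right; rw [show b = i + n + 3 by omega]; exact hR2
    · left
      have := hP_arc (b - (i + n + 4)) (by omega)
      rw [show i + n + 4 + (b - (i + n + 4)) = b by omega] at this
      rw [this]; exact hWv _
  rcases haR with haQ | hj <;> rcases hbL with hbP | hj'
  · exact lt_of_lt_of_le (by omega) (hK1 _ hbP _ haQ (Or.inl hrow.symm))
  · -- a `Q`-site against a lower-connector site (row `t₁`): corridor against `t ∈ P`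
    rcases hj' with hbE | hbE <;> rw [hbE] at hrow ⊢
    · have := hK1 _ tP _ haQ (by simp at hrow ⊢; omega)
      simp at this hrow ⊢
      rcases lt_or_eq_of_le (show t 0 + 2 ≤ u a 0 by omega) with hlt | heq
      · omega
      · exact absurd haQ (by rw [eq_off₃ (t := t) (x := u a) (a := 2) (b := 0) (by omega) (by omega)]; exact h.f20.2)
    · have := hK1 _ tP _ haQ (by simp at hrow ⊢; omega); simp at this ⊢; omega
  · -- an upper-connector site against a `P`-site (row `t₁ + 1`): corridor against `w′ ∈ Q`
    rcases hj with haE | haE <;> rw [haE] at hrow ⊢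
    · have := hK1 _ hbP _ wQ (by simp at hrow ⊢; omega)
      simp at this hrow ⊢
      rcases lt_or_eq_of_le (show u b 0 ≤ t 0 by omega) with hlt | heq
      · omega
      · exact absurd hbP (by rw [eq_off₃ (t := t) (x := u b) (a := 0) (b := 1) (by omega) (by omega)]; exact h.f01.1)
    · have := hK1 _ hbP _ wQ (by simp at hrow ⊢; omega); simp at this ⊢; omega
  · rcases hj with haE | haE <;> rcases hj' with hbE | hbE <;> rw [haE, hbE] at hrow ⊢ <;>
      (simp only [Pi.add_apply, uy0, uy1] at hrow ⊢; omega)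

end Bridge


/-! ### Same polygon, two T3 decompositions -/

/-- periodicity downwards (private plumbing). [cite: Hammond2015SAPJoining, Definition 4.3 p. 20 (arXiv v5)] -/
private theorem isHdCut_sub_period₃ {M j : ℕ} {v : ℕ → Site 2} (hM : 5 ≤ M) (hper : ∀ i, v (i + 2 * M) = v i)
    (h : IsHdCut M v (j + 2 * M)) : IsHdCut M v j := by
  have h' : IsHdCut M (fun i => v (i + 2 * M)) j := isHdCut_shift hM (by rw [Nat.add_comm]; exact h)
  simp only [hper] at h'
  exact h'

/-- periodicity downwards (private plumbing). [cite: Hammond2015SAPJoining, Definition 4.3 p. 20 (arXiv v5)] -/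
private theorem isHdCut'_sub_period₃ {M j : ℕ} {v : ℕ → Site 2} (hM : 5 ≤ M) (hper : ∀ i, v (i + 2 * M) = v i)
    (h : IsHdCut' M v (j + 2 * M)) : IsHdCut' M v j := by
  have h' : IsHdCut' M (fun i => v (i + 2 * M)) j := isHdCut'_shift hM (by rw [Nat.add_comm]; exact h)
  simp only [hper] at h'
  exact h'

/-- periodicity downwards (private plumbing). [cite: Hammond2015SAPJoining, Definition 4.3 p. 20 (arXiv v5)] -/
private theorem isHdCutTF_sub_period₃ {M j : ℕ} {v : ℕ → Site 2} (hM : 5 ≤ M) (hper : ∀ i, v (i + 2 * M) = v i)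
    (h : IsHdCutTF M v (j + 2 * M)) : IsHdCutTF M v j := by
  have h' : IsHdCutTF M (fun i => v (i + 2 * M)) j := isHdCutTF_shift hM (by rw [Nat.add_comm]; exact h)
  simp only [hper] at h'
  exact h'

/-- periodicity downwards (private plumbing). [cite: Hammond2015SAPJoining, Definition 4.3 p. 20 (arXiv v5)] -/
private theorem isHdCutTF'_sub_period₃ {M j : ℕ} {v : ℕ → Site 2} (hM : 5 ≤ M) (hper : ∀ i, v (i + 2 * M) = v i)
    (h : IsHdCutTF' M v (j + 2 * M)) : IsHdCutTF' M v j := by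
  have h' : IsHdCutTF' M (fun i => v (i + 2 * M)) j := isHdCutTF'_shift hM (by rw [Nat.add_comm]; exact h)
  simp only [hper] at h'
  exact h'

/-- periodicity downwards (private plumbing). [cite: Hammond2015SAPJoining, Definition 4.3 p. 20 (arXiv v5)] -/
private theorem isHdCutFT_sub_period₃ {M j : ℕ} {v : ℕ → Site 2} (hM : 5 ≤ M) (hper : ∀ i, v (i + 2 * M) = v i)
    (h : IsHdCutFT M v (j + 2 * M)) : IsHdCutFT M v j := by
  have h' : IsHdCutFT M (fun i => v (i + 2 * M)) j := isHdCutFT_shift hM (by rw [Nat.add_comm]; exact h)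
  simp only [hper] at h'
  exact h'

/-- periodicity downwards (private plumbing). [cite: Hammond2015SAPJoining, Definition 4.3 p. 20 (arXiv v5)] -/
private theorem isHdCutFT'_sub_period₃ {M j : ℕ} {v : ℕ → Site 2} (hM : 5 ≤ M) (hper : ∀ i, v (i + 2 * M) = v i)
    (h : IsHdCutFT' M v (j + 2 * M)) : IsHdCutFT' M v j := by
  have h' : IsHdCutFT' M (fun i => v (i + 2 * M)) j := isHdCutFT'_shift hM (by rw [Nat.add_comm]; exact h)
  simp only [hper] at h'
  exact h'

/-- periodicity downwards (private plumbing). [cite: Hammond2015SAPJoining, Definition 4.3 p. 20 (arXiv v5)] -/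
private theorem isHdCutTT_sub_period₃ {M j : ℕ} {v : ℕ → Site 2} (hM : 4 ≤ M) (hper : ∀ i, v (i + 2 * M) = v i)
    (h : IsHdCutTT M v (j + 2 * M)) : IsHdCutTT M v j := by
  have h' : IsHdCutTT M (fun i => v (i + 2 * M)) j := isHdCutTT_shift hM (by rw [Nat.add_comm]; exact h)
  simp only [hper] at h'
  exact h'

/-- periodicity downwards (private plumbing). [cite: Hammond2015SAPJoining, Definition 4.3 p. 20 (arXiv v5)] -/
private theorem isHdCutTT'_sub_period₃ {M j : ℕ} {v : ℕ → Site 2} (hM : 4 ≤ M) (hper : ∀ i, v (i + 2 * M) = v i)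
    (h : IsHdCutTT' M v (j + 2 * M)) : IsHdCutTT' M v j := by
  have h' : IsHdCutTT' M (fun i => v (i + 2 * M)) j := isHdCutTT'_shift hM (by rw [Nat.add_comm]; exact h)
  simp only [hper] at h'
  exact h'

/-- **Junction uniqueness for the horizontal double brick, same polygon, shape FF** (`d = 0`): two T3 decompositions of the same joined
polygon of corridor-separated `n`-gon pairs, both of shape FF, have the same contact site.
[cite: Hammond2015SAPJoining, §4.2 pp. 20–24 (arXiv v5: the junction plaquette is determined); Madras1995LatticeAnimalsExponent, §2] -/
theorem hdJoin_site_unique_FF {P' Q' : Finset (Sym2 (Site 2))} {t' : Site 2}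
    (hP : IsPolygon brickWallGraph P) (hQ : IsPolygon brickWallGraph Q) (hP' : IsPolygon brickWallGraph P') (hQ' : IsPolygon brickWallGraph Q')
    (hPn : #P = n) (hQn : #Q = n) (hP'n : #P' = n) (hQ'n : #Q' = n) (hn : 3 ≤ n) (hK1 : Corridor P Q) (hK1' : Corridor P' Q')
    (h : IsT3 P Q t) (h' : IsT3 P' Q' t') (hjP : t + ![-1, 1] ∉ vertsOf P) (hjP' : t' + ![-1, 1] ∉ vertsOf P')
    (hjQ : t + ![3, 0] ∉ vertsOf Q) (hjQ' : t' + ![3, 0] ∉ vertsOf Q') (hJ : hdJoin t' P' Q' = hdJoin t P Q) : t' = t := by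
  classical
  have hdisj := disjoint_of_corridor (P := P) (Q := Q) hK1
  obtain ⟨hJpoly, hJc⟩ := h.isPolygon_join hP hQ hdisj
  have hcard : #(hdJoin t P Q) = 2 * n + 6 := by rw [if_neg hjP, if_neg hjQ, hPn, hQn] at hJc; omega
  have cA : s(t + ![-1, 1], t + ![-1, 0]) ∈ hdJoin t P Q := by rw [Sym2.eq_swap]; exact cJb₃ h hjP
  obtain ⟨u, hu, hu0, hu1⟩ := hJpoly.exists_isPolyTraversal cA
  rw [hcard] at hu
  have hrow : ∀ i, u (i + 1) 1 ≤ u i 1 + 1 ∧ u i 1 ≤ u (i + 1) 1 + 1 := row_step_le_of_adj hu.adj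
  have hper : ∀ i, u (i + 2 * (n + 3)) = u i := fun i => by rw [show 2 * (n + 3) = 2 * n + 6 by ring]; exact hu.periodic i
  -- cut of decomposition 1 at index 1
  have cut1 := isHdCut_of_isT3 hP hQ hPn hQn hn hK1 h hjP hjQ hu (i := 0) hu0 (by simpa using hu1)
  simp only [Nat.zero_add] at cut1
  -- locate decomposition 2's anchor bond on the traversal
  have cA' : s(t' + ![-1, 1], t' + ![-1, 0]) ∈ hdJoin t P Q := by rw [← hJ, Sym2.eq_swap]; exact cJb₃ h' hjP'
  obtain ⟨i, hi, hie⟩ := hu.surj _ cA'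
  have hu' : IsPolyTraversal brickWallGraph (hdJoin t' P' Q') (2 * n + 6) u := by rw [hJ]; exact hu
  rcases Sym2.eq_iff.1 hie with ⟨ha, hb⟩ | ⟨ha, hb⟩
  · -- same orientation: forward cut at `i + 1`; uniqueness forces `i = 0`
    have cut2 := isHdCut_of_isT3 hP' hQ' hP'n hQ'n hn hK1' h' hjP' hjQ' hu' (i := i) ha hb
    rcases Nat.lt_or_ge (i + 1) (2 * (n + 3)) with hlt | hge
    · have := isHdCut_unique (by omega) hper hrow (by omega) hlt cut1 cut2
      have e : u 1 = u (i + 1) := by rw [← this]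
      rw [hu1, hb] at e
      exact (add_right_cancel e).symm
    · have hi' : i + 1 = 0 + 2 * (n + 3) := by omega
      rw [hi'] at cut2
      have := isHdCut_unique (by omega) hper hrow (by omega) (by omega) cut1 (isHdCut_sub_period₃ (by omega) hper cut2)
      omega
  · -- opposite orientation: a backward cut at `i + 1` next to the forward cut at `1` — impossible
    exfalso
    have cut2 := isHdCut'_of_isT3 hP' hQ' hP'n hQ'n hn hK1' h' hjP' hjQ' hu' (i := i) ha hb
    rcases Nat.lt_or_ge (i + 1) (2 * (n + 3)) with hlt | hge
    · exact not_isHdCut'_of_isHdCut (by omega) hper hrow (by omega) hlt cut1 cut2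
    · have hi' : i + 1 = 0 + 2 * (n + 3) := by omega
      rw [hi'] at cut2
      exact not_isHdCut'_of_isHdCut (by omega) hper hrow (by omega) (by omega) cut1 (isHdCut'_sub_period₃ (by omega) hper cut2)

/-- **Junction uniqueness for the horizontal double brick, same polygon, shape TF** (`d = 0`): two T3 decompositions of the same joined
polygon of corridor-separated `n`-gon pairs, both of shape TF, have the same contact site.
[cite: Hammond2015SAPJoining, §4.2 pp. 20–24 (arXiv v5: the junction plaquette is determined); Madras1995LatticeAnimalsExponent, §2] -/
theorem hdJoin_site_unique_TF {P' Q' : Finset (Sym2 (Site 2))} {t' : Site 2}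
    (hP : IsPolygon brickWallGraph P) (hQ : IsPolygon brickWallGraph Q) (hP' : IsPolygon brickWallGraph P') (hQ' : IsPolygon brickWallGraph Q')
    (hPn : #P = n) (hQn : #Q = n) (hP'n : #P' = n) (hQ'n : #Q' = n) (hn : 3 ≤ n) (hK1 : Corridor P Q) (hK1' : Corridor P' Q')
    (h : IsT3 P Q t) (h' : IsT3 P' Q' t') (hjP : t + ![-1, 1] ∈ vertsOf P) (hjP' : t' + ![-1, 1] ∈ vertsOf P')
    (hjQ : t + ![3, 0] ∉ vertsOf Q) (hjQ' : t' + ![3, 0] ∉ vertsOf Q') (hJ : hdJoin t' P' Q' = hdJoin t P Q) : t' = t := by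
  classical
  have hdisj := disjoint_of_corridor (P := P) (Q := Q) hK1
  obtain ⟨hJpoly, hJc⟩ := h.isPolygon_join hP hQ hdisj
  have hcard : #(hdJoin t P Q) = 2 * n + 4 := by rw [if_pos hjP, if_neg hjQ, hPn, hQn] at hJc; omega
  have cA : s(t + ![0, 1], t + ![-1, 1]) ∈ hdJoin t P Q := by rw [Sym2.eq_swap]; exact cJ4₃ h
  obtain ⟨u, hu, hu0, hu1⟩ := hJpoly.exists_isPolyTraversal cA
  rw [hcard] at hu
  have hrow : ∀ i, u (i + 1) 1 ≤ u i 1 + 1 ∧ u i 1 ≤ u (i + 1) 1 + 1 := row_step_le_of_adj hu.adj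
  have hper : ∀ i, u (i + 2 * (n + 2)) = u i := fun i => by rw [show 2 * (n + 2) = 2 * n + 4 by ring]; exact hu.periodic i
  -- cut of decomposition 1 at index 1
  have cut1 := isHdCutTF_of_isT3 hP hQ hPn hQn hn hK1 h hjP hjQ hu (i := 0) hu0 (by simpa using hu1)
  simp only [Nat.zero_add] at cut1
  -- locate decomposition 2's anchor bond on the traversal
  have cA' : s(t' + ![0, 1], t' + ![-1, 1]) ∈ hdJoin t P Q := by rw [← hJ, Sym2.eq_swap]; exact cJ4₃ h'
  obtain ⟨i, hi, hie⟩ := hu.surj _ cA'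
  have hu' : IsPolyTraversal brickWallGraph (hdJoin t' P' Q') (2 * n + 4) u := by rw [hJ]; exact hu
  rcases Sym2.eq_iff.1 hie with ⟨ha, hb⟩ | ⟨ha, hb⟩
  · -- same orientation: forward cut at `i + 1`; uniqueness forces `i = 0`
    have cut2 := isHdCutTF_of_isT3 hP' hQ' hP'n hQ'n hn hK1' h' hjP' hjQ' hu' (i := i) ha hb
    rcases Nat.lt_or_ge (i + 1) (2 * (n + 2)) with hlt | hge
    · have := isHdCutTF_unique (by omega) hper hrow (by omega) hlt cut1 cut2
      have e : u 1 = u (i + 1) := by rw [← this]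
      rw [hu1, hb] at e
      exact (add_right_cancel e).symm
    · have hi' : i + 1 = 0 + 2 * (n + 2) := by omega
      rw [hi'] at cut2
      have := isHdCutTF_unique (by omega) hper hrow (by omega) (by omega) cut1 (isHdCutTF_sub_period₃ (by omega) hper cut2)
      omega
  · -- opposite orientation: a backward cut at `i + 1` next to the forward cut at `1` — impossible
    exfalso
    have cut2 := isHdCutTF'_of_isT3 hP' hQ' hP'n hQ'n hn hK1' h' hjP' hjQ' hu' (i := i) ha hb
    rcases Nat.lt_or_ge (i + 1) (2 * (n + 2)) with hlt | hge
    · exact not_isHdCutTF'_of_isHdCutTF (by omega) hper hrow (by omega) hlt cut1 cut2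
    · have hi' : i + 1 = 0 + 2 * (n + 2) := by omega
      rw [hi'] at cut2
      exact not_isHdCutTF'_of_isHdCutTF (by omega) hper hrow (by omega) (by omega) cut1 (isHdCutTF'_sub_period₃ (by omega) hper cut2)

/-- **Junction uniqueness for the horizontal double brick, same polygon, shape FT** (`d = 0`): two T3 decompositions of the same joined
polygon of corridor-separated `n`-gon pairs, both of shape FT, have the same contact site.
[cite: Hammond2015SAPJoining, §4.2 pp. 20–24 (arXiv v5: the junction plaquette is determined); Madras1995LatticeAnimalsExponent, §2] -/
theorem hdJoin_site_unique_FT {P' Q' : Finset (Sym2 (Site 2))} {t' : Site 2}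
    (hP : IsPolygon brickWallGraph P) (hQ : IsPolygon brickWallGraph Q) (hP' : IsPolygon brickWallGraph P') (hQ' : IsPolygon brickWallGraph Q')
    (hPn : #P = n) (hQn : #Q = n) (hP'n : #P' = n) (hQ'n : #Q' = n) (hn : 3 ≤ n) (hK1 : Corridor P Q) (hK1' : Corridor P' Q')
    (h : IsT3 P Q t) (h' : IsT3 P' Q' t') (hjP : t + ![-1, 1] ∉ vertsOf P) (hjP' : t' + ![-1, 1] ∉ vertsOf P')
    (hjQ : t + ![3, 0] ∈ vertsOf Q) (hjQ' : t' + ![3, 0] ∈ vertsOf Q') (hJ : hdJoin t' P' Q' = hdJoin t P Q) : t' = t := by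
  classical
  have hdisj := disjoint_of_corridor (P := P) (Q := Q) hK1
  obtain ⟨hJpoly, hJc⟩ := h.isPolygon_join hP hQ hdisj
  have hcard : #(hdJoin t P Q) = 2 * n + 4 := by rw [if_neg hjP, if_pos hjQ, hPn, hQn] at hJc; omega
  have cA : s(t + ![-1, 1], t + ![-1, 0]) ∈ hdJoin t P Q := by rw [Sym2.eq_swap]; exact cJb₃ h hjP
  obtain ⟨u, hu, hu0, hu1⟩ := hJpoly.exists_isPolyTraversal cA
  rw [hcard] at hu
  have hrow : ∀ i, u (i + 1) 1 ≤ u i 1 + 1 ∧ u i 1 ≤ u (i + 1) 1 + 1 := row_step_le_of_adj hu.adj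
  have hper : ∀ i, u (i + 2 * (n + 2)) = u i := fun i => by rw [show 2 * (n + 2) = 2 * n + 4 by ring]; exact hu.periodic i
  -- cut of decomposition 1 at index 1
  have cut1 := isHdCutFT_of_isT3 hP hQ hPn hQn hn hK1 h hjP hjQ hu (i := 0) hu0 (by simpa using hu1)
  simp only [Nat.zero_add] at cut1
  -- locate decomposition 2's anchor bond on the traversal
  have cA' : s(t' + ![-1, 1], t' + ![-1, 0]) ∈ hdJoin t P Q := by rw [← hJ, Sym2.eq_swap]; exact cJb₃ h' hjP'
  obtain ⟨i, hi, hie⟩ := hu.surj _ cA'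
  have hu' : IsPolyTraversal brickWallGraph (hdJoin t' P' Q') (2 * n + 4) u := by rw [hJ]; exact hu
  rcases Sym2.eq_iff.1 hie with ⟨ha, hb⟩ | ⟨ha, hb⟩
  · -- same orientation: forward cut at `i + 1`; uniqueness forces `i = 0`
    have cut2 := isHdCutFT_of_isT3 hP' hQ' hP'n hQ'n hn hK1' h' hjP' hjQ' hu' (i := i) ha hb
    rcases Nat.lt_or_ge (i + 1) (2 * (n + 2)) with hlt | hge
    · have := isHdCutFT_unique (by omega) hper hrow (by omega) hlt cut1 cut2
      have e : u 1 = u (i + 1) := by rw [← this]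
      rw [hu1, hb] at e
      exact (add_right_cancel e).symm
    · have hi' : i + 1 = 0 + 2 * (n + 2) := by omega
      rw [hi'] at cut2
      have := isHdCutFT_unique (by omega) hper hrow (by omega) (by omega) cut1 (isHdCutFT_sub_period₃ (by omega) hper cut2)
      omega
  · -- opposite orientation: a backward cut at `i + 1` next to the forward cut at `1` — impossible
    exfalso
    have cut2 := isHdCutFT'_of_isT3 hP' hQ' hP'n hQ'n hn hK1' h' hjP' hjQ' hu' (i := i) ha hb
    rcases Nat.lt_or_ge (i + 1) (2 * (n + 2)) with hlt | hge
    · exact not_isHdCutFT'_of_isHdCutFT (by omega) hper hrow (by omega) hlt cut1 cut2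
    · have hi' : i + 1 = 0 + 2 * (n + 2) := by omega
      rw [hi'] at cut2
      exact not_isHdCutFT'_of_isHdCutFT (by omega) hper hrow (by omega) (by omega) cut1 (isHdCutFT'_sub_period₃ (by omega) hper cut2)

/-- **Junction uniqueness for the horizontal double brick, same polygon, shape TT** (`d = 0`): two T3 decompositions of the same joined
polygon of corridor-separated `n`-gon pairs, both of shape TT, have the same contact site.
[cite: Hammond2015SAPJoining, §4.2 pp. 20–24 (arXiv v5: the junction plaquette is determined); Madras1995LatticeAnimalsExponent, §2] -/
theorem hdJoin_site_unique_TT {P' Q' : Finset (Sym2 (Site 2))} {t' : Site 2}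
    (hP : IsPolygon brickWallGraph P) (hQ : IsPolygon brickWallGraph Q) (hP' : IsPolygon brickWallGraph P') (hQ' : IsPolygon brickWallGraph Q')
    (hPn : #P = n) (hQn : #Q = n) (hP'n : #P' = n) (hQ'n : #Q' = n) (hn : 3 ≤ n) (hK1 : Corridor P Q) (hK1' : Corridor P' Q')
    (h : IsT3 P Q t) (h' : IsT3 P' Q' t') (hjP : t + ![-1, 1] ∈ vertsOf P) (hjP' : t' + ![-1, 1] ∈ vertsOf P')
    (hjQ : t + ![3, 0] ∈ vertsOf Q) (hjQ' : t' + ![3, 0] ∈ vertsOf Q') (hJ : hdJoin t' P' Q' = hdJoin t P Q) : t' = t := by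
  classical
  have hdisj := disjoint_of_corridor (P := P) (Q := Q) hK1
  obtain ⟨hJpoly, hJc⟩ := h.isPolygon_join hP hQ hdisj
  have hcard : #(hdJoin t P Q) = 2 * n + 2 := by rw [if_pos hjP, if_pos hjQ, hPn, hQn] at hJc; omega
  have cA : s(t + ![0, 1], t + ![-1, 1]) ∈ hdJoin t P Q := by rw [Sym2.eq_swap]; exact cJ4₃ h
  obtain ⟨u, hu, hu0, hu1⟩ := hJpoly.exists_isPolyTraversal cA
  rw [hcard] at hu
  have hrow : ∀ i, u (i + 1) 1 ≤ u i 1 + 1 ∧ u i 1 ≤ u (i + 1) 1 + 1 := row_step_le_of_adj hu.adj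
  have hper : ∀ i, u (i + 2 * (n + 1)) = u i := fun i => by rw [show 2 * (n + 1) = 2 * n + 2 by ring]; exact hu.periodic i
  -- cut of decomposition 1 at index 1
  have cut1 := isHdCutTT_of_isT3 hP hQ hPn hQn hn hK1 h hjP hjQ hu (i := 0) hu0 (by simpa using hu1)
  simp only [Nat.zero_add] at cut1
  -- locate decomposition 2's anchor bond on the traversal
  have cA' : s(t' + ![0, 1], t' + ![-1, 1]) ∈ hdJoin t P Q := by rw [← hJ, Sym2.eq_swap]; exact cJ4₃ h'
  obtain ⟨i, hi, hie⟩ := hu.surj _ cA'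
  have hu' : IsPolyTraversal brickWallGraph (hdJoin t' P' Q') (2 * n + 2) u := by rw [hJ]; exact hu
  rcases Sym2.eq_iff.1 hie with ⟨ha, hb⟩ | ⟨ha, hb⟩
  · -- same orientation: forward cut at `i + 1`; uniqueness forces `i = 0`
    have cut2 := isHdCutTT_of_isT3 hP' hQ' hP'n hQ'n hn hK1' h' hjP' hjQ' hu' (i := i) ha hb
    rcases Nat.lt_or_ge (i + 1) (2 * (n + 1)) with hlt | hge
    · have := isHdCutTT_unique (by omega) hper hrow (by omega) hlt cut1 cut2
      have e : u 1 = u (i + 1) := by rw [← this]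
      rw [hu1, hb] at e
      exact (add_right_cancel e).symm
    · have hi' : i + 1 = 0 + 2 * (n + 1) := by omega
      rw [hi'] at cut2
      have := isHdCutTT_unique (by omega) hper hrow (by omega) (by omega) cut1 (isHdCutTT_sub_period₃ (by omega) hper cut2)
      omega
  · -- opposite orientation: a backward cut at `i + 1` next to the forward cut at `1` — impossible
    exfalso
    have cut2 := isHdCutTT'_of_isT3 hP' hQ' hP'n hQ'n hn hK1' h' hjP' hjQ' hu' (i := i) ha hb
    rcases Nat.lt_or_ge (i + 1) (2 * (n + 1)) with hlt | hge
    · exact not_isHdCutTT'_of_isHdCutTT (by omega) hper hrow (by omega) hlt cut1 cut2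
    · have hi' : i + 1 = 0 + 2 * (n + 1) := by omega
      rw [hi'] at cut2
      exact not_isHdCutTT'_of_isHdCutTT (by omega) hper hrow (by omega) (by omega) cut1 (isHdCutTT'_sub_period₃ (by omega) hper cut2)


/-- **Junction uniqueness for the horizontal double brick, same polygon** (`d = 0`), the two decompositions having the same bits.
[cite: Hammond2015SAPJoining, §4.2 pp. 20–24 (arXiv v5: the junction plaquette is determined); Madras1995LatticeAnimalsExponent, §2] -/
theorem hdJoin_site_unique {P' Q' : Finset (Sym2 (Site 2))} {t' : Site 2}
    (hP : IsPolygon brickWallGraph P) (hQ : IsPolygon brickWallGraph Q) (hP' : IsPolygon brickWallGraph P') (hQ' : IsPolygon brickWallGraph Q')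
    (hPn : #P = n) (hQn : #Q = n) (hP'n : #P' = n) (hQ'n : #Q' = n) (hn : 3 ≤ n) (hK1 : Corridor P Q) (hK1' : Corridor P' Q')
    (h : IsT3 P Q t) (h' : IsT3 P' Q' t') (hbP : t + ![-1, 1] ∈ vertsOf P ↔ t' + ![-1, 1] ∈ vertsOf P')
    (hbQ : t + ![3, 0] ∈ vertsOf Q ↔ t' + ![3, 0] ∈ vertsOf Q') (hJ : hdJoin t' P' Q' = hdJoin t P Q) : t' = t := by
  by_cases hjP : t + ![-1, 1] ∈ vertsOf P
  · by_cases hjQ : t + ![3, 0] ∈ vertsOf Q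
    · exact hdJoin_site_unique_TT hP hQ hP' hQ' hPn hQn hP'n hQ'n hn hK1 hK1' h h' hjP (hbP.1 hjP) hjQ (hbQ.1 hjQ) hJ
    · exact hdJoin_site_unique_TF hP hQ hP' hQ' hPn hQn hP'n hQ'n hn hK1 hK1' h h' hjP (hbP.1 hjP) hjQ (fun hh => hjQ (hbQ.2 hh)) hJ
  · by_cases hjQ : t + ![3, 0] ∈ vertsOf Q
    · exact hdJoin_site_unique_FT hP hQ hP' hQ' hPn hQn hP'n hQ'n hn hK1 hK1' h h' hjP (fun hh => hjP (hbP.2 hh)) hjQ (hbQ.1 hjQ) hJ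
    · exact hdJoin_site_unique_FF hP hQ hP' hQ' hPn hQn hP'n hQ'n hn hK1 hK1' h h' hjP (fun hh => hjP (hbP.2 hh)) hjQ
        (fun hh => hjQ (hbQ.2 hh)) hJ

/-! ### Translation and `JU3` -/

/-- a bond translated (private plumbing). [folklore] -/
private theorem mem_shift_of_mem₃ {E : Finset (Sym2 (Site 2))} {a b d : Site 2} (h : s(a, b) ∈ E) : s(a + d, b + d) ∈ shiftEdges d E :=
  mem_shiftEdges_iff.2 ⟨_, h, by rw [Sym2.map_mk]⟩

/-- offsets commute with the translation (private plumbing). [folklore] -/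
private theorem add_off₃ (t d v : Site 2) : t + d + v = t + v + d := add_right_comm t d v

/-- the corridor fact is translation-invariant (private copy of `Corridor.shift`). [cite: Hammond2015SAPJoining, §4.1 pp. 17–18 (arXiv v5)] -/
private theorem corridor_shift₃ (hK1 : Corridor P Q) (d : Site 2) : Corridor (shiftEdges d P) (shiftEdges d Q) := by
  intro p hp q hq hrow
  rw [mem_vertsOf_shiftEdges] at hp hq
  have := hK1 _ hp _ hq (by simp only [Pi.sub_apply]; omega)
  simp only [Pi.sub_apply] at this
  omega

/-- vertices of a translated edge set, offset form (private plumbing). [folklore] -/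
private theorem mem_vertsOf_shift_iff₃ {E : Finset (Sym2 (Site 2))} {v d : Site 2} :
    t + d + v ∈ vertsOf (shiftEdges d E) ↔ t + v ∈ vertsOf E := by
  rw [mem_vertsOf_shiftEdges, add_off₃, add_sub_cancel_right]

/-- The T3 bundle is covariant under EVEN translations. [cite: Hammond2015SAPJoining, Definition 4.3 p. 20 (arXiv v5)] -/
theorem isT3_shift (h : IsT3 P Q t) {d : Site 2} (hd : (d 0 + d 1) % 2 = 0) : IsT3 (shiftEdges d P) (shiftEdges d Q) (t + d) := by
  have nv : ∀ {E : Finset (Sym2 (Site 2))} {v : Site 2}, t + v ∉ vertsOf E → t + d + v ∉ vertsOf (shiftEdges d E) :=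
    fun {E} {v} hv hh => hv (mem_vertsOf_shift_iff₃.1 hh)
  refine ⟨?_, ?_, ?_, ⟨nv h.f10.1, nv h.f10.2⟩, ⟨nv h.f20.1, nv h.f20.2⟩, ⟨nv h.f01.1, nv h.f01.2⟩, ⟨nv h.f11.1, nv h.f11.2⟩, nv h.f30,
    nv h.fm1⟩
  · have := h.hpar; simp only [Pi.add_apply]; omega
  · rw [add_off₃, add_off₃ t d]; exact mem_shift_of_mem₃ h.hl
  · rw [add_off₃, add_off₃ t d]; exact mem_shift_of_mem₃ h.hr

/-- The horizontal double-brick join is covariant under translations. [cite: Hammond2015SAPJoining, Definition 4.3 p. 20 (arXiv v5)] -/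
theorem hdJoin_shift (P Q : Finset (Sym2 (Site 2))) (t d : Site 2) :
    hdJoin (t + d) (shiftEdges d P) (shiftEdges d Q) = shiftEdges d (hdJoin t P Q) := by
  classical
  rw [hdJoin, hdJoin, hdBoundary_eq, hdBoundary_eq, bdry_add]
  unfold shiftEdges
  rw [Finset.image_symmDiff _ _ (Sym2.map.injective (add_left_injective d)), Finset.image_union]

/-- **`JU3` holds**: junction uniqueness for the horizontal double-brick join (type T3, both sub-case bits shared). [cite: Hammond2015SAPJoining, §4.2 pp. 20–24 (arXiv v5: the junction plaquette is determined by the joined polygon); Madras1995LatticeAnimalsExponent, §2] -/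
theorem ju3 : JU3 := by
  intro P Q P' Q' t t' d n hP hQ hP' hQ' hPn hQn hP'n hQ'n hK1 hK1' h h' hbP hbQ hJ
  classical
  have hdisj := disjoint_of_corridor (P := P) (Q := Q) hK1
  have hn : 3 ≤ n := by
    obtain ⟨w, c, hc, hcE⟩ := hP
    rw [← hPn, ← hcE, List.toFinset_card_of_nodup hc.edges_nodup, Walk.length_edges]; exact hc.three_le_length
  by_cases hd : (d 0 + d 1) % 2 = 0
  · have hPd := PolygonConcat.isPolygon_shiftEdges_of_even hP hd
    have hQd := PolygonConcat.isPolygon_shiftEdges_of_even hQ hd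
    exact hdJoin_site_unique (P := shiftEdges d P) (Q := shiftEdges d Q) (t := t + d) (n := n) hPd hQd hP' hQ'
      (by rw [card_shiftEdges, hPn]) (by rw [card_shiftEdges, hQn]) hP'n hQ'n hn (corridor_shift₃ hK1 d) hK1' (isT3_shift h hd) h'
      (mem_vertsOf_shift_iff₃.trans hbP) (mem_vertsOf_shift_iff₃.trans hbQ) (by rw [hJ, hdJoin_shift])
  · -- `d` odd is impossible: the vertical bond `t – t−(0,1)` of `P ⊆ J` would translate to a non-bond of the brick wall in `J'`
    exfalso
    have cv : s(t + ![0, 0], t + ![0, -1]) ∈ hdJoin t P Q := tdownJ₃ hP hK1 h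
    have hmemJ' : s(t + ![0, 0] + d, t + ![0, -1] + d) ∈ hdJoin t' P' Q' := by rw [hJ]; exact mem_shift_of_mem₃ cv
    have hdisj' := disjoint_of_corridor (P := P') (Q := Q') hK1'
    have hJ'poly := (h'.isPolygon_join hP' hQ' hdisj').1
    have hadj : brickWallGraph.Adj (t + ![0, 0] + d) (t + ![0, -1] + d) := IsPolygon.mem_edgeSet hJ'poly hmemJ'
    rw [brickWallGraph_adj_coord] at hadj
    have ht := h.hpar
    simp only [Pi.add_apply] at hadj
    simp at hadj
    omega

end Assembly

end HexBW

end Literature.Probability.RandomPlanarGeometry.SAW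

end

/-! ## `_holds` aliases (appended 2026-08-28)

The named fact(s) below are already theorems of the tree under another name; the `_holds`
alias records the discharge under the tree's naming convention (D-0026 bookkeeping: proof term =
the existing theorem, no statement or definition edited). -/

/-- `JU3` is a theorem of the tree (`Literature.Probability.RandomPlanarGeometry.SAW.HexBW.Assembly.ju3`). [cite: Hammond2015SAPJoining, §4.2 pp. 20–24 (arXiv v5); Madras1995LatticeAnimalsExponent, §2] -/
theorem _root_.Literature.Probability.RandomPlanarGeometry.SAW.HexBW.Assembly.JU3_holds : _root_.Literature.Probability.RandomPlanarGeometry.SAW.HexBW.Assembly.JU3 :=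
  _root_.Literature.Probability.RandomPlanarGeometry.SAW.HexBW.Assembly.ju3
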